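import Literature.Analysis.FluidPDE.CKNLocalRegularityRRSRingCutoff
import Literature.Analysis.FluidPDE.CKNLocalRegularityRRSStep3
import Literature.Analysis.FluidPDE.CKNLocalRegularityRRSCutoff
import Literature.Analysis.FluidPDE.SlicedLocalEnergyIntegrable
import Literature.Analysis.FluidPDE.SuitableWeakSliced
import HarnessLib

/-!
# Robinson–Rodrigo–Sadowski, Theorem 15.3: Step 2 of the induction, proved

Analysis/FluidPDE file **discharging the target `RRS2016.step2_force`** of
`CKNLocalRegularityRRS.lean` (Step 2 of the proof of RRS 2016, Theorem 15.3, with the force term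
of CKN (2.5)): `{(A_k) : 1 ≤ k ≤ n} ⟹ (B_{n+1})`, and hence, with the already proved Steps 1, 3, 4
and Lemma 15.11, reducing Theorem 15.3 (force version) to the local pressure estimate alone:

* `RRS2016.step2_force_holds : step2_force`;
* `RRS2016.theorem15_3_force_of_lemma15_12 : lemma15_12 → theorem15_3_force`,
  `RRS2016.theorem15_3_of_lemma15_12 : lemma15_12 → theorem15_3`.

## The printed argument (RRS pp. 221–223) and its formalisation

"Choosing `φ = φ_n` in the local energy inequality
`∫ |u(s)|² φ(s) + 2 ∫∫_{<s} |∇u|² φ ≤ ∫∫_{<s} |u|² (∂ₜφ + Δφ) + ∫∫_{<s} (|u|² + 2p) u·∇φ`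
we obtain `C₁⁻¹ r_n⁻¹ sup_{s-r_n²<t<s} ∫_{B_{r_n}} |u(t)|² + C₁⁻¹ r_n⁻¹ ∫∫_{Q_{r_n}} |∇u|² ≤
I₁ + I₂ + I₃` (15.23), `I₁ ≤ C₁ ε₀^{2/3} r_n²` (15.15), `I₂ ≤ 24 C₁ ε₀^{2/3} r_n²` (15.16)", and
`I₃` is handled by the telescoping cut-offs `χ_k` and (15.24) (`∫ α u·∇φ = 0` for divergence-free
`u`), subtracting the means `(p)_{r_k}` and using `(A_k)` on each `Q_{r_k}`.

Formalisation (weak setting of `RRS2016.IsSuitablePair` on `Q_1(z₀)`, `z ∈ Q_{1/2}(z₀)`,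
`φ = φ_{n+1}` from the proved `lemma15_11`, `r = r_{n+1}`):

1. *Sliced inequality.* `IsSuitablePair.ae_localEnergy_slice_of_forall_lt`: the local energy
   inequality against `θ_j(t) φ` (time cut-offs vanishing near `s`, where `φ` leaves `Q_1(z₀)`)
   and the accepted structure-free slicing `ae_localEnergy_slice_of_integrable` give, for a.e.
   `t < s`, `∫ |u(t)|² φ(t) + 2 ∫∫_{τ<t} |G|² φ ≤ ∫∫_{τ<t} R[φ]`.
2. *Claim R* (`setIntegral_localEnergyRHS_le`): for every `t < s`,
   `∫∫_{τ<t} R[φ] ≤ (C₁ + 24 C₁ + 4 c' C₁ + 48 C₁ κ (S_q + 1)) ε₀^{2/3} r²`, the four terms being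
   the quadratic term (via the smallness assumption, (15.15)), the cubic term over the dyadic
   rings ((15.16)), the pressure term (telescoping `presTest`, slice-wise divergence freedom
   `ae_integral_inner_gradient_presTest_eq_zero`, Fubini, Hölder with `(A_k)`:
   `Σ_k c' C₁ r² r_k⁻⁴ ε₀^{2/3} r_k^{14/3} ≤ 2 c' C₁ r² ε₀^{2/3}`), and the force term
   (`2 ∫∫ |f| |u| φ` over the rings with `|Q_ρ| ≤ 5ρ⁵`, `q > 5/2`, and the choice
   `κ(q) = 1/(48 (S_q + 1))`, `S_q ≥ Σ_j r_j^{2 - 5/q}`).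
3. *Conclusion.* The lower bound `φ ≥ C₁⁻¹ r⁻¹` on `Q_r(z)` turns the a.e. slice bound into
   `cknAEss r z u ≤ C₁ M` (essential supremum) and, letting `t ↑ s` through good times
   (`tendsto_setIntegral_of_monotone`), `cknE r z G ≤ C₁ M / 2`; `C_B = C₁² (39 + 6 c')`,
   `c' = 256 + 136 c_χ`.

All constants are absolute (given the absolute `C₁` of Lemma 15.11 and `c_χ` of the cut-offs);
`κ` depends only on `q`, as allowed by `step2_force`.

## References

* J. C. Robinson, J. L. Rodrigo, W. Sadowski, *The Three-Dimensional Navier–Stokes Equations*,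
  Cambridge Studies in Advanced Mathematics 157, CUP (2016), Theorem 15.3 and its proof,
  pp. 216–226. [RobinsonRodrigoSadowski2016]
* L. Caffarelli, R. Kohn, L. Nirenberg, *Partial regularity of suitable weak solutions of the
  Navier–Stokes equations*, Comm. Pure Appl. Math. 35 (1982), Proposition 1 and (2.5).
-/

noncomputable section

open MeasureTheory Set Function Filter Topology TopologicalSpace Metric
open scoped NNReal ENNReal InnerProductSpace RealInnerProductSpace Laplacian

namespace Literature.Analysis.FluidPDE

namespace RRS2016


section Helpers

/-- `|Q_ρ(z)| = ρ² · (4π/3) ρ³ ≤ 5 ρ⁵`. [folklore] -/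
theorem volume_parabolicCylinder_le {ρ : ℝ} (hρ : 0 ≤ ρ) (z : ℝ × EuclideanSpace ℝ (Fin 3)) :
    volume (parabolicCylinder ρ z) ≤ ENNReal.ofReal (5 * ρ ^ 5) := by
  rw [parabolicCylinder, Measure.volume_eq_prod, Measure.prod_prod, Real.volume_Ioo,
    EuclideanSpace.volume_ball_fin_three]
  have e : z.1 - (z.1 - ρ ^ 2) = ρ ^ 2 := by ring
  rw [e, ← ENNReal.ofReal_pow hρ, ← ENNReal.ofReal_mul (by positivity),
    ← ENNReal.ofReal_mul (by positivity)]
  refine ENNReal.ofReal_le_ofReal ?_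
  have hπ := Real.pi_lt_d2
  have h5 : 0 ≤ ρ ^ 5 := pow_nonneg hρ 5
  calc ρ ^ 2 * (ρ ^ 3 * (Real.pi * 4 / 3)) = (Real.pi * 4 / 3) * ρ ^ 5 := by ring
    _ ≤ 5 * ρ ^ 5 := by gcongr; linarith

/-- From `(A_k)`: `∫∫_{Q_{r_k}(z)} |u|³ ≤ ε₀^{2/3} r_k⁵`. [cite: RobinsonRodrigoSadowski2016, (15.21) p. 220] -/
theorem lintegral_cube_le_of_hypA {ε₀ : ℝ} {u : ℝ → EuclideanSpace ℝ (Fin 3) → EuclideanSpace ℝ (Fin 3)}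
    {p : ℝ → EuclideanSpace ℝ (Fin 3) → ℝ} {k : ℕ} {z : ℝ × EuclideanSpace ℝ (Fin 3)}
    (h : HypA ε₀ u p k z) :
    ∫⁻ w in parabolicCylinder (rad k) z, ‖u w.1 w.2‖ₑ ^ (3 : ℕ) ≤
      ENNReal.ofReal (ε₀ ^ (2 / 3 : ℝ) * rad k ^ 5) := by
  rw [lintegral_cube_eq_mul_cknC (rad_pos k)]
  calc ENNReal.ofReal (rad k) ^ 2 * cknC (rad k) z u
      ≤ ENNReal.ofReal (rad k) ^ 2 * ENNReal.ofReal (ε₀ ^ (2 / 3 : ℝ) * rad k ^ 3) := by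
        gcongr; exact le_self_add.trans h
    _ = ENNReal.ofReal (ε₀ ^ (2 / 3 : ℝ) * rad k ^ 5) := by
        rw [← ENNReal.ofReal_pow (rad_pos k).le, ← ENNReal.ofReal_mul (by positivity)]
        congr 1; ring

/-- From `(A_k)`: `∫∫_{Q_{r_k}(z)} |p - (p)_{r_k}|^{3/2} ≤ ε₀^{2/3} r_k^{9/2}`. [cite: RobinsonRodrigoSadowski2016, (15.21) p. 220] -/
theorem lintegral_presOsc_le_of_hypA {ε₀ : ℝ}
    {u : ℝ → EuclideanSpace ℝ (Fin 3) → EuclideanSpace ℝ (Fin 3)}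
    {p : ℝ → EuclideanSpace ℝ (Fin 3) → ℝ} {k : ℕ} {z : ℝ × EuclideanSpace ℝ (Fin 3)}
    (h : HypA ε₀ u p k z) :
    ∫⁻ w in parabolicCylinder (rad k) z, ‖p w.1 w.2 - ⨍ y in ball z.2 (rad k), p w.1 y‖ₑ ^ (3 / 2 : ℝ) ≤
      ENNReal.ofReal (ε₀ ^ (2 / 3 : ℝ) * (rad k) ^ (9 / 2 : ℝ)) := by
  have hr := rad_pos k
  set L := ∫⁻ w in parabolicCylinder (rad k) z,
    ‖p w.1 w.2 - ⨍ y in ball z.2 (rad k), p w.1 y‖ₑ ^ (3 / 2 : ℝ) with hL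
  have h0 : ENNReal.ofReal (rad k) ^ 2 ≠ 0 := pow_ne_zero _ (ENNReal.ofReal_pos.2 hr).ne'
  have htop : ENNReal.ofReal (rad k) ^ 2 ≠ ∞ := ENNReal.pow_ne_top ENNReal.ofReal_ne_top
  have hLD : L = ENNReal.ofReal (rad k) ^ 2 * cknDOsc (rad k) z p := by
    rw [cknDOsc, ← mul_assoc, ENNReal.mul_inv_cancel h0 htop, one_mul]
  have h2 : ENNReal.ofReal ((rad k) ^ (1 / 2 : ℝ)) * cknDOsc (rad k) z p ≤
      ENNReal.ofReal (ε₀ ^ (2 / 3 : ℝ) * rad k ^ 3) := le_add_self.trans h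
  have hs0 : ENNReal.ofReal ((rad k) ^ (1 / 2 : ℝ)) ≠ 0 :=
    (ENNReal.ofReal_pos.2 (Real.rpow_pos_of_pos hr _)).ne'
  have hD : cknDOsc (rad k) z p ≤
      ENNReal.ofReal (ε₀ ^ (2 / 3 : ℝ) * rad k ^ 3) / ENNReal.ofReal ((rad k) ^ (1 / 2 : ℝ)) := by
    rw [ENNReal.le_div_iff_mul_le (Or.inl hs0) (Or.inl ENNReal.ofReal_ne_top), mul_comm]
    exact h2
  rw [hLD]
  calc ENNReal.ofReal (rad k) ^ 2 * cknDOsc (rad k) z p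
      ≤ ENNReal.ofReal (rad k) ^ 2 *
          (ENNReal.ofReal (ε₀ ^ (2 / 3 : ℝ) * rad k ^ 3) / ENNReal.ofReal ((rad k) ^ (1 / 2 : ℝ))) := by
        gcongr
    _ = ENNReal.ofReal (ε₀ ^ (2 / 3 : ℝ) * (rad k) ^ (9 / 2 : ℝ)) := by
        rw [← ENNReal.ofReal_pow hr.le, ← ENNReal.ofReal_div_of_pos (Real.rpow_pos_of_pos hr _),
          ← ENNReal.ofReal_mul (by positivity)]
        congr 1
        have key : (rad k) ^ (9 / 2 : ℝ) * (rad k) ^ (1 / 2 : ℝ) = (rad k) ^ 5 := by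
          rw [← Real.rpow_add hr, show (9 / 2 : ℝ) + 1 / 2 = ((5 : ℕ) : ℝ) by norm_num,
            Real.rpow_natCast]
        rw [mul_div_assoc', div_eq_iff (Real.rpow_pos_of_pos hr _).ne', mul_assoc, key]
        ring

/-- Hölder with exponents `3` and `3/2`: `∫ F H ≤ (∫ F³)^{1/3} (∫ H^{3/2})^{2/3}`. [folklore] -/
theorem lintegral_mul_le_L3_L32 {α : Type*} [MeasurableSpace α] (μ : Measure α) {F H : α → ℝ≥0∞}
    (hF : AEMeasurable F μ) (hH : AEMeasurable H μ) :
    ∫⁻ a, F a * H a ∂μ ≤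
      (∫⁻ a, F a ^ (3 : ℕ) ∂μ) ^ (1 / 3 : ℝ) * (∫⁻ a, H a ^ (3 / 2 : ℝ) ∂μ) ^ (2 / 3 : ℝ) := by
  have hpq : (3 : ℝ).HolderConjugate (3 / 2) := Real.holderConjugate_iff.2 ⟨by norm_num, by norm_num⟩
  have H0 := ENNReal.lintegral_mul_le_Lp_mul_Lq μ hpq hF hH
  have e3 : ∀ a, F a ^ (3 : ℝ) = F a ^ (3 : ℕ) := fun a => by
    rw [show (3 : ℝ) = ((3 : ℕ) : ℝ) by norm_num, ENNReal.rpow_natCast]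
  simp only [Pi.mul_apply, e3] at H0
  have e : (1 / (3 / 2 : ℝ)) = 2 / 3 := by norm_num
  rw [e] at H0
  exact H0

/-- `L^{3/2}` by `L^q` on a set of finite measure: for `q > 3/2`,
`(∫_s F^{3/2})^{2/3} ≤ (∫_s F^q)^{1/q} μ(s)^{2/3 - 1/q}`. [folklore] -/
theorem lintegral_rpow32_rpow_le {α : Type*} [MeasurableSpace α] (μ : Measure α) (s : Set α)
    {F : α → ℝ≥0∞} (hF : AEMeasurable F (μ.restrict s)) {q : ℝ} (hq : 3 / 2 < q) :
    (∫⁻ a in s, F a ^ (3 / 2 : ℝ) ∂μ) ^ (2 / 3 : ℝ) ≤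
      (∫⁻ a in s, F a ^ q ∂μ) ^ (1 / q) * μ s ^ (2 / 3 - 1 / q : ℝ) := by
  have H := setLIntegral_rpow_le_rpow_mul_measure μ s hF (a := 3 / 2) (b := q) (by norm_num) hq
  have hq0 : q ≠ 0 := by positivity
  calc (∫⁻ a in s, F a ^ (3 / 2 : ℝ) ∂μ) ^ (2 / 3 : ℝ)
      ≤ ((∫⁻ a in s, F a ^ q ∂μ) ^ ((3 / 2 : ℝ) / q) * μ s ^ (1 - (3 / 2 : ℝ) / q)) ^ (2 / 3 : ℝ) :=
        ENNReal.rpow_le_rpow H (by norm_num)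
    _ = _ := by
        rw [ENNReal.mul_rpow_of_nonneg _ _ (by norm_num), ← ENNReal.rpow_mul, ← ENNReal.rpow_mul]
        congr 2
        · field_simp
        · field_simp

/-- The ring decomposition of `Q_{1/2}(z) = Q_{r_1}(z)`:
`Q_{r_1} ⊆ ⋃_{1 ≤ j ≤ n} (Q_{r_j} ∖ Q_{r_{j+1}}) ∪ Q_{r_{n+1}}`. [cite: RobinsonRodrigoSadowski2016, Figure 15.2 p. 218] -/
theorem parabolicCylinder_radOne_subset_rings (z : ℝ × EuclideanSpace ℝ (Fin 3)) (n : ℕ) :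
    parabolicCylinder (rad 1) z ⊆
      (⋃ j : ↥(Finset.Icc 1 n),
          parabolicCylinder (rad (j : ℕ)) z \ parabolicCylinder (rad ((j : ℕ) + 1)) z) ∪
        parabolicCylinder (rad (n + 1)) z := by
  intro w hw
  by_cases hcore : w ∈ parabolicCylinder (rad (n + 1)) z
  · exact Or.inr hcore
  refine Or.inl ?_
  have hP : ∃ m : ℕ, w ∉ parabolicCylinder (rad (m + 1)) z := ⟨n, hcore⟩
  classical
  set j := Nat.find hP with hj
  have hj1 : w ∉ parabolicCylinder (rad (j + 1)) z := Nat.find_spec hP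
  have hjle : j ≤ n := Nat.find_le hcore
  have hj0 : j ≠ 0 := by
    intro h0
    rw [h0, zero_add] at hj1
    exact hj1 hw
  have hj2 : w ∈ parabolicCylinder (rad j) z := by
    have := Nat.find_min hP (m := j - 1) (by omega)
    rw [show j - 1 + 1 = j by omega] at this
    exact not_not.1 this
  exact mem_iUnion.2 ⟨⟨j, Finset.mem_Icc.2 ⟨by omega, hjle⟩⟩, hj2, hj1⟩

/-- Integrated ring decomposition: `∫_{Q_{r_1}} g ≤ Σ_{1 ≤ j ≤ n} ∫_{Q_{r_j} ∖ Q_{r_{j+1}}} g + ∫_{Q_{r_{n+1}}} g`. [folklore] -/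
theorem lintegral_radOne_le_sum_rings (z : ℝ × EuclideanSpace ℝ (Fin 3)) (n : ℕ)
    (g : ℝ × EuclideanSpace ℝ (Fin 3) → ℝ≥0∞) :
    ∫⁻ w in parabolicCylinder (rad 1) z, g w ≤
      (∑ j ∈ Finset.Icc 1 n,
          ∫⁻ w in parabolicCylinder (rad j) z \ parabolicCylinder (rad (j + 1)) z, g w) +
        ∫⁻ w in parabolicCylinder (rad (n + 1)) z, g w := by
  calc ∫⁻ w in parabolicCylinder (rad 1) z, g w
      ≤ ∫⁻ w in (⋃ j : ↥(Finset.Icc 1 n),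
          parabolicCylinder (rad (j : ℕ)) z \ parabolicCylinder (rad ((j : ℕ) + 1)) z) ∪
            parabolicCylinder (rad (n + 1)) z, g w :=
        lintegral_mono_set (parabolicCylinder_radOne_subset_rings z n)
    _ ≤ (∫⁻ w in ⋃ j : ↥(Finset.Icc 1 n),
          parabolicCylinder (rad (j : ℕ)) z \ parabolicCylinder (rad ((j : ℕ) + 1)) z, g w) +
          ∫⁻ w in parabolicCylinder (rad (n + 1)) z, g w := lintegral_union_le _ _ _
    _ ≤ (∑' j : ↥(Finset.Icc 1 n),
          ∫⁻ w in parabolicCylinder (rad (j : ℕ)) z \ parabolicCylinder (rad ((j : ℕ) + 1)) z, g w) +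
          ∫⁻ w in parabolicCylinder (rad (n + 1)) z, g w := by
        gcongr; exact lintegral_iUnion_le _ _
    _ = _ := by
        rw [tsum_fintype]
        congr 1
        exact Finset.sum_coe_sort (Finset.Icc 1 n) (fun j : ℕ =>
          ∫⁻ w in parabolicCylinder (rad j) z \ parabolicCylinder (rad (j + 1)) z, g w)

/-- **Weighted ring estimate**: if the weight `W` is at most `a_j` on the ring `Q_{r_j} ∖ Q_{r_{j+1}}`
(`1 ≤ j ≤ n`) and at most `a_c` on the core `Q_{r_{n+1}}`, and `∫_{Q_{r_j}} g ≤ b_j`,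
`∫_{Q_{r_{n+1}}} g ≤ b_c`, then `∫_{Q_{r_1}} g W ≤ Σ_j a_j b_j + a_c b_c`. [cite: RobinsonRodrigoSadowski2016, pp. 218–219] -/
theorem lintegral_mul_weight_le_sum_rings (z : ℝ × EuclideanSpace ℝ (Fin 3)) {n : ℕ}
    {g W : ℝ × EuclideanSpace ℝ (Fin 3) → ℝ≥0∞} {a : ℕ → ℝ} {b : ℕ → ℝ≥0∞} {ac : ℝ} {bc : ℝ≥0∞}
    (hW : ∀ j ∈ Finset.Icc 1 n,
      ∀ w ∈ parabolicCylinder (rad j) z \ parabolicCylinder (rad (j + 1)) z, W w ≤ ENNReal.ofReal (a j))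
    (hWc : ∀ w ∈ parabolicCylinder (rad (n + 1)) z, W w ≤ ENNReal.ofReal ac)
    (hg : ∀ j ∈ Finset.Icc 1 n, ∫⁻ w in parabolicCylinder (rad j) z, g w ≤ b j)
    (hgc : ∫⁻ w in parabolicCylinder (rad (n + 1)) z, g w ≤ bc) :
    ∫⁻ w in parabolicCylinder (rad 1) z, g w * W w ≤
      (∑ j ∈ Finset.Icc 1 n, ENNReal.ofReal (a j) * b j) + ENNReal.ofReal ac * bc := by
  have hmeas : ∀ r : ℝ, MeasurableSet (parabolicCylinder r z) := fun r =>
    (isOpen_parabolicCylinder r z).measurableSet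
  refine (lintegral_radOne_le_sum_rings z n _).trans (add_le_add (Finset.sum_le_sum fun j hj => ?_) ?_)
  · calc ∫⁻ w in parabolicCylinder (rad j) z \ parabolicCylinder (rad (j + 1)) z, g w * W w
        ≤ ∫⁻ w in parabolicCylinder (rad j) z \ parabolicCylinder (rad (j + 1)) z,
            g w * ENNReal.ofReal (a j) :=
          setLIntegral_mono' ((hmeas _).diff (hmeas _)) fun w hw => by gcongr; exact hW j hj w hw
      _ ≤ ∫⁻ w in parabolicCylinder (rad j) z, g w * ENNReal.ofReal (a j) :=
          lintegral_mono_set fun w hw => hw.1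
      _ = (∫⁻ w in parabolicCylinder (rad j) z, g w) * ENNReal.ofReal (a j) :=
          lintegral_mul_const' _ _ ENNReal.ofReal_ne_top
      _ ≤ b j * ENNReal.ofReal (a j) := by gcongr; exact hg j hj
      _ = ENNReal.ofReal (a j) * b j := mul_comm _ _
  · calc ∫⁻ w in parabolicCylinder (rad (n + 1)) z, g w * W w
        ≤ ∫⁻ w in parabolicCylinder (rad (n + 1)) z, g w * ENNReal.ofReal ac :=
          setLIntegral_mono' (hmeas _) fun w hw => by gcongr; exact hWc w hw
      _ = (∫⁻ w in parabolicCylinder (rad (n + 1)) z, g w) * ENNReal.ofReal ac :=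
          lintegral_mul_const' _ _ ENNReal.ofReal_ne_top
      _ ≤ bc * ENNReal.ofReal ac := by gcongr
      _ = ENNReal.ofReal ac * bc := mul_comm _ _

/-- `Σ_{1 ≤ j ≤ n} r_j = 1 - r_n ≤ 1`. [folklore] -/
theorem sum_Icc_rad_le_one (n : ℕ) : ∑ j ∈ Finset.Icc 1 n, rad j ≤ 1 := by
  have h : ∀ n : ℕ, ∑ j ∈ Finset.Icc 1 n, rad j = 1 - rad n := by
    intro n
    induction n with
    | zero => simp [rad]
    | succ n ih =>
        rw [Finset.sum_Icc_succ_top (by omega), ih, rad_succ]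
        ring
  rw [h]
  linarith [rad_pos n]

/-- Geometric sums: for `0 ≤ ρ < 1`, `Σ_{1 ≤ j ≤ n} ρ^j ≤ ρ / (1 - ρ)`. [folklore] -/
theorem sum_Icc_pow_le {ρ : ℝ} (h0 : 0 ≤ ρ) (h1 : ρ < 1) (n : ℕ) :
    ∑ j ∈ Finset.Icc 1 n, ρ ^ j ≤ ρ / (1 - ρ) := by
  have h : ∀ n : ℕ, ∑ j ∈ Finset.Icc 1 n, ρ ^ j = ρ * (1 - ρ ^ n) / (1 - ρ) := by
    intro n
    induction n with
    | zero => simp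
    | succ n ih =>
        have hne : 1 - ρ ≠ 0 := by linarith
        rw [Finset.sum_Icc_succ_top (by omega), ih]
        field_simp
        ring
  rw [h]
  refine div_le_div_of_nonneg_right ?_ (by linarith)
  nlinarith [pow_nonneg h0 n]

/-- `(r_j)^e = ((1/2)^e)^j` for real exponents. [folklore] -/
theorem rad_rpow (j : ℕ) (e : ℝ) : (rad j) ^ e = ((1 / 2 : ℝ) ^ e) ^ j := by
  rw [rad, ← Real.rpow_natCast_mul (by norm_num), mul_comm, Real.rpow_mul_natCast (by norm_num)]

/-- `Σ_{1 ≤ j ≤ n} r_j^{2/3} ≤ 2`. [folklore] -/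
theorem sum_Icc_rad_rpow_twoThirds_le (n : ℕ) :
    ∑ j ∈ Finset.Icc 1 n, (rad j) ^ (2 / 3 : ℝ) ≤ 2 := by
  set ρ : ℝ := (1 / 2 : ℝ) ^ (2 / 3 : ℝ) with hρ
  have hρ0 : 0 ≤ ρ := Real.rpow_nonneg (by norm_num) _
  have hρ1 : ρ ≤ 2 / 3 := by
    -- `ρ³ = 1/4 ≤ 8/27 = (2/3)³`
    have h3 : ρ ^ 3 = 1 / 4 := by
      rw [hρ, ← Real.rpow_mul_natCast (by norm_num)]; norm_num
    refine le_of_pow_le_pow_left₀ (by norm_num : (3 : ℕ) ≠ 0) (by norm_num) ?_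
    rw [h3]; norm_num
  simp_rw [rad_rpow]
  refine (sum_Icc_pow_le hρ0 (by linarith) n).trans ?_
  rw [div_le_iff₀ (by linarith)]
  linarith

end Helpers



section Slice

variable {Q : Opens (ℝ × EuclideanSpace ℝ (Fin 3))} {ν : ℝ}
  {f u : ℝ → EuclideanSpace ℝ (Fin 3) → EuclideanSpace ℝ (Fin 3)}
  {p : ℝ → EuclideanSpace ℝ (Fin 3) → ℝ}
  {G : ℝ → EuclideanSpace ℝ (Fin 3) → EuclideanSpace ℝ (Fin 3) →L[ℝ] EuclideanSpace ℝ (Fin 3)}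

/-- For a suitable pair, `|p|^{3/2}` is integrable on every compact `K ⊆ Q`. [folklore] -/
theorem IsSuitablePair.integrableOn_abs_pressure_rpow (h : IsSuitablePair Q ν f u p G)
    {K : Set (ℝ × EuclideanSpace ℝ (Fin 3))} (hK : K ⊆ (Q : Set (ℝ × EuclideanSpace ℝ (Fin 3))))
    (hKc : IsCompact K) :
    IntegrableOn (fun z : ℝ × EuclideanSpace ℝ (Fin 3) => |p z.1 z.2| ^ (3 / 2 : ℝ)) K volume := by
  have hp := h.pressure_locallyIntegrableOn.integrableOn_compact_subset hK hKc
  have hm : AEStronglyMeasurable (fun z : ℝ × EuclideanSpace ℝ (Fin 3) => |p z.1 z.2| ^ (3 / 2 : ℝ))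
      (volume.restrict K) := by
    have e : (fun z : ℝ × EuclideanSpace ℝ (Fin 3) => |p z.1 z.2| ^ (3 / 2 : ℝ)) =
        fun z => ‖uncurry p z‖ ^ (3 / 2 : ℝ) := by
      funext z; rw [Real.norm_eq_abs]; rfl
    rw [e]
    exact (hp.aestronglyMeasurable.aemeasurable.norm.pow_const _).aestronglyMeasurable
  refine ⟨hm, ?_⟩
  rw [hasFiniteIntegral_iff_enorm]
  refine lt_of_le_of_lt (lintegral_mono fun z => le_of_eq ?_)
    ((lintegral_mono_set hK).trans_lt h.pressure_lt_top)
  rw [Real.enorm_eq_ofReal (Real.rpow_nonneg (abs_nonneg _) _), Real.enorm_eq_ofReal_abs,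
    ENNReal.ofReal_rpow_of_nonneg (abs_nonneg _) (by norm_num)]

/-- Under the local integrability of `|u|³`, the field `(|u|² + 2p) u` of a suitable pair is
locally integrable on `Q` (Young). [folklore] -/
theorem IsSuitablePair.locallyIntegrableOn_cubic (h : IsSuitablePair Q ν f u p G)
    (hu3 : LocallyIntegrableOn (fun z : ℝ × EuclideanSpace ℝ (Fin 3) => ‖u z.1 z.2‖ ^ 3)
      (Q : Set (ℝ × EuclideanSpace ℝ (Fin 3))) volume) :
    LocallyIntegrableOn (uncurry fun t x => (‖u t x‖ ^ 2 + 2 * p t x) • u t x)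
      (Q : Set (ℝ × EuclideanSpace ℝ (Fin 3))) volume := by
  refine (locallyIntegrableOn_iff Q.isOpen.isLocallyClosed).2 fun K hK hKc => ?_
  have hu := h.weakGradient.locallyIntegrableOn.integrableOn_compact_subset hK hKc
  have hp := h.pressure_locallyIntegrableOn.integrableOn_compact_subset hK hKc
  have hu3K := hu3.integrableOn_compact_subset hK hKc
  have hp32 := h.integrableOn_abs_pressure_rpow hK hKc
  have hm : AEStronglyMeasurable (uncurry fun t x => (‖u t x‖ ^ 2 + 2 * p t x) • u t x)
      (volume.restrict K) := by
    have e : (uncurry fun t x => (‖u t x‖ ^ 2 + 2 * p t x) • u t x) =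
        fun z : ℝ × EuclideanSpace ℝ (Fin 3) => (‖uncurry u z‖ ^ 2 + 2 * uncurry p z) • uncurry u z := by
      funext z; rfl
    rw [e]
    exact ((hu.aestronglyMeasurable.norm.pow 2).add
      (hp.aestronglyMeasurable.const_mul 2)).smul hu.aestronglyMeasurable
  refine Integrable.mono' ((hu3K.const_mul (5 / 3)).add (hp32.const_mul (4 / 3))) hm
    (Eventually.of_forall fun z => ?_)
  have hpq : (3 / 2 : ℝ).HolderConjugate 3 := Real.holderConjugate_iff.2 ⟨by norm_num, by norm_num⟩
  have hy := Real.young_inequality_of_nonneg (abs_nonneg (p z.1 z.2)) (norm_nonneg (u z.1 z.2)) hpq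
  simp only [uncurry, norm_smul, Real.norm_eq_abs, Pi.add_apply]
  have h3 : ‖u z.1 z.2‖ ^ (3 : ℝ) = ‖u z.1 z.2‖ ^ 3 := by
    rw [show (3 : ℝ) = ((3 : ℕ) : ℝ) by norm_num, Real.rpow_natCast]
  rw [h3] at hy
  have hu0 := norm_nonneg (u z.1 z.2)
  calc |‖u z.1 z.2‖ ^ 2 + 2 * p z.1 z.2| * ‖u z.1 z.2‖
      ≤ (‖u z.1 z.2‖ ^ 2 + 2 * |p z.1 z.2|) * ‖u z.1 z.2‖ := by
        gcongr
        exact (abs_add_le _ _).trans (by rw [abs_of_nonneg (sq_nonneg _), abs_mul, abs_two])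
    _ = ‖u z.1 z.2‖ ^ 3 + 2 * (|p z.1 z.2| * ‖u z.1 z.2‖) := by ring
    _ ≤ ‖u z.1 z.2‖ ^ 3 + 2 * (|p z.1 z.2| ^ (3 / 2 : ℝ) / (3 / 2) + ‖u z.1 z.2‖ ^ 3 / 3) := by
        gcongr
    _ = 5 / 3 * ‖u z.1 z.2‖ ^ 3 + 4 / 3 * |p z.1 z.2| ^ (3 / 2 : ℝ) := by ring

/-- **Integrability of the right-hand side of the local energy inequality** for a suitable pair
with `|u|³, f·u ∈ L¹_loc(Q)` and a test function `ζ` on `Q`. [folklore] -/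
theorem IsSuitablePair.integrable_localEnergyRHS (h : IsSuitablePair Q ν f u p G)
    (hu3 : LocallyIntegrableOn (fun z : ℝ × EuclideanSpace ℝ (Fin 3) => ‖u z.1 z.2‖ ^ 3)
      (Q : Set (ℝ × EuclideanSpace ℝ (Fin 3))) volume)
    (hfu : LocallyIntegrableOn (fun z : ℝ × EuclideanSpace ℝ (Fin 3) => ⟪f z.1 z.2, u z.1 z.2⟫)
      (Q : Set (ℝ × EuclideanSpace ℝ (Fin 3))) volume)
    {ζ : ℝ → EuclideanSpace ℝ (Fin 3) → ℝ} (hζ : IsSpaceTimeTestOn Q ζ) :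
    Integrable (localEnergyRHS ν f u p ζ) (volume : Measure (ℝ × EuclideanSpace ℝ (Fin 3))) := by
  set K := tsupport (uncurry ζ) with hK
  have hKc : IsCompact K := hζ.hasCompactSupport
  have hKQ : K ⊆ (Q : Set (ℝ × EuclideanSpace ℝ (Fin 3))) := hζ.tsupport_subset
  have hζ' : IsSpaceTimeTestOn (⊤ : Opens (ℝ × EuclideanSpace ℝ (Fin 3))) ζ := hζ.mono le_top
  have hcζ : Continuous fun z : ℝ × EuclideanSpace ℝ (Fin 3) => ζ z.1 z.2 := hζ.contDiff.continuous
  have hcT : Continuous fun z : ℝ × EuclideanSpace ℝ (Fin 3) => timeDeriv ζ z.1 z.2 :=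
    hζ'.timeDeriv_top.contDiff.continuous
  have hcL : Continuous fun z : ℝ × EuclideanSpace ℝ (Fin 3) => Δ (ζ z.1) z.2 :=
    hζ'.laplacian_top.contDiff.continuous
  obtain ⟨hcg, -, hg0⟩ := hζ.continuous_gradient_field
  have hζK : ∀ z ∉ K, ζ z.1 z.2 = 0 := fun z hz =>
    show uncurry ζ z = 0 from image_eq_zero_of_notMem_tsupport hz
  have hTK : ∀ z ∉ K, timeDeriv ζ z.1 z.2 = 0 := fun z hz =>
    IsSpaceTimeTestOn.timeDeriv_eq_zero_of_notMem hz
  have hLK : ∀ z ∉ K, Δ (ζ z.1) z.2 = 0 := fun z hz =>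
    laplacian_eq_zero_of_notMem_tsupport (notMem_tsupport_slice hz)
  have h1 : Integrable (fun z : ℝ × EuclideanSpace ℝ (Fin 3) =>
      ‖u z.1 z.2‖ ^ 2 * (timeDeriv ζ z.1 z.2 + ν * Δ (ζ z.1) z.2))
      (volume : Measure (ℝ × EuclideanSpace ℝ (Fin 3))) :=
    integrable_mul_of_locallyIntegrableOn h.sq_locallyIntegrableOn
      (hcT.add (continuous_const.mul hcL)) hKc hKQ fun z hz => by rw [hTK z hz, hLK z hz]; ring
  have h2 : Integrable (fun z : ℝ × EuclideanSpace ℝ (Fin 3) =>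
      ⟪(fun t x => (‖u t x‖ ^ 2 + 2 * p t x) • u t x) z.1 z.2, gradient (ζ z.1) z.2⟫)
      (volume : Measure (ℝ × EuclideanSpace ℝ (Fin 3))) :=
    integrable_inner_of_locallyIntegrableOn (h.locallyIntegrableOn_cubic hu3) hcg hKc hKQ hg0
  have h3 : Integrable (fun z : ℝ × EuclideanSpace ℝ (Fin 3) => ⟪f z.1 z.2, u z.1 z.2⟫ * (2 * ζ z.1 z.2))
      (volume : Measure (ℝ × EuclideanSpace ℝ (Fin 3))) :=
    integrable_mul_of_locallyIntegrableOn hfu (continuous_const.mul hcζ) hKc hKQ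
      fun z hz => by rw [hζK z hz, mul_zero]
  refine ((h1.add h2).add h3).congr (Eventually.of_forall fun z => ?_)
  simp only [localEnergyRHS, real_inner_smul_left, Pi.add_apply]
  ring

/-- **The sliced local energy inequality for a suitable pair** (RRS (15.8) with force): for a
test function `ζ ≥ 0` on `Q`, for a.e. `s`,
`∫ |u(s)|² ζ(s) + 2ν ∫∫_{t<s} |G|² ζ ≤ ∫∫_{t<s} R[ζ]`. [cite: RobinsonRodrigoSadowski2016, (15.8) p. 215] -/
theorem IsSuitablePair.ae_localEnergy_slice (h : IsSuitablePair Q ν f u p G)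
    (hu3 : LocallyIntegrableOn (fun z : ℝ × EuclideanSpace ℝ (Fin 3) => ‖u z.1 z.2‖ ^ 3)
      (Q : Set (ℝ × EuclideanSpace ℝ (Fin 3))) volume)
    (hfu : LocallyIntegrableOn (fun z : ℝ × EuclideanSpace ℝ (Fin 3) => ⟪f z.1 z.2, u z.1 z.2⟫)
      (Q : Set (ℝ × EuclideanSpace ℝ (Fin 3))) volume)
    {ζ : ℝ → EuclideanSpace ℝ (Fin 3) → ℝ} (hζ : IsSpaceTimeTestOn Q ζ) (hζ0 : ∀ t x, 0 ≤ ζ t x) :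
    ∀ᵐ s ∂(volume : Measure ℝ),
      (∫ x, ‖u s x‖ ^ 2 * ζ s x) +
          2 * ν * ∫ z in {z : ℝ × EuclideanSpace ℝ (Fin 3) | z.1 < s},
            frobeniusNormSq (G z.1 z.2) * ζ z.1 z.2 ≤
        ∫ z in {z : ℝ × EuclideanSpace ℝ (Fin 3) | z.1 < s}, localEnergyRHS ν f u p ζ z := by
  set K := tsupport (uncurry ζ) with hK
  have hKc : IsCompact K := hζ.hasCompactSupport
  have hKQ : K ⊆ (Q : Set (ℝ × EuclideanSpace ℝ (Fin 3))) := hζ.tsupport_subset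
  have hcζ : Continuous fun z : ℝ × EuclideanSpace ℝ (Fin 3) => ζ z.1 z.2 := hζ.contDiff.continuous
  have hζK : ∀ z ∉ K, ζ z.1 z.2 = 0 := fun z hz =>
    show uncurry ζ z = 0 from image_eq_zero_of_notMem_tsupport hz
  have hIW : Integrable (fun z : ℝ × EuclideanSpace ℝ (Fin 3) => ‖u z.1 z.2‖ ^ 2 * ζ z.1 z.2)
      (volume : Measure (ℝ × EuclideanSpace ℝ (Fin 3))) :=
    integrable_mul_of_locallyIntegrableOn h.sq_locallyIntegrableOn hcζ hKc hKQ hζK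
  have hG2 : ∀ K' ⊆ (Q : Set (ℝ × EuclideanSpace ℝ (Fin 3))), IsCompact K' →
      ∫⁻ z in K', ENNReal.ofReal (frobeniusNormSq (G z.1 z.2)) < ∞ := fun K' hK' _ =>
    (lintegral_mono_set hK').trans_lt h.gradient_lt_top
  have hIF : Integrable (fun z : ℝ × EuclideanSpace ℝ (Fin 3) => frobeniusNormSq (G z.1 z.2) * ζ z.1 z.2)
      (volume : Measure (ℝ × EuclideanSpace ℝ (Fin 3))) :=
    integrable_mul_of_locallyIntegrableOn (locallyIntegrableOn_frobeniusNormSq h.weakGradient hG2)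
      hcζ hKc hKQ hζK
  have hIR := h.integrable_localEnergyRHS hu3 hfu hζ
  exact ae_localEnergy_slice_of_integrable h.localEnergy hζ hζ0 hIW hIF hIR

/-- **The sliced local energy inequality for a suitable pair, below a time level**: for a
nonnegative smooth compactly supported `ζ` on space–time supported in `Q` below every time
level `τ < T`, the sliced inequality holds for a.e. `s < T`. [cite: RobinsonRodrigoSadowski2016, (15.8) p. 215] -/
theorem IsSuitablePair.ae_localEnergy_slice_of_forall_lt (h : IsSuitablePair Q ν f u p G)
    (hu3 : LocallyIntegrableOn (fun z : ℝ × EuclideanSpace ℝ (Fin 3) => ‖u z.1 z.2‖ ^ 3)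
      (Q : Set (ℝ × EuclideanSpace ℝ (Fin 3))) volume)
    (hfu : LocallyIntegrableOn (fun z : ℝ × EuclideanSpace ℝ (Fin 3) => ⟪f z.1 z.2, u z.1 z.2⟫)
      (Q : Set (ℝ × EuclideanSpace ℝ (Fin 3))) volume)
    {ζ : ℝ → EuclideanSpace ℝ (Fin 3) → ℝ}
    (hζ : IsSpaceTimeTestOn (⊤ : Opens (ℝ × EuclideanSpace ℝ (Fin 3))) ζ) (hζ0 : ∀ t x, 0 ≤ ζ t x)
    {T : ℝ} (hζQ : ∀ τ < T, tsupport (uncurry ζ) ∩ {z | z.1 ≤ τ} ⊆ (Q : Set (ℝ × EuclideanSpace ℝ (Fin 3)))) :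
    ∀ᵐ s ∂(volume : Measure ℝ), s < T →
      (∫ x, ‖u s x‖ ^ 2 * ζ s x) +
          2 * ν * ∫ z in {z : ℝ × EuclideanSpace ℝ (Fin 3) | z.1 < s},
            frobeniusNormSq (G z.1 z.2) * ζ z.1 z.2 ≤
        ∫ z in {z : ℝ × EuclideanSpace ℝ (Fin 3) | z.1 < s}, localEnergyRHS ν f u p ζ z := by
  set δ : ℕ → ℝ := fun k => 1 / ((k : ℝ) + 1) with hδ
  have hδ0 : ∀ k, 0 < δ k := fun k => by positivity
  choose θ ρ hθs hθd hθ1 hθ0 hρ0 hθnn using fun k => exists_time_level_cutoff T (hδ0 k)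
  have htest : ∀ k, IsSpaceTimeTestOn Q (fun t x => θ k t * ζ t x) := fun k =>
    hζ.time_mul_of_forall_lt hζQ (hθs k) (by linarith [hδ0 k]) (hθ0 k)
  have hae := ae_all_iff.2 fun k =>
    h.ae_localEnergy_slice hu3 hfu (htest k) (fun t x => mul_nonneg (hθnn k t) (hζ0 t x))
  have hmeas : ∀ s : ℝ, MeasurableSet {z : ℝ × EuclideanSpace ℝ (Fin 3) | z.1 < s} := fun s =>
    measurableSet_lt measurable_fst measurable_const
  filter_upwards [hae] with s hs' hsT
  obtain ⟨k, hk⟩ := exists_nat_one_div_lt (show 0 < (T - s) / 3 by linarith)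
  have hk' : s < T - 3 * δ k := by
    simp only [hδ]
    linarith
  have h1 : ∀ t ≤ s, θ k t = 1 := fun t ht => hθ1 k t (by linarith)
  have key := hs' k
  have e1 : (∫ x, ‖u s x‖ ^ 2 * (θ k s * ζ s x)) = ∫ x, ‖u s x‖ ^ 2 * ζ s x := by
    simp only [h1 s le_rfl, one_mul]
  have e2 : ∫ z in {z : ℝ × EuclideanSpace ℝ (Fin 3) | z.1 < s},
        frobeniusNormSq (G z.1 z.2) * (θ k z.1 * ζ z.1 z.2) =
      ∫ z in {z : ℝ × EuclideanSpace ℝ (Fin 3) | z.1 < s}, frobeniusNormSq (G z.1 z.2) * ζ z.1 z.2 := by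
    refine setIntegral_congr_fun (hmeas s) fun z hz => ?_
    simp only [h1 z.1 (le_of_lt hz), one_mul]
  have e3 : ∫ z in {z : ℝ × EuclideanSpace ℝ (Fin 3) | z.1 < s},
        localEnergyRHS ν f u p (fun t x => θ k t * ζ t x) z =
      ∫ z in {z : ℝ × EuclideanSpace ℝ (Fin 3) | z.1 < s}, localEnergyRHS ν f u p ζ z := by
    refine setIntegral_congr_fun (hmeas s) fun z hz => ?_
    have hz1 : z.1 < s := hz
    have h := localEnergyRHS_mul_of_hasDerivAt (ν := ν) (f := f) (u := u) (p := p) hζ (hθd k)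
      z.1 z.2
    rw [h1 z.1 hz1.le, hρ0 k z.1 (by linarith), one_mul, zero_mul, add_zero] at h
    exact h
  rw [e1, e2] at key
  refine key.trans (le_of_eq ?_)
  rw [← e3]

end Slice


/-! ### Step 2: estimates on single cylinders and ring sums -/

section CylinderEstimates

variable {z₀ z : ℝ × EuclideanSpace ℝ (Fin 3)}
  {f u : ℝ → EuclideanSpace ℝ (Fin 3) → EuclideanSpace ℝ (Fin 3)}
  {p : ℝ → EuclideanSpace ℝ (Fin 3) → ℝ}

/-- Real exponent bookkeeping: `(ε^{2/3} r⁵)^{1/3} = ε^{2/9} r^{5/3}`. [folklore] -/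
theorem rpow_cube_third {ε r : ℝ} (hε : 0 ≤ ε) (hr : 0 < r) :
    (ε ^ (2 / 3 : ℝ) * r ^ 5) ^ (1 / 3 : ℝ) = ε ^ (2 / 9 : ℝ) * r ^ (5 / 3 : ℝ) := by
  rw [Real.mul_rpow (Real.rpow_nonneg hε _) (pow_nonneg hr.le 5), ← Real.rpow_mul hε,
    show (r ^ 5 : ℝ) = r ^ ((5 : ℕ) : ℝ) from (Real.rpow_natCast r 5).symm, ← Real.rpow_mul hr.le]
  norm_num

/-- **The quadratic term** (RRS (15.15)): from the smallness assumption,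
`∫∫_{Q_{1/2}(z)} |u|² ≤ |Q_{1/2}|^{1/3} (∫∫ |u|³)^{2/3} ≤ ε₀^{2/3}`. [cite: RobinsonRodrigoSadowski2016, (15.15) p. 218] -/
theorem lintegral_sq_half_le_of_small {ε₀ : ℝ} (hε : 0 ≤ ε₀) (hz : z ∈ parabolicCylinder (1 / 2) z₀)
    (hu : AEMeasurable (fun w : ℝ × EuclideanSpace ℝ (Fin 3) => ‖u w.1 w.2‖ₑ)
      (volume.restrict (parabolicCylinder 1 z₀)))
    (hS : Small ε₀ u p z₀) :
    ∫⁻ w in parabolicCylinder (1 / 2) z, ‖u w.1 w.2‖ₑ ^ 2 ≤ ENNReal.ofReal (ε₀ ^ (2 / 3 : ℝ)) := by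
  have hsub : parabolicCylinder (1 / 2) z ⊆ parabolicCylinder 1 z₀ :=
    parabolicCylinder_subset_of_mem_half hz (by norm_num) le_rfl
  have hF : AEMeasurable (fun w : ℝ × EuclideanSpace ℝ (Fin 3) => ‖u w.1 w.2‖ₑ)
      (volume.restrict (parabolicCylinder (1 / 2) z)) :=
    hu.mono_measure (Measure.restrict_mono hsub le_rfl)
  have H := setLIntegral_rpow_le_rpow_mul_measure volume (parabolicCylinder (1 / 2) z) hF
    (a := 2) (b := 3) (by norm_num) (by norm_num)
  have e2 : ∀ w : ℝ × EuclideanSpace ℝ (Fin 3), ‖u w.1 w.2‖ₑ ^ (2 : ℝ) = ‖u w.1 w.2‖ₑ ^ 2 := fun w => by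
    rw [show (2 : ℝ) = ((2 : ℕ) : ℝ) by norm_num, ENNReal.rpow_natCast]
  have e3 : ∀ w : ℝ × EuclideanSpace ℝ (Fin 3), ‖u w.1 w.2‖ₑ ^ (3 : ℝ) = ‖u w.1 w.2‖ₑ ^ (3 : ℕ) := fun w => by
    rw [show (3 : ℝ) = ((3 : ℕ) : ℝ) by norm_num, ENNReal.rpow_natCast]
  simp only [e2, e3] at H
  have h3 : ∫⁻ w in parabolicCylinder (1 / 2) z, ‖u w.1 w.2‖ₑ ^ (3 : ℕ) ≤ ENNReal.ofReal ε₀ :=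
    calc ∫⁻ w in parabolicCylinder (1 / 2) z, ‖u w.1 w.2‖ₑ ^ (3 : ℕ)
        ≤ ∫⁻ w in parabolicCylinder 1 z₀, ‖u w.1 w.2‖ₑ ^ (3 : ℕ) := lintegral_mono_set hsub
      _ ≤ ∫⁻ w in parabolicCylinder 1 z₀, (‖u w.1 w.2‖ₑ ^ (3 : ℕ) + ‖p w.1 w.2‖ₑ ^ (3 / 2 : ℝ)) :=
          lintegral_mono fun w => le_self_add
      _ ≤ ENNReal.ofReal ε₀ := hS
  have hV : volume (parabolicCylinder (1 / 2) z) ≤ 1 :=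
    calc volume (parabolicCylinder (1 / 2) z) ≤ ENNReal.ofReal (5 * (1 / 2) ^ 5) :=
          volume_parabolicCylinder_le (by norm_num) z
      _ ≤ 1 := by rw [← ENNReal.ofReal_one]; exact ENNReal.ofReal_le_ofReal (by norm_num)
  calc ∫⁻ w in parabolicCylinder (1 / 2) z, ‖u w.1 w.2‖ₑ ^ 2
      ≤ (∫⁻ w in parabolicCylinder (1 / 2) z, ‖u w.1 w.2‖ₑ ^ (3 : ℕ)) ^ ((2 : ℝ) / 3) *
          volume (parabolicCylinder (1 / 2) z) ^ (1 - (2 : ℝ) / 3) := H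
    _ ≤ (ENNReal.ofReal ε₀) ^ ((2 : ℝ) / 3) * 1 ^ (1 - (2 : ℝ) / 3) := by gcongr
    _ = ENNReal.ofReal (ε₀ ^ (2 / 3 : ℝ)) := by
        rw [ENNReal.one_rpow, mul_one, ENNReal.ofReal_rpow_of_nonneg hε (by norm_num)]

/-- **The force on one cylinder** (Hölder, with the decay `|Q_r| ≤ 5 r⁵` and `q > 5/2`):
if `‖f‖_{L^q(Q_1(z₀))} ≤ κ ε₀^{4/9}` and `∫∫_{Q_{r_k}(z)} |u|³ ≤ ε₀^{2/3} r_k⁵`, then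
`∫∫_{Q_{r_k}(z)} |u| |f| ≤ 3 κ ε₀^{2/3} r_k^{5 - 5/q}`. [folklore] -/
theorem lintegral_vel_force_le {q κ ε₀ : ℝ} (hq : 5 / 2 < q) (hκ : 0 ≤ κ) (hε : 0 ≤ ε₀) {k : ℕ}
    (hsub : parabolicCylinder (rad k) z ⊆ parabolicCylinder 1 z₀)
    (hf : AEMeasurable (fun w : ℝ × EuclideanSpace ℝ (Fin 3) => ‖f w.1 w.2‖ₑ)
      (volume.restrict (parabolicCylinder 1 z₀)))
    (hu : AEMeasurable (fun w : ℝ × EuclideanSpace ℝ (Fin 3) => ‖u w.1 w.2‖ₑ)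
      (volume.restrict (parabolicCylinder 1 z₀)))
    (hF : ∫⁻ w in parabolicCylinder 1 z₀, ‖f w.1 w.2‖ₑ ^ q ≤
      ENNReal.ofReal ((κ * ε₀ ^ (4 / 9 : ℝ)) ^ q))
    (hU : ∫⁻ w in parabolicCylinder (rad k) z, ‖u w.1 w.2‖ₑ ^ (3 : ℕ) ≤
      ENNReal.ofReal (ε₀ ^ (2 / 3 : ℝ) * rad k ^ 5)) :
    ∫⁻ w in parabolicCylinder (rad k) z, ‖u w.1 w.2‖ₑ * ‖f w.1 w.2‖ₑ ≤
      ENNReal.ofReal (3 * κ * ε₀ ^ (2 / 3 : ℝ) * (rad k) ^ (5 - 5 / q : ℝ)) := by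
  have hr := rad_pos k
  have hq0 : 0 < q := by linarith
  have hq32 : (3 / 2 : ℝ) < q := by linarith
  set e : ℝ := 2 / 3 - 1 / q with he
  have he0 : 0 ≤ e := by
    rw [he, sub_nonneg, one_div_le (by linarith) (by norm_num)]; norm_num; linarith
  have he1 : e ≤ 2 / 3 := by rw [he]; linarith [one_div_pos.2 hq0]
  have hμ := Measure.restrict_mono (μ := volume) (ν := volume) hsub le_rfl
  have hfk := hf.mono_measure hμ
  have huk := hu.mono_measure hμ
  -- Hölder `3`–`3/2`
  have H1 := lintegral_mul_le_L3_L32 (volume.restrict (parabolicCylinder (rad k) z)) huk hfk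
  -- `L^{3/2}` by `L^q`
  have H2 := lintegral_rpow32_rpow_le volume (parabolicCylinder (rad k) z) hfk hq32
  -- the `L^q` norm on the small cylinder
  have H3 : (∫⁻ w in parabolicCylinder (rad k) z, ‖f w.1 w.2‖ₑ ^ q) ^ (1 / q) ≤
      ENNReal.ofReal (κ * ε₀ ^ (4 / 9 : ℝ)) := by
    calc (∫⁻ w in parabolicCylinder (rad k) z, ‖f w.1 w.2‖ₑ ^ q) ^ (1 / q)
        ≤ (ENNReal.ofReal ((κ * ε₀ ^ (4 / 9 : ℝ)) ^ q)) ^ (1 / q) := by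
          gcongr
          exact (lintegral_mono_set hsub).trans hF
      _ = ENNReal.ofReal (κ * ε₀ ^ (4 / 9 : ℝ)) := by
          rw [ENNReal.ofReal_rpow_of_nonneg (by positivity) (by positivity), one_div,
            Real.rpow_rpow_inv (by positivity) hq0.ne']
  -- the measure factor
  have H4 : volume (parabolicCylinder (rad k) z) ^ e ≤ ENNReal.ofReal ((5 * rad k ^ 5) ^ e) := by
    calc volume (parabolicCylinder (rad k) z) ^ e ≤ (ENNReal.ofReal (5 * rad k ^ 5)) ^ e := by
          gcongr; exact volume_parabolicCylinder_le hr.le z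
      _ = _ := ENNReal.ofReal_rpow_of_nonneg (by positivity) he0
  -- the cube factor
  have H5 : (∫⁻ w in parabolicCylinder (rad k) z, ‖u w.1 w.2‖ₑ ^ (3 : ℕ)) ^ (1 / 3 : ℝ) ≤
      ENNReal.ofReal ((ε₀ ^ (2 / 3 : ℝ) * rad k ^ 5) ^ (1 / 3 : ℝ)) := by
    calc (∫⁻ w in parabolicCylinder (rad k) z, ‖u w.1 w.2‖ₑ ^ (3 : ℕ)) ^ (1 / 3 : ℝ)
        ≤ (ENNReal.ofReal (ε₀ ^ (2 / 3 : ℝ) * rad k ^ 5)) ^ (1 / 3 : ℝ) := by gcongr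
      _ = _ := ENNReal.ofReal_rpow_of_nonneg (by positivity) (by norm_num)
  -- the real arithmetic
  have h5e : (5 : ℝ) ^ e ≤ 3 := by
    calc (5 : ℝ) ^ e ≤ 5 ^ (2 / 3 : ℝ) := Real.rpow_le_rpow_of_exponent_le (by norm_num) he1
      _ ≤ 3 := by
          refine le_of_pow_le_pow_left₀ (by norm_num : (3 : ℕ) ≠ 0) (by norm_num) ?_
          rw [← Real.rpow_mul_natCast (by norm_num)]; norm_num
  have hreal : (ε₀ ^ (2 / 3 : ℝ) * rad k ^ 5) ^ (1 / 3 : ℝ) *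
      (κ * ε₀ ^ (4 / 9 : ℝ) * (5 * rad k ^ 5) ^ e) ≤ 3 * κ * ε₀ ^ (2 / 3 : ℝ) * (rad k) ^ (5 - 5 / q : ℝ) := by
    rw [rpow_cube_third hε hr, Real.mul_rpow (by norm_num) (pow_nonneg hr.le 5),
      show (rad k ^ 5 : ℝ) = rad k ^ ((5 : ℕ) : ℝ) from (Real.rpow_natCast _ 5).symm,
      ← Real.rpow_mul hr.le]
    have hee : ε₀ ^ (2 / 9 : ℝ) * ε₀ ^ (4 / 9 : ℝ) = ε₀ ^ (2 / 3 : ℝ) := by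
      rw [← Real.rpow_add' hε (by norm_num)]; norm_num
    have hrr : (rad k) ^ (5 / 3 : ℝ) * (rad k) ^ (((5 : ℕ) : ℝ) * e) = (rad k) ^ (5 - 5 / q : ℝ) := by
      rw [← Real.rpow_add hr]; congr 1; rw [he]; push_cast; ring
    calc ε₀ ^ (2 / 9 : ℝ) * rad k ^ (5 / 3 : ℝ) * (κ * ε₀ ^ (4 / 9 : ℝ) * (5 ^ e * rad k ^ (((5 : ℕ) : ℝ) * e)))
        = (5 : ℝ) ^ e * κ * (ε₀ ^ (2 / 9 : ℝ) * ε₀ ^ (4 / 9 : ℝ)) *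
            ((rad k) ^ (5 / 3 : ℝ) * (rad k) ^ (((5 : ℕ) : ℝ) * e)) := by ring
      _ = (5 : ℝ) ^ e * κ * ε₀ ^ (2 / 3 : ℝ) * (rad k) ^ (5 - 5 / q : ℝ) := by rw [hee, hrr]
      _ ≤ 3 * κ * ε₀ ^ (2 / 3 : ℝ) * (rad k) ^ (5 - 5 / q : ℝ) := by
          gcongr
  -- assemble
  calc ∫⁻ w in parabolicCylinder (rad k) z, ‖u w.1 w.2‖ₑ * ‖f w.1 w.2‖ₑ
      ≤ (∫⁻ w in parabolicCylinder (rad k) z, ‖u w.1 w.2‖ₑ ^ (3 : ℕ)) ^ (1 / 3 : ℝ) *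
          (∫⁻ w in parabolicCylinder (rad k) z, ‖f w.1 w.2‖ₑ ^ (3 / 2 : ℝ)) ^ (2 / 3 : ℝ) := H1
    _ ≤ ENNReal.ofReal ((ε₀ ^ (2 / 3 : ℝ) * rad k ^ 5) ^ (1 / 3 : ℝ)) *
          (ENNReal.ofReal (κ * ε₀ ^ (4 / 9 : ℝ)) * ENNReal.ofReal ((5 * rad k ^ 5) ^ e)) := by
        gcongr
        exact H2.trans (mul_le_mul' H3 H4)
    _ = ENNReal.ofReal ((ε₀ ^ (2 / 3 : ℝ) * rad k ^ 5) ^ (1 / 3 : ℝ) *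
          (κ * ε₀ ^ (4 / 9 : ℝ) * (5 * rad k ^ 5) ^ e)) := by
        rw [← ENNReal.ofReal_mul (by positivity), ← ENNReal.ofReal_mul (by positivity)]
    _ ≤ _ := ENNReal.ofReal_le_ofReal hreal

/-- **The pressure on one cylinder** (Hölder with `(A_k)`):
`∫∫_{Q_{r_k}(z)} |u| |p - (p)_{r_k}| ≤ (ε₀^{2/3} r_k⁵)^{1/3} (ε₀^{2/3} r_k^{9/2})^{2/3} = ε₀^{2/3} r_k^{14/3}`. [cite: RobinsonRodrigoSadowski2016, p. 223] -/
theorem lintegral_vel_presOsc_le {ε₀ : ℝ} (hε : 0 ≤ ε₀) {k : ℕ}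
    (hu : AEMeasurable (fun w : ℝ × EuclideanSpace ℝ (Fin 3) => ‖u w.1 w.2‖ₑ)
      (volume.restrict (parabolicCylinder (rad k) z)))
    (hp : AEMeasurable (fun w : ℝ × EuclideanSpace ℝ (Fin 3) =>
      ‖p w.1 w.2 - ⨍ y in ball z.2 (rad k), p w.1 y‖ₑ) (volume.restrict (parabolicCylinder (rad k) z)))
    (hA : HypA ε₀ u p k z) :
    ∫⁻ w in parabolicCylinder (rad k) z, ‖u w.1 w.2‖ₑ * ‖p w.1 w.2 - ⨍ y in ball z.2 (rad k), p w.1 y‖ₑ ≤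
      ENNReal.ofReal (ε₀ ^ (2 / 3 : ℝ) * (rad k) ^ (14 / 3 : ℝ)) := by
  have hr := rad_pos k
  have H1 := lintegral_mul_le_L3_L32 (volume.restrict (parabolicCylinder (rad k) z)) hu hp
  have H5 : (∫⁻ w in parabolicCylinder (rad k) z, ‖u w.1 w.2‖ₑ ^ (3 : ℕ)) ^ (1 / 3 : ℝ) ≤
      ENNReal.ofReal ((ε₀ ^ (2 / 3 : ℝ) * rad k ^ 5) ^ (1 / 3 : ℝ)) := by
    calc (∫⁻ w in parabolicCylinder (rad k) z, ‖u w.1 w.2‖ₑ ^ (3 : ℕ)) ^ (1 / 3 : ℝ)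
        ≤ (ENNReal.ofReal (ε₀ ^ (2 / 3 : ℝ) * rad k ^ 5)) ^ (1 / 3 : ℝ) := by
          gcongr; exact lintegral_cube_le_of_hypA hA
      _ = _ := ENNReal.ofReal_rpow_of_nonneg (by positivity) (by norm_num)
  have H6 : (∫⁻ w in parabolicCylinder (rad k) z,
      ‖p w.1 w.2 - ⨍ y in ball z.2 (rad k), p w.1 y‖ₑ ^ (3 / 2 : ℝ)) ^ (2 / 3 : ℝ) ≤
      ENNReal.ofReal ((ε₀ ^ (2 / 3 : ℝ) * (rad k) ^ (9 / 2 : ℝ)) ^ (2 / 3 : ℝ)) := by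
    calc (∫⁻ w in parabolicCylinder (rad k) z,
        ‖p w.1 w.2 - ⨍ y in ball z.2 (rad k), p w.1 y‖ₑ ^ (3 / 2 : ℝ)) ^ (2 / 3 : ℝ)
        ≤ (ENNReal.ofReal (ε₀ ^ (2 / 3 : ℝ) * (rad k) ^ (9 / 2 : ℝ))) ^ (2 / 3 : ℝ) := by
          gcongr; exact lintegral_presOsc_le_of_hypA hA
      _ = _ := ENNReal.ofReal_rpow_of_nonneg (by positivity) (by norm_num)
  have hreal : (ε₀ ^ (2 / 3 : ℝ) * rad k ^ 5) ^ (1 / 3 : ℝ) *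
      (ε₀ ^ (2 / 3 : ℝ) * (rad k) ^ (9 / 2 : ℝ)) ^ (2 / 3 : ℝ) = ε₀ ^ (2 / 3 : ℝ) * (rad k) ^ (14 / 3 : ℝ) := by
    rw [rpow_cube_third hε hr, Real.mul_rpow (Real.rpow_nonneg hε _) (Real.rpow_nonneg hr.le _),
      ← Real.rpow_mul hε, ← Real.rpow_mul hr.le]
    have hee : ε₀ ^ (2 / 9 : ℝ) * ε₀ ^ ((2 / 3 : ℝ) * (2 / 3)) = ε₀ ^ (2 / 3 : ℝ) := by
      rw [← Real.rpow_add' hε (by norm_num)]; norm_num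
    have hrr : (rad k) ^ (5 / 3 : ℝ) * (rad k) ^ ((9 / 2 : ℝ) * (2 / 3)) = (rad k) ^ (14 / 3 : ℝ) := by
      rw [← Real.rpow_add hr]; norm_num
    calc ε₀ ^ (2 / 9 : ℝ) * rad k ^ (5 / 3 : ℝ) * (ε₀ ^ ((2 / 3 : ℝ) * (2 / 3)) * rad k ^ ((9 / 2 : ℝ) * (2 / 3)))
        = (ε₀ ^ (2 / 9 : ℝ) * ε₀ ^ ((2 / 3 : ℝ) * (2 / 3))) *
            ((rad k) ^ (5 / 3 : ℝ) * (rad k) ^ ((9 / 2 : ℝ) * (2 / 3))) := by ring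
      _ = _ := by rw [hee, hrr]
  calc ∫⁻ w in parabolicCylinder (rad k) z, ‖u w.1 w.2‖ₑ * ‖p w.1 w.2 - ⨍ y in ball z.2 (rad k), p w.1 y‖ₑ
      ≤ _ := H1
    _ ≤ ENNReal.ofReal ((ε₀ ^ (2 / 3 : ℝ) * rad k ^ 5) ^ (1 / 3 : ℝ)) *
          ENNReal.ofReal ((ε₀ ^ (2 / 3 : ℝ) * (rad k) ^ (9 / 2 : ℝ)) ^ (2 / 3 : ℝ)) := mul_le_mul' H5 H6
    _ = _ := by rw [← ENNReal.ofReal_mul (by positivity), hreal]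

end CylinderEstimates

/-! ### Step 2: the ring sums -/

section RingSums

variable {z₀ z : ℝ × EuclideanSpace ℝ (Fin 3)}
  {f u : ℝ → EuclideanSpace ℝ (Fin 3) → EuclideanSpace ℝ (Fin 3)}
  {p : ℝ → EuclideanSpace ℝ (Fin 3) → ℝ}

/-- Geometric sums of powers of the radii: for `e > 0`, `Σ_{1 ≤ j ≤ n} r_j^e ≤ S(e)` uniformly in `n`. [folklore] -/
theorem exists_sum_rad_rpow_le {e : ℝ} (he : 0 < e) :
    ∃ S : ℝ, 0 ≤ S ∧ ∀ n : ℕ, ∑ j ∈ Finset.Icc 1 n, (rad j) ^ e ≤ S := by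
  set ρ : ℝ := (1 / 2 : ℝ) ^ e with hρ
  have hρ0 : 0 ≤ ρ := Real.rpow_nonneg (by norm_num) _
  have hρ1 : ρ < 1 := Real.rpow_lt_one (by norm_num) (by norm_num) he
  refine ⟨ρ / (1 - ρ), div_nonneg hρ0 (by linarith), fun n => ?_⟩
  simp_rw [rad_rpow]
  exact sum_Icc_pow_le hρ0 hρ1 n

/-- **The cubic term over the rings** (RRS (15.16)): with `|∇φ| ≤ C₁ r² r_{j+1}⁻⁴` on the ring
`Q_{r_j} ∖ Q_{r_{j+1}}` (`1 ≤ j ≤ n`), `|∇φ| ≤ C₁ r⁻²` on `Q_r`, `r = r_{n+1}`, and `(A_k)` for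
`1 ≤ k ≤ n`: `∫∫_{Q_{1/2}} |u|³ |∇φ| ≤ 24 C₁ ε₀^{2/3} r²`. [cite: RobinsonRodrigoSadowski2016, (15.16) p. 219] -/
theorem lintegral_cube_grad_le {ε₀ C₁ : ℝ} (hε : 0 ≤ ε₀) (hC : 0 ≤ C₁) {n : ℕ} (hn : 1 ≤ n)
    {φ : ℝ → EuclideanSpace ℝ (Fin 3) → ℝ}
    (hA : ∀ k : ℕ, 1 ≤ k → k ≤ n → HypA ε₀ u p k z)
    (hring : ∀ j : ℕ, 1 ≤ j → j + 1 ≤ n + 1 →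
      ∀ w ∈ parabolicCylinder (rad j) z \ parabolicCylinder (rad (j + 1)) z,
        ‖gradient (φ w.1) w.2‖ ≤ C₁ * (rad (n + 1)) ^ 2 * ((rad (j + 1)) ^ 4)⁻¹)
    (hcore : ∀ w ∈ parabolicCylinder (rad (n + 1)) z,
      ‖gradient (φ w.1) w.2‖ ≤ C₁ * ((rad (n + 1)) ^ 2)⁻¹) :
    ∫⁻ w in parabolicCylinder (rad 1) z, ‖u w.1 w.2‖ₑ ^ (3 : ℕ) * ENNReal.ofReal ‖gradient (φ w.1) w.2‖ ≤
      ENNReal.ofReal (24 * C₁ * ε₀ ^ (2 / 3 : ℝ) * (rad (n + 1)) ^ 2) := by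
  set r := rad (n + 1) with hr_def
  have hr : 0 < r := rad_pos _
  have hr4 : r ≤ 1 / 4 := by rw [hr_def, ← rad_two]; exact rad_antitone (by omega)
  have hrn : rad n = 2 * r := by rw [hr_def, rad_succ]; ring
  have H := lintegral_mul_weight_le_sum_rings z (n := n)
    (g := fun w => ‖u w.1 w.2‖ₑ ^ (3 : ℕ)) (W := fun w => ENNReal.ofReal ‖gradient (φ w.1) w.2‖)
    (a := fun j => C₁ * r ^ 2 * ((rad (j + 1)) ^ 4)⁻¹) (b := fun j => ENNReal.ofReal (ε₀ ^ (2 / 3 : ℝ) * rad j ^ 5))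
    (ac := C₁ * (r ^ 2)⁻¹) (bc := ENNReal.ofReal (ε₀ ^ (2 / 3 : ℝ) * rad n ^ 5))
    (fun j hj w hw => ENNReal.ofReal_le_ofReal
      (hring j (Finset.mem_Icc.1 hj).1 (by linarith [(Finset.mem_Icc.1 hj).2]) w hw))
    (fun w hw => ENNReal.ofReal_le_ofReal (hcore w hw))
    (fun j hj => lintegral_cube_le_of_hypA (hA j (Finset.mem_Icc.1 hj).1 (Finset.mem_Icc.1 hj).2))
    ((lintegral_mono_set (parabolicCylinder_mono (rad_pos _).le (rad_succ_le n) z)).trans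
      (lintegral_cube_le_of_hypA (hA n hn le_rfl)))
  refine H.trans ?_
  -- evaluate the sum
  have hsum : ∑ j ∈ Finset.Icc 1 n, ENNReal.ofReal (C₁ * r ^ 2 * ((rad (j + 1)) ^ 4)⁻¹) *
      ENNReal.ofReal (ε₀ ^ (2 / 3 : ℝ) * rad j ^ 5) =
      ENNReal.ofReal (16 * C₁ * r ^ 2 * ε₀ ^ (2 / 3 : ℝ) * ∑ j ∈ Finset.Icc 1 n, rad j) := by
    rw [Finset.mul_sum, ENNReal.ofReal_sum_of_nonneg (fun j _ => by
      have := rad_pos j; have := rad_pos (j + 1); positivity)]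
    refine Finset.sum_congr rfl fun j _ => ?_
    have hj := rad_pos j
    have hj1 := rad_pos (j + 1)
    rw [← ENNReal.ofReal_mul (by positivity)]
    congr 1
    rw [rad_succ]
    field_simp
    ring
  have hcore' : ENNReal.ofReal (C₁ * (r ^ 2)⁻¹) * ENNReal.ofReal (ε₀ ^ (2 / 3 : ℝ) * rad n ^ 5) =
      ENNReal.ofReal (32 * C₁ * ε₀ ^ (2 / 3 : ℝ) * r ^ 3) := by
    rw [← ENNReal.ofReal_mul (by positivity), hrn]
    congr 1
    field_simp
    ring
  have hs0 : 0 ≤ ∑ j ∈ Finset.Icc 1 n, rad j := Finset.sum_nonneg fun j _ => (rad_pos j).le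
  rw [hsum, hcore', ← ENNReal.ofReal_add (by positivity) (by positivity)]
  refine ENNReal.ofReal_le_ofReal ?_
  have h1 := sum_Icc_rad_le_one n
  have h2 : r ^ 3 ≤ r ^ 2 * (1 / 4) := by rw [pow_succ]; gcongr
  have hε23 : 0 ≤ ε₀ ^ (2 / 3 : ℝ) := Real.rpow_nonneg hε _
  nlinarith [mul_nonneg (mul_nonneg hC (sq_nonneg r)) hε23, mul_nonneg hC hε23]

/-- **The force term over the rings**: with `φ ≤ C₁ r² r_{j+1}⁻³` on the ring `Q_{r_j} ∖ Q_{r_{j+1}}`,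
`φ ≤ C₁ r⁻¹` on `Q_r` (`r = r_{n+1}`), `(A_k)` for `1 ≤ k ≤ n`, and `‖f‖_{L^q(Q_1(z₀))} ≤ κ ε₀^{4/9}`:
`∫∫_{Q_{1/2}} |u| |f| φ ≤ 24 C₁ κ (S + 1) ε₀^{2/3} r²`, `S ≥ Σ_j r_j^{2-5/q}`. [folklore] -/
theorem lintegral_vel_force_weight_le {q κ ε₀ C₁ S : ℝ} (hq : 5 / 2 < q) (hκ : 0 ≤ κ) (hε : 0 ≤ ε₀)
    (hC : 0 ≤ C₁) (hS : ∀ m : ℕ, ∑ j ∈ Finset.Icc 1 m, (rad j) ^ (2 - 5 / q : ℝ) ≤ S)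
    {n : ℕ} (hn : 1 ≤ n) (hz : z ∈ parabolicCylinder (1 / 2) z₀)
    (hf : AEMeasurable (fun w : ℝ × EuclideanSpace ℝ (Fin 3) => ‖f w.1 w.2‖ₑ)
      (volume.restrict (parabolicCylinder 1 z₀)))
    (hu : AEMeasurable (fun w : ℝ × EuclideanSpace ℝ (Fin 3) => ‖u w.1 w.2‖ₑ)
      (volume.restrict (parabolicCylinder 1 z₀)))
    (hF : ∫⁻ w in parabolicCylinder 1 z₀, ‖f w.1 w.2‖ₑ ^ q ≤
      ENNReal.ofReal ((κ * ε₀ ^ (4 / 9 : ℝ)) ^ q))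
    (hA : ∀ k : ℕ, 1 ≤ k → k ≤ n → HypA ε₀ u p k z)
    {φ : ℝ → EuclideanSpace ℝ (Fin 3) → ℝ}
    (hring : ∀ j : ℕ, 1 ≤ j → j + 1 ≤ n + 1 →
      ∀ w ∈ parabolicCylinder (rad j) z \ parabolicCylinder (rad (j + 1)) z,
        φ w.1 w.2 ≤ C₁ * (rad (n + 1)) ^ 2 * ((rad (j + 1)) ^ 3)⁻¹)
    (hcore : ∀ w ∈ parabolicCylinder (rad (n + 1)) z, φ w.1 w.2 ≤ C₁ * (rad (n + 1))⁻¹) :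
    ∫⁻ w in parabolicCylinder (rad 1) z, ‖u w.1 w.2‖ₑ * ‖f w.1 w.2‖ₑ * ENNReal.ofReal (φ w.1 w.2) ≤
      ENNReal.ofReal (24 * C₁ * κ * (S + 1) * ε₀ ^ (2 / 3 : ℝ) * (rad (n + 1)) ^ 2) := by
  set r := rad (n + 1) with hr_def
  have hr : 0 < r := rad_pos _
  have hrn : rad n = 2 * r := by rw [hr_def, rad_succ]; ring
  have hq0 : 0 < q := by linarith
  have hcyl : ∀ k : ℕ, 1 ≤ k → k ≤ n →
      ∫⁻ w in parabolicCylinder (rad k) z, ‖u w.1 w.2‖ₑ * ‖f w.1 w.2‖ₑ ≤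
        ENNReal.ofReal (3 * κ * ε₀ ^ (2 / 3 : ℝ) * (rad k) ^ (5 - 5 / q : ℝ)) := fun k hk1 hk2 =>
    lintegral_vel_force_le hq hκ hε (parabolicCylinder_rad_subset hz hk1) hf hu hF
      (lintegral_cube_le_of_hypA (hA k hk1 hk2))
  have H := lintegral_mul_weight_le_sum_rings z (n := n)
    (g := fun w => ‖u w.1 w.2‖ₑ * ‖f w.1 w.2‖ₑ) (W := fun w => ENNReal.ofReal (φ w.1 w.2))
    (a := fun j => C₁ * r ^ 2 * ((rad (j + 1)) ^ 3)⁻¹)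
    (b := fun j => ENNReal.ofReal (3 * κ * ε₀ ^ (2 / 3 : ℝ) * (rad j) ^ (5 - 5 / q : ℝ)))
    (ac := C₁ * r⁻¹) (bc := ENNReal.ofReal (3 * κ * ε₀ ^ (2 / 3 : ℝ) * (rad n) ^ (5 - 5 / q : ℝ)))
    (fun j hj w hw => ENNReal.ofReal_le_ofReal
      (hring j (Finset.mem_Icc.1 hj).1 (by linarith [(Finset.mem_Icc.1 hj).2]) w hw))
    (fun w hw => ENNReal.ofReal_le_ofReal (hcore w hw))
    (fun j hj => hcyl j (Finset.mem_Icc.1 hj).1 (Finset.mem_Icc.1 hj).2)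
    ((lintegral_mono_set (parabolicCylinder_mono (rad_pos _).le (rad_succ_le n) z)).trans (hcyl n hn le_rfl))
  refine H.trans ?_
  have hsum : ∑ j ∈ Finset.Icc 1 n, ENNReal.ofReal (C₁ * r ^ 2 * ((rad (j + 1)) ^ 3)⁻¹) *
      ENNReal.ofReal (3 * κ * ε₀ ^ (2 / 3 : ℝ) * (rad j) ^ (5 - 5 / q : ℝ)) =
      ENNReal.ofReal (24 * C₁ * κ * r ^ 2 * ε₀ ^ (2 / 3 : ℝ) *
        ∑ j ∈ Finset.Icc 1 n, (rad j) ^ (2 - 5 / q : ℝ)) := by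
    rw [Finset.mul_sum, ENNReal.ofReal_sum_of_nonneg (fun j _ => by
      have := rad_pos j; have := rad_pos (j + 1); positivity)]
    refine Finset.sum_congr rfl fun j _ => ?_
    have hj := rad_pos j
    have hj1 := rad_pos (j + 1)
    rw [← ENNReal.ofReal_mul (by positivity)]
    congr 1
    have hsplit : (rad j) ^ (5 - 5 / q : ℝ) = (rad j) ^ (2 - 5 / q : ℝ) * (rad j) ^ 3 := by
      rw [show (5 - 5 / q : ℝ) = (2 - 5 / q) + ((3 : ℕ) : ℝ) by push_cast; ring,
        Real.rpow_add hj, Real.rpow_natCast]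
    rw [rad_succ, hsplit]
    field_simp
    ring
  have hcore' : ENNReal.ofReal (C₁ * r⁻¹) *
      ENNReal.ofReal (3 * κ * ε₀ ^ (2 / 3 : ℝ) * (rad n) ^ (5 - 5 / q : ℝ)) ≤
      ENNReal.ofReal (24 * C₁ * κ * ε₀ ^ (2 / 3 : ℝ) * r ^ 2) := by
    have hn0 := rad_pos n
    rw [← ENNReal.ofReal_mul (by positivity)]
    refine ENNReal.ofReal_le_ofReal ?_
    have hle : (rad n) ^ (5 - 5 / q : ℝ) ≤ (rad n) ^ 3 := by
      rw [show ((rad n) ^ 3 : ℝ) = (rad n) ^ ((3 : ℕ) : ℝ) from (Real.rpow_natCast _ 3).symm]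
      refine Real.rpow_le_rpow_of_exponent_ge (rad_pos n) (rad_le_one n) ?_
      have h5q : 5 / q ≤ 2 := by rw [div_le_iff₀ hq0]; linarith
      push_cast
      linarith
    calc C₁ * r⁻¹ * (3 * κ * ε₀ ^ (2 / 3 : ℝ) * (rad n) ^ (5 - 5 / q : ℝ))
        ≤ C₁ * r⁻¹ * (3 * κ * ε₀ ^ (2 / 3 : ℝ) * (rad n) ^ 3) := by gcongr
      _ = 24 * C₁ * κ * ε₀ ^ (2 / 3 : ℝ) * r ^ 2 := by rw [hrn]; field_simp; ring
  calc (∑ j ∈ Finset.Icc 1 n, ENNReal.ofReal (C₁ * r ^ 2 * ((rad (j + 1)) ^ 3)⁻¹) *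
        ENNReal.ofReal (3 * κ * ε₀ ^ (2 / 3 : ℝ) * (rad j) ^ (5 - 5 / q : ℝ))) +
        ENNReal.ofReal (C₁ * r⁻¹) * ENNReal.ofReal (3 * κ * ε₀ ^ (2 / 3 : ℝ) * (rad n) ^ (5 - 5 / q : ℝ))
      ≤ ENNReal.ofReal (24 * C₁ * κ * r ^ 2 * ε₀ ^ (2 / 3 : ℝ) * S) +
          ENNReal.ofReal (24 * C₁ * κ * ε₀ ^ (2 / 3 : ℝ) * r ^ 2) := by
        rw [hsum]
        gcongr
        exact hS n
    _ = _ := by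
        have hS0 : 0 ≤ S := le_trans (Finset.sum_nonneg fun j _ => Real.rpow_nonneg (rad_pos j).le _) (hS 0)
        rw [← ENNReal.ofReal_add (by positivity) (by positivity)]
        congr 1; ring

/-- **The pressure sum** (RRS p. 223): with `(A_k)` for `1 ≤ k ≤ n`,
`Σ_{k=1}^{n} C r_k⁻⁴ ∫∫_{Q_{r_k}} |u| |p - (p)_{r_k}| ≤ C ε₀^{2/3} Σ_k r_k^{2/3} ≤ 2 C ε₀^{2/3}`. [cite: RobinsonRodrigoSadowski2016, p. 223] -/
theorem sum_lintegral_vel_presOsc_le {ε₀ C : ℝ} (hε : 0 ≤ ε₀) (hC : 0 ≤ C) {n : ℕ}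
    (hu : ∀ k ∈ Finset.Icc 1 n, AEMeasurable (fun w : ℝ × EuclideanSpace ℝ (Fin 3) => ‖u w.1 w.2‖ₑ)
      (volume.restrict (parabolicCylinder (rad k) z)))
    (hp : ∀ k ∈ Finset.Icc 1 n, AEMeasurable (fun w : ℝ × EuclideanSpace ℝ (Fin 3) =>
      ‖p w.1 w.2 - ⨍ y in ball z.2 (rad k), p w.1 y‖ₑ) (volume.restrict (parabolicCylinder (rad k) z)))
    (hA : ∀ k : ℕ, 1 ≤ k → k ≤ n → HypA ε₀ u p k z) :
    ∑ k ∈ Finset.Icc 1 n, ENNReal.ofReal (C * ((rad k) ^ 4)⁻¹) *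
        ∫⁻ w in parabolicCylinder (rad k) z,
          ‖u w.1 w.2‖ₑ * ‖p w.1 w.2 - ⨍ y in ball z.2 (rad k), p w.1 y‖ₑ ≤
      ENNReal.ofReal (2 * C * ε₀ ^ (2 / 3 : ℝ)) := by
  calc ∑ k ∈ Finset.Icc 1 n, ENNReal.ofReal (C * ((rad k) ^ 4)⁻¹) *
        ∫⁻ w in parabolicCylinder (rad k) z,
          ‖u w.1 w.2‖ₑ * ‖p w.1 w.2 - ⨍ y in ball z.2 (rad k), p w.1 y‖ₑ
      ≤ ∑ k ∈ Finset.Icc 1 n, ENNReal.ofReal (C * ((rad k) ^ 4)⁻¹) *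
          ENNReal.ofReal (ε₀ ^ (2 / 3 : ℝ) * (rad k) ^ (14 / 3 : ℝ)) := by
        refine Finset.sum_le_sum fun k hk => ?_
        gcongr
        exact lintegral_vel_presOsc_le hε (hu k hk) (hp k hk)
          (hA k (Finset.mem_Icc.1 hk).1 (Finset.mem_Icc.1 hk).2)
    _ = ENNReal.ofReal (C * ε₀ ^ (2 / 3 : ℝ) * ∑ k ∈ Finset.Icc 1 n, (rad k) ^ (2 / 3 : ℝ)) := by
        rw [Finset.mul_sum, ENNReal.ofReal_sum_of_nonneg (fun k _ => by have := rad_pos k; positivity)]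
        refine Finset.sum_congr rfl fun k _ => ?_
        have hk := rad_pos k
        rw [← ENNReal.ofReal_mul (by positivity)]
        congr 1
        have hsplit : (rad k) ^ (14 / 3 : ℝ) = (rad k) ^ (2 / 3 : ℝ) * (rad k) ^ 4 := by
          rw [show (14 / 3 : ℝ) = 2 / 3 + ((4 : ℕ) : ℝ) by norm_num, Real.rpow_add hk, Real.rpow_natCast]
        rw [hsplit]
        field_simp
    _ ≤ ENNReal.ofReal (C * ε₀ ^ (2 / 3 : ℝ) * 2) := by
        refine ENNReal.ofReal_le_ofReal ?_
        exact mul_le_mul_of_nonneg_left (sum_Icc_rad_rpow_twoThirds_le n)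
          (mul_nonneg hC (Real.rpow_nonneg hε _))
    _ = _ := by congr 1; ring

end RingSums

/-! ### Step 2: support geometry of `φ_{n+1}` and integrability helpers -/

section Geometry

variable {z₀ z : ℝ × EuclideanSpace ℝ (Fin 3)}

/-- **Where `φ` lives below the top time.** If `supp φ ⊆ (s - 1/9, s + r²/2) × B_{1/2}(a)` and
`supp φ ∩ Q_1(z) ⊆ Q_{1/3}(z)` (Lemma 15.11 (iii)), then every point of `tsupport φ` with
`τ < s` lies in `[s - 1/9, s] × B̄_{1/3}(a)`. [folklore] -/
theorem mem_box_of_mem_tsupport {φ : ℝ → EuclideanSpace ℝ (Fin 3) → ℝ} {ρ : ℝ}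
    (hbox : support (uncurry φ) ⊆ Ioo (z.1 - 1 / 9) (z.1 + ρ) ×ˢ ball z.2 (1 / 2))
    (h13 : support (uncurry φ) ∩ parabolicCylinder 1 z ⊆ parabolicCylinder (1 / 3) z)
    {w : ℝ × EuclideanSpace ℝ (Fin 3)} (hw : w ∈ tsupport (uncurry φ)) (hws : w.1 < z.1) :
    w ∈ Icc (z.1 - 1 / 9) z.1 ×ˢ closedBall z.2 (1 / 3) := by
  -- `w ∈ Q_1(z)`
  have hcl : tsupport (uncurry φ) ⊆ Icc (z.1 - 1 / 9) (z.1 + ρ) ×ˢ closedBall z.2 (1 / 2) := by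
    refine (closure_mono hbox).trans ?_
    rw [closure_prod_eq]
    exact prod_mono (closure_minimal Ioo_subset_Icc_self isClosed_Icc) closure_ball_subset_closedBall
  have hw' := hcl hw
  rw [mem_prod, mem_Icc, mem_closedBall] at hw'
  have hwU : w ∈ parabolicCylinder 1 z := by
    rw [mem_parabolicCylinder]
    exact ⟨⟨by linarith [hw'.1.1], hws⟩, by linarith [hw'.2]⟩
  -- `Q_1(z) ∩ closure(supp) ⊆ closure(Q_1(z) ∩ supp) ⊆ closure(Q_{1/3}(z))`
  have h1 : w ∈ closure (parabolicCylinder 1 z ∩ support (uncurry φ)) :=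
    (isOpen_parabolicCylinder 1 z).inter_closure ⟨hwU, hw⟩
  have h2 : closure (parabolicCylinder 1 z ∩ support (uncurry φ)) ⊆
      Icc (z.1 - 1 / 9) z.1 ×ˢ closedBall z.2 (1 / 3) := by
    have h13' : parabolicCylinder 1 z ∩ support (uncurry φ) ⊆ parabolicCylinder (1 / 3) z := by
      rw [inter_comm]; exact h13
    refine (closure_mono h13').trans ?_
    have e : parabolicCylinder (1 / 3) z = Ioo (z.1 - 1 / 9) z.1 ×ˢ ball z.2 (1 / 3) := by
      rw [parabolicCylinder]; norm_num
    rw [e, closure_prod_eq]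
    exact prod_mono (closure_minimal Ioo_subset_Icc_self isClosed_Icc) closure_ball_subset_closedBall
  exact h2 h1

/-- The box `[s - 1/9, s] × B̄_{1/3}(a)` below the top time lies in `Q_{1/2}(z) = Q_{r_1}(z)`. [folklore] -/
theorem mem_parabolicCylinder_radOne_of_mem_box {w : ℝ × EuclideanSpace ℝ (Fin 3)}
    (hw : w ∈ Icc (z.1 - 1 / 9) z.1 ×ˢ closedBall z.2 (1 / 3)) (hws : w.1 < z.1) :
    w ∈ parabolicCylinder (rad 1) z := by
  rw [mem_prod, mem_Icc, mem_closedBall] at hw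
  rw [mem_parabolicCylinder, rad_one]
  exact ⟨⟨by linarith [hw.1.1], hws⟩, by linarith [hw.2]⟩

/-- The box `[s - 1/9, s] × B̄_{1/3}(a)` lies in `Q_1(z₀)` for `z ∈ Q_{1/2}(z₀)`. [folklore] -/
theorem box_subset_parabolicCylinder_one (hz : z ∈ parabolicCylinder (1 / 2) z₀) :
    Icc (z.1 - 1 / 9) z.1 ×ˢ closedBall z.2 (1 / 3) ⊆ parabolicCylinder 1 z₀ := by
  intro w hw
  rw [mem_prod, mem_Icc, mem_closedBall] at hw
  rw [mem_parabolicCylinder] at hz ⊢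
  obtain ⟨⟨hz1, hz2⟩, hz3⟩ := hz
  refine ⟨⟨by linarith [hw.1.1], by linarith [hw.1.2]⟩, ?_⟩
  calc dist w.2 z₀.2 ≤ dist w.2 z.2 + dist z.2 z₀.2 := dist_triangle _ _ _
    _ < 1 / 3 + 1 / 2 := add_lt_add_of_le_of_lt hw.2 hz3
    _ ≤ 1 := by norm_num

/-- `tsupport φ` below every time level `τ' < s` lies in `Q_1(z₀)` (the hypothesis `hζQ` of the
sliced local energy inequality below a time level). [folklore] -/
theorem tsupport_inter_subset_of_box {φ : ℝ → EuclideanSpace ℝ (Fin 3) → ℝ} {ρ : ℝ}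
    (hz : z ∈ parabolicCylinder (1 / 2) z₀)
    (hbox : support (uncurry φ) ⊆ Ioo (z.1 - 1 / 9) (z.1 + ρ) ×ˢ ball z.2 (1 / 2))
    (h13 : support (uncurry φ) ∩ parabolicCylinder 1 z ⊆ parabolicCylinder (1 / 3) z) :
    ∀ τ' < z.1, tsupport (uncurry φ) ∩ {w | w.1 ≤ τ'} ⊆
      ((parabolicCylinderOpens 1 z₀ : Opens (ℝ × EuclideanSpace ℝ (Fin 3))) :
        Set (ℝ × EuclideanSpace ℝ (Fin 3))) := by
  intro τ' hτ' w hw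
  rw [coe_parabolicCylinderOpens]
  exact box_subset_parabolicCylinder_one hz
    (mem_box_of_mem_tsupport hbox h13 hw.1 (lt_of_le_of_lt hw.2 hτ'))

end Geometry

section Integrability

variable {X : Type*} [MeasurableSpace X]

/-- **Norm of a set integral by a Lebesgue integral on a larger set**: if on `S` the integrand is
dominated by `Q.indicator G`, then `‖∫_S g‖ ≤ (∫⁻_Q G).toReal`. [folklore] -/
theorem norm_setIntegral_le_toReal_lintegral {μ : Measure X} {g : X → ℝ} {S Q : Set X}
    (hS : MeasurableSet S) (hQ : MeasurableSet Q) {G : X → ℝ≥0∞}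
    (h : ∀ w ∈ S, ‖g w‖ₑ ≤ Q.indicator G w) (hfin : ∫⁻ w in Q, G w ∂μ ≠ ∞) :
    ‖∫ w in S, g w ∂μ‖ ≤ (∫⁻ w in Q, G w ∂μ).toReal := by
  refine (norm_integral_le_lintegral_norm _).trans (ENNReal.toReal_mono hfin ?_)
  calc ∫⁻ w in S, ENNReal.ofReal ‖g w‖ ∂μ = ∫⁻ w in S, ‖g w‖ₑ ∂μ :=
        lintegral_congr fun w => ofReal_norm _
    _ ≤ ∫⁻ w in S, Q.indicator G w ∂μ := setLIntegral_mono' hS h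
    _ ≤ ∫⁻ w, Q.indicator G w ∂μ := lintegral_mono' Measure.restrict_le_self le_rfl
    _ = ∫⁻ w in Q, G w ∂μ := lintegral_indicator hQ _

/-- Products of an `L³` and an `L^{3/2}` function on a set are integrable there. [folklore] -/
theorem integrableOn_mul_of_L3_L32 {μ : Measure X} {S : Set X} {F H : X → ℝ}
    (hF : AEStronglyMeasurable F (μ.restrict S)) (hH : AEStronglyMeasurable H (μ.restrict S))
    (h3 : ∫⁻ w in S, ‖F w‖ₑ ^ (3 : ℕ) ∂μ ≠ ∞) (h32 : ∫⁻ w in S, ‖H w‖ₑ ^ (3 / 2 : ℝ) ∂μ ≠ ∞) :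
    IntegrableOn (fun w => F w * H w) S μ := by
  refine ⟨hF.mul hH, ?_⟩
  rw [hasFiniteIntegral_iff_enorm]
  calc ∫⁻ w in S, ‖F w * H w‖ₑ ∂μ = ∫⁻ w in S, ‖F w‖ₑ * ‖H w‖ₑ ∂μ :=
        lintegral_congr fun w => enorm_mul _ _
    _ ≤ (∫⁻ w in S, ‖F w‖ₑ ^ (3 : ℕ) ∂μ) ^ (1 / 3 : ℝ) *
          (∫⁻ w in S, ‖H w‖ₑ ^ (3 / 2 : ℝ) ∂μ) ^ (2 / 3 : ℝ) :=
        lintegral_mul_le_L3_L32 _ hF.enorm hH.enorm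
    _ < ∞ := ENNReal.mul_lt_top (ENNReal.rpow_lt_top_of_nonneg (by norm_num) h3)
        (ENNReal.rpow_lt_top_of_nonneg (by norm_num) h32)

end Integrability

/-! ### Step 2: the pressure term -/

section Pressure

variable {z₀ z : ℝ × EuclideanSpace ℝ (Fin 3)} {n : ℕ} {ν : ℝ}
  {f u : ℝ → EuclideanSpace ℝ (Fin 3) → EuclideanSpace ℝ (Fin 3)}
  {p : ℝ → EuclideanSpace ℝ (Fin 3) → ℝ}
  {G : ℝ → EuclideanSpace ℝ (Fin 3) → EuclideanSpace ℝ (Fin 3) →L[ℝ] EuclideanSpace ℝ (Fin 3)}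
  {φ : ℝ → EuclideanSpace ℝ (Fin 3) → ℝ}

/-- `Φ_k` is a space–time test function (on the whole space–time) when `φ` is. [folklore] -/
theorem isSpaceTimeTestOn_top_presTest (hφs : ContDiff ℝ (⊤ : ℕ∞) (uncurry φ))
    (hφc : HasCompactSupport (uncurry φ)) (k : ℕ) :
    IsSpaceTimeTestOn (⊤ : Opens (ℝ × EuclideanSpace ℝ (Fin 3))) (presTest z n φ k) :=
  ⟨contDiff_presTest hφs k,
    hφc.of_isClosed_subset (isClosed_tsupport _) (tsupport_presTest_subset φ k),
    fun _ _ => trivial⟩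

/-- The slices of `Φ_k` are differentiable. [folklore] -/
theorem differentiable_presTest (hφd : ∀ τ, Differentiable ℝ (φ τ)) (k : ℕ) (τ : ℝ) :
    Differentiable ℝ (presTest z n φ k τ) :=
  ((differentiable_cylCutN k τ).sub (differentiable_cylCutN (k + 1) τ)).mul (hφd τ)

/-- **`χ_{r_1} φ = φ` below the top time** (RRS p. 222: "`χ_1 φ_n = φ_n`, since the support of
`φ_n` is always contained in `Q_{1/3} ⊂ Q_{1/2 × 7/8}`"). [cite: RobinsonRodrigoSadowski2016, p. 222] -/
theorem cylCut_radOne_mul_eq {ρ : ℝ}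
    (hbox : support (uncurry φ) ⊆ Ioo (z.1 - 1 / 9) (z.1 + ρ) ×ˢ ball z.2 (1 / 2))
    (h13 : support (uncurry φ) ∩ parabolicCylinder 1 z ⊆ parabolicCylinder (1 / 3) z)
    {τ : ℝ} (hτ : τ < z.1) (y : EuclideanSpace ℝ (Fin 3)) :
    cylCut z (rad 1) τ y * φ τ y = φ τ y := by
  by_cases h0 : φ τ y = 0
  · rw [h0, mul_zero]
  · have hmem : (τ, y) ∈ tsupport (uncurry φ) := subset_tsupport _ (by exact h0)
    have hbox' := mem_box_of_mem_tsupport hbox h13 hmem hτ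
    rw [mem_prod, mem_Icc, mem_closedBall, dist_eq_norm] at hbox'
    rw [cylCut_eq_one (rad_pos 1) (by rw [rad_one]; simp only at hbox'; linarith [hbox'.2])
      (by rw [rad_one]; simp only at hbox'; nlinarith [hbox'.1.1]), one_mul]

/-- **The telescoping decomposition of `∇φ`** below the top time:
`∇φ(τ, ·) = Σ_{k=1}^{n} ∇Φ_k(τ, ·)`. [cite: RobinsonRodrigoSadowski2016, p. 222] -/
theorem gradient_eq_sum_presTest (hn : 1 ≤ n) (hφd : ∀ τ, Differentiable ℝ (φ τ)) {ρ : ℝ}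
    (hbox : support (uncurry φ) ⊆ Ioo (z.1 - 1 / 9) (z.1 + ρ) ×ˢ ball z.2 (1 / 2))
    (h13 : support (uncurry φ) ∩ parabolicCylinder 1 z ⊆ parabolicCylinder (1 / 3) z)
    {τ : ℝ} (hτ : τ < z.1) (y : EuclideanSpace ℝ (Fin 3)) :
    gradient (φ τ) y = ∑ k ∈ Finset.Icc 1 n, gradient (presTest z n φ k τ) y := by
  have hfun : φ τ = fun y => ∑ k ∈ Finset.Icc 1 n, presTest z n φ k τ y := by
    funext y'
    rw [sum_presTest_eq hn, cylCut_radOne_mul_eq hbox h13 hτ]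
  have hsum : HasFDerivAt (fun y => ∑ k ∈ Finset.Icc 1 n, presTest z n φ k τ y)
      (∑ k ∈ Finset.Icc 1 n, fderiv ℝ (presTest z n φ k τ) y) y :=
    HasFDerivAt.fun_sum fun k _ => ((differentiable_presTest hφd k τ) y).hasFDerivAt
  unfold gradient
  rw [hfun, hsum.fderiv, map_sum]

/-- **Slice-wise divergence freedom against `Φ_k`**: for a suitable pair on `Q_1(z₀)` and
`z ∈ Q_{1/2}(z₀)`, for a.e. `τ < s`, `∫ ⟪u(τ), ∇Φ_k(τ, ·)⟫ = 0` (RRS (15.24)). [cite: RobinsonRodrigoSadowski2016, (15.24) p. 222] -/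
theorem ae_integral_inner_gradient_presTest_eq_zero
    (hS : IsSuitablePair (parabolicCylinderOpens 1 z₀) ν f u p G)
    (hz : z ∈ parabolicCylinder (1 / 2) z₀) (hφs : ContDiff ℝ (⊤ : ℕ∞) (uncurry φ))
    (hφc : HasCompactSupport (uncurry φ)) {ρ : ℝ}
    (hbox : support (uncurry φ) ⊆ Ioo (z.1 - 1 / 9) (z.1 + ρ) ×ˢ ball z.2 (1 / 2))
    (h13 : support (uncurry φ) ∩ parabolicCylinder 1 z ⊆ parabolicCylinder (1 / 3) z) (k : ℕ) :
    ∀ᵐ τ ∂(volume : Measure ℝ), τ < z.1 →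
      ∫ y, ⟪u τ y, gradient (presTest z n φ k τ) y⟫ = 0 := by
  set δ : ℕ → ℝ := fun j => 1 / ((j : ℝ) + 1) with hδ
  have hδ0 : ∀ j, 0 < δ j := fun j => by positivity
  choose θ ρ' hθs hθd hθ1 hθ0 hρ0 hθnn using fun j => exists_time_level_cutoff z.1 (hδ0 j)
  have hPT := isSpaceTimeTestOn_top_presTest (z := z) (n := n) hφs hφc k
  have hζQ : ∀ τ' < z.1, tsupport (uncurry (presTest z n φ k)) ∩ {w | w.1 ≤ τ'} ⊆
      ((parabolicCylinderOpens 1 z₀ : Opens (ℝ × EuclideanSpace ℝ (Fin 3))) :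
        Set (ℝ × EuclideanSpace ℝ (Fin 3))) := fun τ' hτ' =>
    (inter_subset_inter_left _ (tsupport_presTest_subset φ k)).trans
      (tsupport_inter_subset_of_box hz hbox h13 τ' hτ')
  have htest : ∀ j, IsSpaceTimeTestOn (parabolicCylinderOpens 1 z₀)
      (fun t x => θ j t * presTest z n φ k t x) := fun j =>
    hPT.time_mul_of_forall_lt hζQ (hθs j) (by linarith [hδ0 j]) (hθ0 j)
  have hae := ae_all_iff.2 fun j =>
    ae_integral_inner_gradient_eq_zero hS.weakGradient.locallyIntegrableOn hS.divFree (htest j)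
  filter_upwards [hae] with τ hτ' hτs
  obtain ⟨j, hj⟩ := exists_nat_one_div_lt (show 0 < (z.1 - τ) / 3 by linarith)
  have hj' : τ < z.1 - 3 * δ j := by
    simp only [hδ]
    linarith
  have h1 : θ j τ = 1 := hθ1 j τ hj'.le
  have e : (fun x => θ j τ * presTest z n φ k τ x) = presTest z n φ k τ := by
    funext x; rw [h1, one_mul]
  have := hτ' j
  rw [e] at this
  exact this

/-- **The pressure term against one `Φ_k`** (RRS p. 223): for `t < s`, if `∇Φ_k(τ, ·)` vanishes
off `Q_{r_k}(z)` and is bounded by `B` below the top time, and `(A_k)` holds, then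
`|∫∫_{τ<t} p ⟪u, ∇Φ_k⟫| = |∫∫_{τ<t} (p - (p)_{r_k}) ⟪u, ∇Φ_k⟫| ≤ B ε₀^{2/3} r_k^{14/3}`,
and the integrand is integrable on `{τ < t}`. [cite: RobinsonRodrigoSadowski2016, p. 223] -/
theorem pressure_presTest_bound {Ω : Set (ℝ × EuclideanSpace ℝ (Fin 3))}
    (hu_meas : AEStronglyMeasurable (uncurry u) (volume.restrict Ω))
    (hp_meas : AEStronglyMeasurable (uncurry p) (volume.restrict Ω))
    (hu3 : ∫⁻ w in Ω, ‖u w.1 w.2‖ₑ ^ (3 : ℕ) ≠ ∞)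
    (hp32 : ∫⁻ w in Ω, ‖p w.1 w.2‖ₑ ^ (3 / 2 : ℝ) ≠ ∞)
    {k : ℕ} (hsubk : parabolicCylinder (rad k) z ⊆ Ω)
    (hdivk : ∀ᵐ τ ∂(volume : Measure ℝ), τ < z.1 →
      ∫ y, ⟪u τ y, gradient (presTest z n φ k τ) y⟫ = 0)
    (hgradc : Continuous (fun w : ℝ × EuclideanSpace ℝ (Fin 3) => gradient (presTest z n φ k w.1) w.2))
    (hgrad0 : ∀ τ < z.1, ∀ y, (τ, y) ∉ parabolicCylinder (rad k) z →
      gradient (presTest z n φ k τ) y = 0)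
    {B : ℝ} (hB : 0 ≤ B) (hgradb : ∀ τ < z.1, ∀ y, ‖gradient (presTest z n φ k τ) y‖ ≤ B)
    {ε₀ : ℝ} (hε : 0 ≤ ε₀) (hA : HypA ε₀ u p k z) {t : ℝ} (ht : t < z.1) :
    IntegrableOn (fun w : ℝ × EuclideanSpace ℝ (Fin 3) =>
        p w.1 w.2 * ⟪u w.1 w.2, gradient (presTest z n φ k w.1) w.2⟫) {w | w.1 < t} volume ∧
      |∫ w in {w : ℝ × EuclideanSpace ℝ (Fin 3) | w.1 < t},
          p w.1 w.2 * ⟪u w.1 w.2, gradient (presTest z n φ k w.1) w.2⟫| ≤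
        B * (ε₀ ^ (2 / 3 : ℝ) * (rad k) ^ (14 / 3 : ℝ)) := by
  set S : Set (ℝ × EuclideanSpace ℝ (Fin 3)) := {w | w.1 < t} with hS_def
  set Qk := parabolicCylinder (rad k) z with hQk_def
  have hSm : MeasurableSet S := measurableSet_lt measurable_fst measurable_const
  have hQm : MeasurableSet Qk := (isOpen_parabolicCylinder _ z).measurableSet
  set pbar : ℝ × EuclideanSpace ℝ (Fin 3) → ℝ := fun w => ⨍ y in ball z.2 (rad k), p w.1 y with hpbar
  set Ip : ℝ × EuclideanSpace ℝ (Fin 3) → ℝ := fun w =>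
    ⟪u w.1 w.2, gradient (presTest z n φ k w.1) w.2⟫ with hIp
  -- measurability on `Qk`
  have hμk := Measure.restrict_mono (μ := volume) (ν := volume) hsubk le_rfl
  have hu_k : AEStronglyMeasurable (uncurry u) (volume.restrict Qk) := hu_meas.mono_measure hμk
  have hp_k : AEStronglyMeasurable (uncurry p) (volume.restrict Qk) := hp_meas.mono_measure hμk
  have hpbar_k : AEStronglyMeasurable pbar (volume.restrict Qk) := aestronglyMeasurable_setAverage_fst hp_k
  have hIp_k : AEStronglyMeasurable Ip (volume.restrict Qk) :=
    hu_k.inner hgradc.aestronglyMeasurable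
  -- pointwise bound `‖Ip‖ ≤ ‖u‖ B` on `Qk` (all its points are below the top time)
  have hQk_lt : ∀ w ∈ Qk, w.1 < z.1 := fun w hw => ((mem_parabolicCylinder.1 hw).1).2
  have hIp_le : ∀ w : ℝ × EuclideanSpace ℝ (Fin 3), w.1 < z.1 → ‖Ip w‖ ≤ ‖u w.1 w.2‖ * B := fun w hw =>
    (norm_inner_le_norm _ _).trans (mul_le_mul_of_nonneg_left (hgradb w.1 hw w.2) (norm_nonneg _))
  -- `∫_{Qk} ‖Ip‖ₑ³ < ∞`
  have hIp3 : ∫⁻ w in Qk, ‖Ip w‖ₑ ^ (3 : ℕ) ≠ ∞ := by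
    refine ne_of_lt ?_
    calc ∫⁻ w in Qk, ‖Ip w‖ₑ ^ (3 : ℕ)
        ≤ ∫⁻ w in Qk, (‖u w.1 w.2‖ₑ * ENNReal.ofReal B) ^ (3 : ℕ) := by
          refine setLIntegral_mono' hQm fun w hw => ?_
          gcongr
          calc ‖Ip w‖ₑ = ENNReal.ofReal ‖Ip w‖ := (ofReal_norm _).symm
            _ ≤ ENNReal.ofReal (‖u w.1 w.2‖ * B) := ENNReal.ofReal_le_ofReal (hIp_le w (hQk_lt w hw))
            _ = _ := by rw [ENNReal.ofReal_mul (norm_nonneg _), ofReal_norm]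
      _ = ENNReal.ofReal B ^ (3 : ℕ) * ∫⁻ w in Qk, ‖u w.1 w.2‖ₑ ^ (3 : ℕ) := by
          rw [← lintegral_const_mul' _ _ (ENNReal.pow_ne_top ENNReal.ofReal_ne_top)]
          exact lintegral_congr fun w => by ring
      _ < ∞ := ENNReal.mul_lt_top (ENNReal.pow_lt_top ENNReal.ofReal_lt_top)
          (((lintegral_mono_set hsubk).trans_lt (lt_top_iff_ne_top.2 hu3)))
  -- integrability of `P = Ip * p` and `M = Ip * pbar` on `Qk`
  have hP_k : IntegrableOn (fun w => Ip w * p w.1 w.2) Qk volume :=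
    integrableOn_mul_of_L3_L32 hIp_k hp_k hIp3
      (ne_of_lt ((lintegral_mono_set hsubk).trans_lt (lt_top_iff_ne_top.2 hp32)))
  have hM_k : IntegrableOn (fun w => Ip w * pbar w) Qk volume := by
    refine integrableOn_mul_of_L3_L32 hIp_k hpbar_k hIp3 (ne_of_lt ?_)
    calc ∫⁻ w in Qk, ‖pbar w‖ₑ ^ (3 / 2 : ℝ) ≤ ∫⁻ w in Qk, ‖p w.1 w.2‖ₑ ^ (3 / 2 : ℝ) :=
          lintegral_cylinder_enorm_average_rpow_le (rad_pos k) z hp_k (by norm_num)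
      _ < ∞ := (lintegral_mono_set hsubk).trans_lt (lt_top_iff_ne_top.2 hp32)
  -- extension by zero to `S`
  have hzero : ∀ w ∈ S \ Qk, Ip w = 0 := fun w hw => by
    have hw1 : w.1 < z.1 := lt_trans hw.1 ht
    simp only [hIp]
    rw [hgrad0 w.1 hw1 w.2 hw.2, inner_zero_right]
  have hP_S : IntegrableOn (fun w => Ip w * p w.1 w.2) S volume :=
    hP_k.of_forall_sdiff_eq_zero hSm fun w hw => by rw [hzero w hw, zero_mul]
  have hM_S : IntegrableOn (fun w => Ip w * pbar w) S volume :=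
    hM_k.of_forall_sdiff_eq_zero hSm fun w hw => by rw [hzero w hw, zero_mul]
  -- the mean term integrates to zero (Fubini and slice-wise divergence freedom)
  have hM0 : ∫ w in S, Ip w * pbar w = 0 := by
    rw [← integral_indicator hSm]
    have hI : Integrable (S.indicator fun w => Ip w * pbar w) (volume : Measure (ℝ × EuclideanSpace ℝ (Fin 3))) :=
      (integrable_indicator_iff hSm).2 hM_S
    rw [Measure.volume_eq_prod] at hI ⊢
    rw [integral_prod _ hI]
    refine integral_eq_zero_of_ae ?_
    filter_upwards [hdivk] with τ hτ
    by_cases hτt : τ < t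
    · have e : (fun y => S.indicator (fun w => Ip w * pbar w) (τ, y)) =
          fun y => (⨍ y' in ball z.2 (rad k), p τ y') * ⟪u τ y, gradient (presTest z n φ k τ) y⟫ := by
        funext y
        rw [indicator_of_mem (show (τ, y) ∈ S from hτt)]
        simp only [hIp, hpbar]
        ring
      simp only [e]
      rw [Pi.zero_apply, integral_const_mul, hτ (lt_trans hτt ht), mul_zero]
    · have e : (fun y => S.indicator (fun w => Ip w * pbar w) (τ, y)) = fun _ => 0 := by
        funext y
        exact indicator_of_notMem (show (τ, y) ∉ S from hτt) _
      simp only [e]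
      rw [Pi.zero_apply]
      exact integral_zero _ _
  -- the bound
  have hAE_u : AEMeasurable (fun w : ℝ × EuclideanSpace ℝ (Fin 3) => ‖u w.1 w.2‖ₑ) (volume.restrict Qk) :=
    hu_k.enorm
  have hAE_p : AEMeasurable (fun w : ℝ × EuclideanSpace ℝ (Fin 3) => ‖p w.1 w.2 - pbar w‖ₑ)
      (volume.restrict Qk) := (hp_k.sub hpbar_k).enorm
  have hL := lintegral_vel_presOsc_le hε hAE_u hAE_p hA
  refine ⟨hP_S.congr_fun (fun w _ => mul_comm _ _) hSm, ?_⟩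
  have hsplit : ∫ w in S, p w.1 w.2 * Ip w = ∫ w in S, (p w.1 w.2 - pbar w) * Ip w := by
    have e1 : ∫ w in S, p w.1 w.2 * Ip w = ∫ w in S, Ip w * p w.1 w.2 :=
      integral_congr_ae (Eventually.of_forall fun w => mul_comm _ _)
    have e2 : ∫ w in S, (p w.1 w.2 - pbar w) * Ip w =
        ∫ w in S, (Ip w * p w.1 w.2 - Ip w * pbar w) :=
      integral_congr_ae (Eventually.of_forall fun w => by ring)
    rw [e1, e2, integral_sub hP_S hM_S, hM0, sub_zero]
  rw [show (fun w : ℝ × EuclideanSpace ℝ (Fin 3) =>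
      p w.1 w.2 * ⟪u w.1 w.2, gradient (presTest z n φ k w.1) w.2⟫) = fun w => p w.1 w.2 * Ip w from rfl,
    hsplit]
  have hfinG : ∫⁻ w in Qk, ENNReal.ofReal B * (‖u w.1 w.2‖ₑ * ‖p w.1 w.2 - pbar w‖ₑ) ≠ ∞ := by
    rw [lintegral_const_mul' _ _ ENNReal.ofReal_ne_top]
    exact ENNReal.mul_ne_top ENNReal.ofReal_ne_top (ne_top_of_le_ne_top ENNReal.ofReal_ne_top hL)
  have hnorm := norm_setIntegral_le_toReal_lintegral (μ := volume) hSm hQm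
    (g := fun w => (p w.1 w.2 - pbar w) * Ip w)
    (G := fun w => ENNReal.ofReal B * (‖u w.1 w.2‖ₑ * ‖p w.1 w.2 - pbar w‖ₑ)) (fun w hw => ?_) hfinG
  · rw [Real.norm_eq_abs] at hnorm
    refine hnorm.trans ?_
    rw [lintegral_const_mul' _ _ ENNReal.ofReal_ne_top, ENNReal.toReal_mul, ENNReal.toReal_ofReal hB]
    exact mul_le_mul_of_nonneg_left (ENNReal.toReal_le_of_le_ofReal
      (mul_nonneg (Real.rpow_nonneg hε _) (Real.rpow_nonneg (rad_pos k).le _)) hL) hB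
  · -- the pointwise domination on `S`
    by_cases hwQ : w ∈ Qk
    · rw [indicator_of_mem hwQ]
      calc ‖(p w.1 w.2 - pbar w) * Ip w‖ₑ = ENNReal.ofReal ‖(p w.1 w.2 - pbar w) * Ip w‖ :=
            (ofReal_norm _).symm
        _ ≤ ENNReal.ofReal (‖p w.1 w.2 - pbar w‖ * (‖u w.1 w.2‖ * B)) := by
            refine ENNReal.ofReal_le_ofReal ?_
            rw [norm_mul]
            exact mul_le_mul_of_nonneg_left (hIp_le w (hQk_lt w hwQ)) (norm_nonneg _)
        _ = ENNReal.ofReal B * (‖u w.1 w.2‖ₑ * ‖p w.1 w.2 - pbar w‖ₑ) := by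
            rw [ENNReal.ofReal_mul (norm_nonneg _), ENNReal.ofReal_mul (norm_nonneg _), ofReal_norm,
              ofReal_norm]
            ring
    · rw [indicator_of_notMem hwQ, hzero w ⟨hw, hwQ⟩, mul_zero, enorm_zero]

end Pressure

/-! ### Step 2: integrability of the pieces of the local energy integrand and their bounds -/

section Pieces

variable {z₀ z : ℝ × EuclideanSpace ℝ (Fin 3)} {n : ℕ}
  {f u : ℝ → EuclideanSpace ℝ (Fin 3) → EuclideanSpace ℝ (Fin 3)}
  {p : ℝ → EuclideanSpace ℝ (Fin 3) → ℝ}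
  {G : ℝ → EuclideanSpace ℝ (Fin 3) → EuclideanSpace ℝ (Fin 3) →L[ℝ] EuclideanSpace ℝ (Fin 3)}
  {φ : ℝ → EuclideanSpace ℝ (Fin 3) → ℝ}

/-- Integrability on `S` of a function dominated on a measurable `Q` by an integrable one and
vanishing on `S ∖ Q`. [folklore] -/
theorem integrableOn_of_dominated_of_zero {X : Type*} [MeasurableSpace X] {μ : Measure X}
    {S Q : Set X} (hS : MeasurableSet S) (hQ : MeasurableSet Q) {g H : X → ℝ}
    (hgm : AEStronglyMeasurable g (μ.restrict Q)) (hH : IntegrableOn H Q μ)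
    (hdom : ∀ x ∈ Q, ‖g x‖ ≤ H x) (hzero : ∀ x ∈ S \ Q, g x = 0) : IntegrableOn g S μ := by
  have h : IntegrableOn g Q μ := Integrable.mono' hH hgm (ae_restrict_of_forall_mem hQ hdom)
  exact h.of_forall_sdiff_eq_zero hS hzero

/-- `∫_{Q} |u|² < ∞` from `∫_{Q} |u|³ < ∞` on a set of finite measure (`|u|² ≤ 1 + |u|³`). [folklore] -/
theorem integrableOn_sq_of_cube {Q : Set (ℝ × EuclideanSpace ℝ (Fin 3))} (hQ : volume Q < ∞)
    (hu : AEStronglyMeasurable (uncurry u) (volume.restrict Q))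
    (hu3 : IntegrableOn (fun w : ℝ × EuclideanSpace ℝ (Fin 3) => ‖u w.1 w.2‖ ^ 3) Q volume) :
    IntegrableOn (fun w : ℝ × EuclideanSpace ℝ (Fin 3) => ‖u w.1 w.2‖ ^ 2) Q volume := by
  have h1 : IntegrableOn (fun _ : ℝ × EuclideanSpace ℝ (Fin 3) => (1 : ℝ)) Q volume :=
    integrableOn_const hQ.ne
  refine Integrable.mono' (h1.add hu3) (hu.norm.pow 2) (Eventually.of_forall fun w => ?_)
  rw [Real.norm_of_nonneg (sq_nonneg _)]
  have h0 := norm_nonneg (u w.1 w.2)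
  show ‖u w.1 w.2‖ ^ 2 ≤ 1 + ‖u w.1 w.2‖ ^ 3
  nlinarith [sq_nonneg (‖u w.1 w.2‖ - 1), sq_nonneg ‖u w.1 w.2‖]

/-- `∫_{Q} |u|³ < ∞` as a Bochner integrability statement. [folklore] -/
theorem integrableOn_cube_of_lintegral {Q : Set (ℝ × EuclideanSpace ℝ (Fin 3))}
    (hu : AEStronglyMeasurable (uncurry u) (volume.restrict Q))
    (hu3 : ∫⁻ w in Q, ‖u w.1 w.2‖ₑ ^ (3 : ℕ) ≠ ∞) :
    IntegrableOn (fun w : ℝ × EuclideanSpace ℝ (Fin 3) => ‖u w.1 w.2‖ ^ 3) Q volume := by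
  refine ⟨hu.norm.pow 3, ?_⟩
  rw [hasFiniteIntegral_iff_enorm]
  refine lt_of_le_of_lt (lintegral_mono fun w => le_of_eq ?_) (lt_top_iff_ne_top.2 hu3)
  rw [Real.enorm_eq_ofReal (pow_nonneg (norm_nonneg _) 3), ENNReal.ofReal_pow (norm_nonneg _), ofReal_norm]

/-- `|G|²` is integrable on `Q` when `∫_Q |G|² < ∞`. [folklore] -/
theorem integrableOn_frobeniusNormSq {Q : Set (ℝ × EuclideanSpace ℝ (Fin 3))}
    (hG : AEStronglyMeasurable (fun w : ℝ × EuclideanSpace ℝ (Fin 3) => frobeniusNormSq (G w.1 w.2))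
      (volume.restrict Q))
    (hG2 : ∫⁻ w in Q, ENNReal.ofReal (frobeniusNormSq (G w.1 w.2)) ≠ ∞) :
    IntegrableOn (fun w : ℝ × EuclideanSpace ℝ (Fin 3) => frobeniusNormSq (G w.1 w.2)) Q volume := by
  refine ⟨hG, ?_⟩
  rw [hasFiniteIntegral_iff_enorm]
  refine lt_of_le_of_lt (lintegral_mono fun w => le_of_eq ?_) (lt_top_iff_ne_top.2 hG2)
  rw [Real.enorm_eq_ofReal (frobeniusNormSq_nonneg _)]

/-- **Integrability of the pieces of the local energy integrand below a time level `t ≤ s`**: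
each of `|u|²(φₜ + νΔφ)`, `|u|² u·∇φ`, `p u·∇φ`, `2 f·u φ`, `|G|²φ`, `|u|²φ` is integrable on
`{τ < t}`, since below `s` the weights live in `Q_{1/2}(z) ⊆ Q_1(z₀)` where `|u|³, |p|^{3/2}, |f|^q,
|G|²` are integrable. [folklore] -/
theorem integrableOn_pieces {ν : ℝ} (hz : z ∈ parabolicCylinder (1 / 2) z₀)
    (hu : AEStronglyMeasurable (uncurry u) (volume.restrict (parabolicCylinder 1 z₀)))
    (hp : AEStronglyMeasurable (uncurry p) (volume.restrict (parabolicCylinder 1 z₀)))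
    (hf : AEStronglyMeasurable (uncurry f) (volume.restrict (parabolicCylinder 1 z₀)))
    (hGm : AEStronglyMeasurable (fun w : ℝ × EuclideanSpace ℝ (Fin 3) => frobeniusNormSq (G w.1 w.2))
      (volume.restrict (parabolicCylinder 1 z₀)))
    (hu3 : ∫⁻ w in parabolicCylinder 1 z₀, ‖u w.1 w.2‖ₑ ^ (3 : ℕ) ≠ ∞)
    (hp32 : ∫⁻ w in parabolicCylinder 1 z₀, ‖p w.1 w.2‖ₑ ^ (3 / 2 : ℝ) ≠ ∞)
    (hf32 : ∫⁻ w in parabolicCylinder 1 z₀, ‖f w.1 w.2‖ₑ ^ (3 / 2 : ℝ) ≠ ∞)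
    (hG2 : ∫⁻ w in parabolicCylinder 1 z₀, ENNReal.ofReal (frobeniusNormSq (G w.1 w.2)) ≠ ∞)
    (hφ : IsSpaceTimeTestOn (⊤ : Opens (ℝ × EuclideanSpace ℝ (Fin 3))) φ) {ρ : ℝ}
    (hbox : support (uncurry φ) ⊆ Ioo (z.1 - 1 / 9) (z.1 + ρ) ×ˢ ball z.2 (1 / 2))
    (h13 : support (uncurry φ) ∩ parabolicCylinder 1 z ⊆ parabolicCylinder (1 / 3) z)
    {t : ℝ} (ht : t ≤ z.1) :
    IntegrableOn (fun w : ℝ × EuclideanSpace ℝ (Fin 3) =>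
        ‖u w.1 w.2‖ ^ 2 * (timeDeriv φ w.1 w.2 + ν * Δ (φ w.1) w.2)) {w | w.1 < t} volume ∧
      IntegrableOn (fun w : ℝ × EuclideanSpace ℝ (Fin 3) =>
        ‖u w.1 w.2‖ ^ 2 * ⟪u w.1 w.2, gradient (φ w.1) w.2⟫) {w | w.1 < t} volume ∧
      IntegrableOn (fun w : ℝ × EuclideanSpace ℝ (Fin 3) =>
        p w.1 w.2 * ⟪u w.1 w.2, gradient (φ w.1) w.2⟫) {w | w.1 < t} volume ∧
      IntegrableOn (fun w : ℝ × EuclideanSpace ℝ (Fin 3) =>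
        2 * ⟪f w.1 w.2, u w.1 w.2⟫ * φ w.1 w.2) {w | w.1 < t} volume ∧
      IntegrableOn (fun w : ℝ × EuclideanSpace ℝ (Fin 3) =>
        frobeniusNormSq (G w.1 w.2) * φ w.1 w.2) {w | w.1 < t} volume ∧
      IntegrableOn (fun w : ℝ × EuclideanSpace ℝ (Fin 3) =>
        ‖u w.1 w.2‖ ^ 2 * φ w.1 w.2) {w | w.1 < t} volume := by
  set S : Set (ℝ × EuclideanSpace ℝ (Fin 3)) := {w | w.1 < t} with hS_def
  set Q1 := parabolicCylinder 1 z₀ with hQ1_def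
  set Qh := parabolicCylinder (rad 1) z with hQh_def
  have hSm : MeasurableSet S := measurableSet_lt measurable_fst measurable_const
  have hQhm : MeasurableSet Qh := (isOpen_parabolicCylinder _ z).measurableSet
  have hsub : Qh ⊆ Q1 := parabolicCylinder_rad_subset hz le_rfl
  have hμ := Measure.restrict_mono (μ := volume) (ν := volume) hsub le_rfl
  have hQ1fin : volume Q1 < ∞ :=
    (volume_parabolicCylinder_le zero_le_one z₀).trans_lt ENNReal.ofReal_lt_top
  -- the weights: continuity, and vanishing off `tsupport φ`
  set K := tsupport (uncurry φ) with hK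
  have hKc : IsCompact K := hφ.hasCompactSupport
  have hcφ : Continuous fun w : ℝ × EuclideanSpace ℝ (Fin 3) => φ w.1 w.2 := hφ.contDiff.continuous
  have hcT : Continuous fun w : ℝ × EuclideanSpace ℝ (Fin 3) => timeDeriv φ w.1 w.2 :=
    hφ.timeDeriv_top.contDiff.continuous
  have hcL : Continuous fun w : ℝ × EuclideanSpace ℝ (Fin 3) => Δ (φ w.1) w.2 :=
    hφ.laplacian_top.contDiff.continuous
  obtain ⟨hcg, hcgc, hg0⟩ := hφ.continuous_gradient_field
  have hφK : ∀ w ∉ K, φ w.1 w.2 = 0 := fun w hw =>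
    show uncurry φ w = 0 from image_eq_zero_of_notMem_tsupport hw
  have hTK : ∀ w ∉ K, timeDeriv φ w.1 w.2 = 0 := fun w hw =>
    IsSpaceTimeTestOn.timeDeriv_eq_zero_of_notMem hw
  have hLK : ∀ w ∉ K, Δ (φ w.1) w.2 = 0 := fun w hw =>
    laplacian_eq_zero_of_notMem_tsupport (notMem_tsupport_slice hw)
  -- global bounds on the weights
  obtain ⟨Cφ, hCφ⟩ := hcφ.bounded_above_of_compact_support (HasCompactSupport.intro hKc hφK)
  obtain ⟨CA, hCA⟩ := (hcT.add (continuous_const.mul hcL)).bounded_above_of_compact_support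
    (HasCompactSupport.intro (f := fun w : ℝ × EuclideanSpace ℝ (Fin 3) =>
      timeDeriv φ w.1 w.2 + ν * Δ (φ w.1) w.2) hKc fun w hw => by
        simp only [hTK w hw, hLK w hw, mul_zero, add_zero])
  obtain ⟨Cg, hCg⟩ := hcg.bounded_above_of_compact_support hcgc
  have hCφ0 : 0 ≤ Cφ := (norm_nonneg _).trans (hCφ (z.1, z.2))
  have hCA0 : 0 ≤ CA := (norm_nonneg _).trans (hCA (z.1, z.2))
  have hCg0 : 0 ≤ Cg := (norm_nonneg _).trans (hCg (z.1, z.2))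
  -- points of `S` outside `Qh` are outside `tsupport φ`
  have hout : ∀ w ∈ S \ Qh, w ∉ K := fun w hw hwK =>
    hw.2 (mem_parabolicCylinder_radOne_of_mem_box
      (mem_box_of_mem_tsupport hbox h13 hwK (lt_of_lt_of_le hw.1 ht)) (lt_of_lt_of_le hw.1 ht))
  -- basic integrable functions on `Qh`
  have hu_h : AEStronglyMeasurable (uncurry u) (volume.restrict Qh) := hu.mono_measure hμ
  have hp_h : AEStronglyMeasurable (uncurry p) (volume.restrict Qh) := hp.mono_measure hμ
  have hf_h : AEStronglyMeasurable (uncurry f) (volume.restrict Qh) := hf.mono_measure hμ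
  have hI3 : IntegrableOn (fun w : ℝ × EuclideanSpace ℝ (Fin 3) => ‖u w.1 w.2‖ ^ 3) Qh volume :=
    (integrableOn_cube_of_lintegral hu hu3).mono_set hsub
  have hI2 : IntegrableOn (fun w : ℝ × EuclideanSpace ℝ (Fin 3) => ‖u w.1 w.2‖ ^ 2) Qh volume :=
    (integrableOn_sq_of_cube hQ1fin hu (integrableOn_cube_of_lintegral hu hu3)).mono_set hsub
  have hun : AEStronglyMeasurable (fun w : ℝ × EuclideanSpace ℝ (Fin 3) => ‖u w.1 w.2‖) (volume.restrict Q1) :=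
    hu.norm
  have hfn : AEStronglyMeasurable (fun w : ℝ × EuclideanSpace ℝ (Fin 3) => ‖f w.1 w.2‖) (volume.restrict Q1) :=
    hf.norm
  have hp1 : AEStronglyMeasurable (fun w : ℝ × EuclideanSpace ℝ (Fin 3) => p w.1 w.2) (volume.restrict Q1) := hp
  have hu3' : ∫⁻ w in Q1, ‖(‖u w.1 w.2‖)‖ₑ ^ (3 : ℕ) ≠ ∞ := by simpa only [enorm_norm] using hu3
  have hf32' : ∫⁻ w in Q1, ‖(‖f w.1 w.2‖)‖ₑ ^ (3 / 2 : ℝ) ≠ ∞ := by simpa only [enorm_norm] using hf32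
  have hIup : IntegrableOn (fun w : ℝ × EuclideanSpace ℝ (Fin 3) => ‖u w.1 w.2‖ * p w.1 w.2) Qh volume :=
    (integrableOn_mul_of_L3_L32 (S := Q1) hun hp1 hu3' hp32).mono_set hsub
  have hIuf : IntegrableOn (fun w : ℝ × EuclideanSpace ℝ (Fin 3) => ‖u w.1 w.2‖ * ‖f w.1 w.2‖) Qh volume :=
    (integrableOn_mul_of_L3_L32 (S := Q1) hun hfn hu3' hf32').mono_set hsub
  have hIG : IntegrableOn (fun w : ℝ × EuclideanSpace ℝ (Fin 3) => frobeniusNormSq (G w.1 w.2)) Qh volume :=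
    (integrableOn_frobeniusNormSq hGm hG2).mono_set hsub
  refine ⟨?_, ?_, ?_, ?_, ?_, ?_⟩
  · -- `|u|² (φₜ + νΔφ)`
    refine integrableOn_of_dominated_of_zero hSm hQhm
      ((hu_h.norm.pow 2).mul ((hcT.add (continuous_const.mul hcL)).aestronglyMeasurable))
      (hI2.mul_const CA) (fun w _ => ?_) (fun w hw => ?_)
    · rw [norm_mul, Real.norm_of_nonneg (sq_nonneg _)]
      exact mul_le_mul_of_nonneg_left (hCA w) (sq_nonneg _)
    · rw [hTK w (hout w hw), hLK w (hout w hw)]; ring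
  · -- `|u|² u·∇φ`
    refine integrableOn_of_dominated_of_zero hSm hQhm
      ((hu_h.norm.pow 2).mul (hu_h.inner hcg.aestronglyMeasurable))
      (hI3.mul_const Cg) (fun w _ => ?_) (fun w hw => ?_)
    · rw [norm_mul, Real.norm_of_nonneg (sq_nonneg _)]
      calc ‖u w.1 w.2‖ ^ 2 * ‖⟪u w.1 w.2, gradient (φ w.1) w.2⟫‖
          ≤ ‖u w.1 w.2‖ ^ 2 * (‖u w.1 w.2‖ * Cg) := mul_le_mul_of_nonneg_left
            ((norm_inner_le_norm _ _).trans (mul_le_mul_of_nonneg_left (hCg w) (norm_nonneg _)))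
            (sq_nonneg _)
        _ = ‖u w.1 w.2‖ ^ 3 * Cg := by ring
    · rw [hg0 w (hout w hw), inner_zero_right, mul_zero]
  · -- `p u·∇φ`
    refine integrableOn_of_dominated_of_zero hSm hQhm
      (hp_h.mul (hu_h.inner hcg.aestronglyMeasurable))
      (hIup.norm.mul_const Cg) (fun w _ => ?_) (fun w hw => ?_)
    · rw [norm_mul, norm_mul, norm_norm]
      calc ‖p w.1 w.2‖ * ‖⟪u w.1 w.2, gradient (φ w.1) w.2⟫‖
          ≤ ‖p w.1 w.2‖ * (‖u w.1 w.2‖ * Cg) := mul_le_mul_of_nonneg_left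
            ((norm_inner_le_norm _ _).trans (mul_le_mul_of_nonneg_left (hCg w) (norm_nonneg _)))
            (norm_nonneg _)
        _ = ‖u w.1 w.2‖ * ‖p w.1 w.2‖ * Cg := by ring
    · rw [hg0 w (hout w hw), inner_zero_right, mul_zero]
  · -- `2 f·u φ`
    refine integrableOn_of_dominated_of_zero hSm hQhm
      (((hf_h.inner hu_h).const_mul 2).mul hcφ.aestronglyMeasurable)
      (hIuf.mul_const (2 * Cφ)) (fun w _ => ?_) (fun w hw => ?_)
    · rw [norm_mul, norm_mul, Real.norm_two]
      calc 2 * ‖⟪f w.1 w.2, u w.1 w.2⟫‖ * ‖φ w.1 w.2‖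
          ≤ 2 * (‖f w.1 w.2‖ * ‖u w.1 w.2‖) * Cφ := by
            gcongr
            · exact norm_inner_le_norm _ _
            · exact hCφ w
        _ = ‖u w.1 w.2‖ * ‖f w.1 w.2‖ * (2 * Cφ) := by ring
    · rw [hφK w (hout w hw), mul_zero]
  · -- `|G|² φ`
    refine integrableOn_of_dominated_of_zero hSm hQhm
      ((hGm.mono_measure hμ).mul hcφ.aestronglyMeasurable)
      (hIG.mul_const Cφ) (fun w _ => ?_) (fun w hw => ?_)
    · rw [norm_mul, Real.norm_of_nonneg (frobeniusNormSq_nonneg _)]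
      exact mul_le_mul_of_nonneg_left (hCφ w) (frobeniusNormSq_nonneg _)
    · rw [hφK w (hout w hw), mul_zero]
  · -- `|u|² φ`
    refine integrableOn_of_dominated_of_zero hSm hQhm
      ((hu_h.norm.pow 2).mul hcφ.aestronglyMeasurable)
      (hI2.mul_const Cφ) (fun w _ => ?_) (fun w hw => ?_)
    · rw [norm_mul, Real.norm_of_nonneg (sq_nonneg _)]
      exact mul_le_mul_of_nonneg_left (hCφ w) (sq_nonneg _)
    · rw [hφK w (hout w hw), mul_zero]

end Pieces

/-! ### Step 2: the four bounds below a time level -/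

section Bounds

variable {z₀ z : ℝ × EuclideanSpace ℝ (Fin 3)} {n : ℕ} {ν : ℝ}
  {f u : ℝ → EuclideanSpace ℝ (Fin 3) → EuclideanSpace ℝ (Fin 3)}
  {p : ℝ → EuclideanSpace ℝ (Fin 3) → ℝ}
  {G : ℝ → EuclideanSpace ℝ (Fin 3) → EuclideanSpace ℝ (Fin 3) →L[ℝ] EuclideanSpace ℝ (Fin 3)}
  {φ : ℝ → EuclideanSpace ℝ (Fin 3) → ℝ}

/-- **The quadratic term `I₁`** (RRS (15.15)): for `t ≤ s`,
`|∫∫_{τ<t} |u|² (φₜ + Δφ)| ≤ C ∫∫_{Q_{1/2}(z)} |u|² ≤ C ε₀^{2/3}` when `|φₜ + Δφ| ≤ C` below `s`. [cite: RobinsonRodrigoSadowski2016, (15.15) p. 218] -/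
theorem abs_setIntegral_quadratic_le (hz : z ∈ parabolicCylinder (1 / 2) z₀)
    (hu : AEStronglyMeasurable (uncurry u) (volume.restrict (parabolicCylinder 1 z₀)))
    {ε₀ : ℝ} (hε : 0 ≤ ε₀) (hsmall : Small ε₀ u p z₀) {ρ : ℝ}
    (hbox : support (uncurry φ) ⊆ Ioo (z.1 - 1 / 9) (z.1 + ρ) ×ˢ ball z.2 (1 / 2))
    (h13 : support (uncurry φ) ∩ parabolicCylinder 1 z ⊆ parabolicCylinder (1 / 3) z)
    {C : ℝ} (hC : 0 ≤ C) (hheat : ∀ τ : ℝ, τ ≤ z.1 → ∀ x, |timeDeriv φ τ x + Δ (φ τ) x| ≤ C)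
    {t : ℝ} (ht : t ≤ z.1) :
    |∫ w in {w : ℝ × EuclideanSpace ℝ (Fin 3) | w.1 < t},
        ‖u w.1 w.2‖ ^ 2 * (timeDeriv φ w.1 w.2 + 1 * Δ (φ w.1) w.2)| ≤ C * ε₀ ^ (2 / 3 : ℝ) := by
  set S : Set (ℝ × EuclideanSpace ℝ (Fin 3)) := {w | w.1 < t} with hS_def
  have hSm : MeasurableSet S := measurableSet_lt measurable_fst measurable_const
  have hQm : MeasurableSet (parabolicCylinder (1 / 2) z) := (isOpen_parabolicCylinder _ z).measurableSet
  have hTK : ∀ w ∉ tsupport (uncurry φ), timeDeriv φ w.1 w.2 = 0 := fun w hw =>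
    IsSpaceTimeTestOn.timeDeriv_eq_zero_of_notMem hw
  have hLK : ∀ w ∉ tsupport (uncurry φ), Δ (φ w.1) w.2 = 0 := fun w hw =>
    laplacian_eq_zero_of_notMem_tsupport (notMem_tsupport_slice hw)
  have hL := lintegral_sq_half_le_of_small hε hz hu.enorm hsmall
  have hfin : ∫⁻ w in parabolicCylinder (1 / 2) z, ‖u w.1 w.2‖ₑ ^ 2 * ENNReal.ofReal C ≠ ∞ := by
    rw [lintegral_mul_const' _ _ ENNReal.ofReal_ne_top]
    exact ENNReal.mul_ne_top (ne_top_of_le_ne_top ENNReal.ofReal_ne_top hL) ENNReal.ofReal_ne_top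
  have h := norm_setIntegral_le_toReal_lintegral (μ := volume) hSm hQm
    (g := fun w => ‖u w.1 w.2‖ ^ 2 * (timeDeriv φ w.1 w.2 + 1 * Δ (φ w.1) w.2))
    (G := fun w => ‖u w.1 w.2‖ₑ ^ 2 * ENNReal.ofReal C) (fun w hw => ?_) hfin
  · rw [Real.norm_eq_abs] at h
    refine h.trans ?_
    rw [lintegral_mul_const' _ _ ENNReal.ofReal_ne_top, ENNReal.toReal_mul, ENNReal.toReal_ofReal hC,
      mul_comm]
    exact mul_le_mul_of_nonneg_left (ENNReal.toReal_le_of_le_ofReal (Real.rpow_nonneg hε _) hL) hC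
  · by_cases hK : w ∈ tsupport (uncurry φ)
    · have hws : w.1 < z.1 := lt_of_lt_of_le hw ht
      have hwQ : w ∈ parabolicCylinder (1 / 2) z := by
        rw [← rad_one]
        exact mem_parabolicCylinder_radOne_of_mem_box (mem_box_of_mem_tsupport hbox h13 hK hws) hws
      rw [indicator_of_mem hwQ, one_mul]
      calc ‖‖u w.1 w.2‖ ^ 2 * (timeDeriv φ w.1 w.2 + Δ (φ w.1) w.2)‖ₑ
          = ENNReal.ofReal (‖u w.1 w.2‖ ^ 2 * |timeDeriv φ w.1 w.2 + Δ (φ w.1) w.2|) := by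
            rw [← ofReal_norm, norm_mul, Real.norm_of_nonneg (sq_nonneg _), Real.norm_eq_abs]
        _ ≤ ENNReal.ofReal (‖u w.1 w.2‖ ^ 2 * C) :=
            ENNReal.ofReal_le_ofReal (mul_le_mul_of_nonneg_left (hheat w.1 hws.le w.2) (sq_nonneg _))
        _ = ‖u w.1 w.2‖ₑ ^ 2 * ENNReal.ofReal C := by
            rw [ENNReal.ofReal_mul (sq_nonneg _), ENNReal.ofReal_pow (norm_nonneg _), ofReal_norm]
    · rw [hTK w hK, hLK w hK]
      simp
/-- **The cubic term `I₂`** (RRS (15.16)): for `t ≤ s`,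
`|∫∫_{τ<t} |u|² u·∇φ| ≤ ∫∫_{Q_{1/2}} |u|³ |∇φ| ≤ 24 C₁ ε₀^{2/3} r²`. [cite: RobinsonRodrigoSadowski2016, (15.16) p. 219] -/
theorem abs_setIntegral_cubic_le (hn : 1 ≤ n) {ε₀ C₁ : ℝ} (hε : 0 ≤ ε₀) (hC : 0 ≤ C₁)
    (hA : ∀ k : ℕ, 1 ≤ k → k ≤ n → HypA ε₀ u p k z)
    (hφ : IsSpaceTimeTestOn (⊤ : Opens (ℝ × EuclideanSpace ℝ (Fin 3))) φ) {ρ : ℝ}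
    (hbox : support (uncurry φ) ⊆ Ioo (z.1 - 1 / 9) (z.1 + ρ) ×ˢ ball z.2 (1 / 2))
    (h13 : support (uncurry φ) ∩ parabolicCylinder 1 z ⊆ parabolicCylinder (1 / 3) z)
    (hring : ∀ j : ℕ, 1 ≤ j → j + 1 ≤ n + 1 →
      ∀ w ∈ parabolicCylinder (rad j) z \ parabolicCylinder (rad (j + 1)) z,
        ‖gradient (φ w.1) w.2‖ ≤ C₁ * (rad (n + 1)) ^ 2 * ((rad (j + 1)) ^ 4)⁻¹)
    (hcore : ∀ w ∈ parabolicCylinder (rad (n + 1)) z,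
      ‖gradient (φ w.1) w.2‖ ≤ C₁ * ((rad (n + 1)) ^ 2)⁻¹)
    {t : ℝ} (ht : t ≤ z.1) :
    |∫ w in {w : ℝ × EuclideanSpace ℝ (Fin 3) | w.1 < t},
        ‖u w.1 w.2‖ ^ 2 * ⟪u w.1 w.2, gradient (φ w.1) w.2⟫| ≤
      24 * C₁ * ε₀ ^ (2 / 3 : ℝ) * (rad (n + 1)) ^ 2 := by
  set S : Set (ℝ × EuclideanSpace ℝ (Fin 3)) := {w | w.1 < t} with hS_def
  have hSm : MeasurableSet S := measurableSet_lt measurable_fst measurable_const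
  have hQm : MeasurableSet (parabolicCylinder (rad 1) z) := (isOpen_parabolicCylinder _ z).measurableSet
  obtain ⟨-, -, hg0⟩ := hφ.continuous_gradient_field
  have hL := lintegral_cube_grad_le (u := u) hε hC hn hA hring hcore
  have hfin : ∫⁻ w in parabolicCylinder (rad 1) z,
      ‖u w.1 w.2‖ₑ ^ (3 : ℕ) * ENNReal.ofReal ‖gradient (φ w.1) w.2‖ ≠ ∞ :=
    ne_top_of_le_ne_top ENNReal.ofReal_ne_top hL
  have h := norm_setIntegral_le_toReal_lintegral (μ := volume) hSm hQm
    (g := fun w => ‖u w.1 w.2‖ ^ 2 * ⟪u w.1 w.2, gradient (φ w.1) w.2⟫)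
    (G := fun w => ‖u w.1 w.2‖ₑ ^ (3 : ℕ) * ENNReal.ofReal ‖gradient (φ w.1) w.2‖) (fun w hw => ?_) hfin
  · rw [Real.norm_eq_abs] at h
    have h24 : 0 ≤ 24 * C₁ * ε₀ ^ (2 / 3 : ℝ) * (rad (n + 1)) ^ 2 := by
      have := rad_pos (n + 1); positivity
    exact h.trans (ENNReal.toReal_le_of_le_ofReal h24 hL)
  · by_cases hK : w ∈ tsupport (uncurry φ)
    · have hws : w.1 < z.1 := lt_of_lt_of_le hw ht
      have hwQ : w ∈ parabolicCylinder (rad 1) z :=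
        mem_parabolicCylinder_radOne_of_mem_box (mem_box_of_mem_tsupport hbox h13 hK hws) hws
      rw [indicator_of_mem hwQ]
      calc ‖‖u w.1 w.2‖ ^ 2 * ⟪u w.1 w.2, gradient (φ w.1) w.2⟫‖ₑ
          = ENNReal.ofReal (‖u w.1 w.2‖ ^ 2 * |⟪u w.1 w.2, gradient (φ w.1) w.2⟫|) := by
            rw [← ofReal_norm, norm_mul, Real.norm_of_nonneg (sq_nonneg _), Real.norm_eq_abs]
        _ ≤ ENNReal.ofReal (‖u w.1 w.2‖ ^ 3 * ‖gradient (φ w.1) w.2‖) := by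
            refine ENNReal.ofReal_le_ofReal ?_
            calc ‖u w.1 w.2‖ ^ 2 * |⟪u w.1 w.2, gradient (φ w.1) w.2⟫|
                ≤ ‖u w.1 w.2‖ ^ 2 * (‖u w.1 w.2‖ * ‖gradient (φ w.1) w.2‖) :=
                  mul_le_mul_of_nonneg_left (abs_real_inner_le_norm _ _) (sq_nonneg _)
              _ = _ := by ring
        _ = ‖u w.1 w.2‖ₑ ^ (3 : ℕ) * ENNReal.ofReal ‖gradient (φ w.1) w.2‖ := by
            rw [ENNReal.ofReal_mul (pow_nonneg (norm_nonneg _) 3), ENNReal.ofReal_pow (norm_nonneg _),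
              ofReal_norm]
    · rw [hg0 w hK, inner_zero_right, mul_zero, enorm_zero]
      exact zero_le

/-- **The force term** : for `t ≤ s`,
`|∫∫_{τ<t} 2 f·u φ| ≤ 2 ∫∫_{Q_{1/2}} |u| |f| φ ≤ 48 C₁ κ (S + 1) ε₀^{2/3} r²`. [folklore] -/
theorem abs_setIntegral_force_le (hn : 1 ≤ n) (hz : z ∈ parabolicCylinder (1 / 2) z₀)
    {q κ ε₀ C₁ S : ℝ} (hq : 5 / 2 < q) (hκ : 0 ≤ κ) (hε : 0 ≤ ε₀) (hC : 0 ≤ C₁)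
    (hS : ∀ m : ℕ, ∑ j ∈ Finset.Icc 1 m, (rad j) ^ (2 - 5 / q : ℝ) ≤ S)
    (hf : AEStronglyMeasurable (uncurry f) (volume.restrict (parabolicCylinder 1 z₀)))
    (hu : AEStronglyMeasurable (uncurry u) (volume.restrict (parabolicCylinder 1 z₀)))
    (hF : ∫⁻ w in parabolicCylinder 1 z₀, ‖f w.1 w.2‖ₑ ^ q ≤
      ENNReal.ofReal ((κ * ε₀ ^ (4 / 9 : ℝ)) ^ q))
    (hA : ∀ k : ℕ, 1 ≤ k → k ≤ n → HypA ε₀ u p k z) (hφ0 : ∀ t x, 0 ≤ φ t x)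
    {ρ : ℝ} (hbox : support (uncurry φ) ⊆ Ioo (z.1 - 1 / 9) (z.1 + ρ) ×ˢ ball z.2 (1 / 2))
    (h13 : support (uncurry φ) ∩ parabolicCylinder 1 z ⊆ parabolicCylinder (1 / 3) z)
    (hring : ∀ j : ℕ, 1 ≤ j → j + 1 ≤ n + 1 →
      ∀ w ∈ parabolicCylinder (rad j) z \ parabolicCylinder (rad (j + 1)) z,
        φ w.1 w.2 ≤ C₁ * (rad (n + 1)) ^ 2 * ((rad (j + 1)) ^ 3)⁻¹)
    (hcore : ∀ w ∈ parabolicCylinder (rad (n + 1)) z, φ w.1 w.2 ≤ C₁ * (rad (n + 1))⁻¹)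
    {t : ℝ} (ht : t ≤ z.1) :
    |∫ w in {w : ℝ × EuclideanSpace ℝ (Fin 3) | w.1 < t}, 2 * ⟪f w.1 w.2, u w.1 w.2⟫ * φ w.1 w.2| ≤
      48 * C₁ * κ * (S + 1) * ε₀ ^ (2 / 3 : ℝ) * (rad (n + 1)) ^ 2 := by
  set T : Set (ℝ × EuclideanSpace ℝ (Fin 3)) := {w | w.1 < t} with hT_def
  have hTm : MeasurableSet T := measurableSet_lt measurable_fst measurable_const
  have hQm : MeasurableSet (parabolicCylinder (rad 1) z) := (isOpen_parabolicCylinder _ z).measurableSet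
  have hφK : ∀ w ∉ tsupport (uncurry φ), φ w.1 w.2 = 0 := fun w hw =>
    show uncurry φ w = 0 from image_eq_zero_of_notMem_tsupport hw
  have hS0 : 0 ≤ S := le_trans (Finset.sum_nonneg fun j _ => Real.rpow_nonneg (rad_pos j).le _) (hS 0)
  have hL := lintegral_vel_force_weight_le (p := p) hq hκ hε hC hS hn hz hf.enorm hu.enorm hF hA hring hcore
  have hfin : ∫⁻ w in parabolicCylinder (rad 1) z,
      ENNReal.ofReal 2 * (‖u w.1 w.2‖ₑ * ‖f w.1 w.2‖ₑ * ENNReal.ofReal (φ w.1 w.2)) ≠ ∞ := by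
    rw [lintegral_const_mul' _ _ ENNReal.ofReal_ne_top]
    exact ENNReal.mul_ne_top ENNReal.ofReal_ne_top (ne_top_of_le_ne_top ENNReal.ofReal_ne_top hL)
  have h := norm_setIntegral_le_toReal_lintegral (μ := volume) hTm hQm
    (g := fun w => 2 * ⟪f w.1 w.2, u w.1 w.2⟫ * φ w.1 w.2)
    (G := fun w => ENNReal.ofReal 2 * (‖u w.1 w.2‖ₑ * ‖f w.1 w.2‖ₑ * ENNReal.ofReal (φ w.1 w.2)))
    (fun w hw => ?_) hfin
  · rw [Real.norm_eq_abs] at h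
    refine h.trans ?_
    rw [lintegral_const_mul' _ _ ENNReal.ofReal_ne_top, ENNReal.toReal_mul, ENNReal.toReal_ofReal zero_le_two]
    have h24 : 0 ≤ 24 * C₁ * κ * (S + 1) * ε₀ ^ (2 / 3 : ℝ) * (rad (n + 1)) ^ 2 := by
      have := rad_pos (n + 1); positivity
    calc 2 * (∫⁻ w in parabolicCylinder (rad 1) z,
          ‖u w.1 w.2‖ₑ * ‖f w.1 w.2‖ₑ * ENNReal.ofReal (φ w.1 w.2)).toReal
        ≤ 2 * (24 * C₁ * κ * (S + 1) * ε₀ ^ (2 / 3 : ℝ) * (rad (n + 1)) ^ 2) :=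
          mul_le_mul_of_nonneg_left (ENNReal.toReal_le_of_le_ofReal h24 hL) zero_le_two
      _ = _ := by ring
  · by_cases hK : w ∈ tsupport (uncurry φ)
    · have hws : w.1 < z.1 := lt_of_lt_of_le hw ht
      have hwQ : w ∈ parabolicCylinder (rad 1) z :=
        mem_parabolicCylinder_radOne_of_mem_box (mem_box_of_mem_tsupport hbox h13 hK hws) hws
      rw [indicator_of_mem hwQ]
      calc ‖2 * ⟪f w.1 w.2, u w.1 w.2⟫ * φ w.1 w.2‖ₑ
          = ENNReal.ofReal (2 * |⟪f w.1 w.2, u w.1 w.2⟫| * φ w.1 w.2) := by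
            rw [← ofReal_norm, norm_mul, norm_mul, Real.norm_two, Real.norm_eq_abs,
              Real.norm_of_nonneg (hφ0 _ _)]
        _ ≤ ENNReal.ofReal (2 * (‖u w.1 w.2‖ * ‖f w.1 w.2‖) * φ w.1 w.2) := by
            refine ENNReal.ofReal_le_ofReal ?_
            gcongr
            · exact hφ0 _ _
            · rw [mul_comm]; exact abs_real_inner_le_norm _ _
        _ = ENNReal.ofReal 2 * (‖u w.1 w.2‖ₑ * ‖f w.1 w.2‖ₑ * ENNReal.ofReal (φ w.1 w.2)) := by
            rw [ENNReal.ofReal_mul (by positivity), ENNReal.ofReal_mul zero_le_two,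
              ENNReal.ofReal_mul (norm_nonneg _), ofReal_norm, ofReal_norm, mul_assoc]
    · rw [hφK w hK, mul_zero, enorm_zero]
      exact zero_le

/-- **The pressure term `I₃`** (RRS p. 223): for `t < s`, with the telescoping decomposition and
`(A_k)`, `|∫∫_{τ<t} p u·∇φ| ≤ Σ_k c' C₁ r² r_k⁻⁴ · ε₀^{2/3} r_k^{14/3} ≤ 2 c' C₁ r² ε₀^{2/3}`,
`c' = 256 + 136 c_χ`. [cite: RobinsonRodrigoSadowski2016, p. 223] -/
theorem abs_setIntegral_pressure_le (hSP : IsSuitablePair (parabolicCylinderOpens 1 z₀) ν f u p G)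
    (hn : 1 ≤ n) (hz : z ∈ parabolicCylinder (1 / 2) z₀)
    (hu3 : ∫⁻ w in parabolicCylinder 1 z₀, ‖u w.1 w.2‖ₑ ^ (3 : ℕ) ≠ ∞)
    {ε₀ C₁ cχ : ℝ} (hε : 0 ≤ ε₀) (hC : 0 ≤ C₁) (hcχ0 : 0 ≤ cχ)
    (hcχ : ∀ ρ : ℝ, 0 < ρ → ∀ (τ : ℝ) (y : EuclideanSpace ℝ (Fin 3)), ‖fderiv ℝ (cylCut z ρ τ) y‖ ≤ cχ / ρ)
    (hA : ∀ k : ℕ, 1 ≤ k → k ≤ n → HypA ε₀ u p k z)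
    (hφs : ContDiff ℝ (⊤ : ℕ∞) (uncurry φ)) (hφc : HasCompactSupport (uncurry φ)) (hφ0 : ∀ t x, 0 ≤ φ t x)
    {ρ : ℝ} (hbox : support (uncurry φ) ⊆ Ioo (z.1 - 1 / 9) (z.1 + ρ) ×ˢ ball z.2 (1 / 2))
    (h13 : support (uncurry φ) ∩ parabolicCylinder 1 z ⊆ parabolicCylinder (1 / 3) z)
    (hcore : ∀ w ∈ parabolicCylinder (rad (n + 1)) z,
      φ w.1 w.2 ≤ C₁ * (rad (n + 1))⁻¹ ∧ ‖gradient (φ w.1) w.2‖ ≤ C₁ * ((rad (n + 1)) ^ 2)⁻¹)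
    (hring : ∀ j : ℕ, 1 ≤ j → j + 1 ≤ n + 1 →
      ∀ w ∈ parabolicCylinder (rad j) z \ parabolicCylinder (rad (j + 1)) z,
        φ w.1 w.2 ≤ C₁ * (rad (n + 1)) ^ 2 * ((rad (j + 1)) ^ 3)⁻¹ ∧
          ‖gradient (φ w.1) w.2‖ ≤ C₁ * (rad (n + 1)) ^ 2 * ((rad (j + 1)) ^ 4)⁻¹)
    {t : ℝ} (ht : t < z.1) :
    |∫ w in {w : ℝ × EuclideanSpace ℝ (Fin 3) | w.1 < t}, p w.1 w.2 * ⟪u w.1 w.2, gradient (φ w.1) w.2⟫| ≤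
      2 * (256 + 136 * cχ) * C₁ * (rad (n + 1)) ^ 2 * ε₀ ^ (2 / 3 : ℝ) := by
  set S : Set (ℝ × EuclideanSpace ℝ (Fin 3)) := {w | w.1 < t} with hS_def
  have hSm : MeasurableSet S := measurableSet_lt measurable_fst measurable_const
  set Q1 := parabolicCylinder 1 z₀ with hQ1
  set r := rad (n + 1) with hr_def
  have hr : 0 < r := rad_pos _
  set c' : ℝ := 256 + 136 * cχ with hc'
  have hc'0 : 0 ≤ c' := by positivity
  -- data from the suitable pair
  have hu : AEStronglyMeasurable (uncurry u) (volume.restrict Q1) :=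
    hSP.weakGradient.locallyIntegrableOn.aestronglyMeasurable
  have hp : AEStronglyMeasurable (uncurry p) (volume.restrict Q1) :=
    hSP.pressure_locallyIntegrableOn.aestronglyMeasurable
  have hp32 : ∫⁻ w in Q1, ‖p w.1 w.2‖ₑ ^ (3 / 2 : ℝ) ≠ ∞ := hSP.pressure_lt_top.ne
  -- slices of `φ` differentiable; bounds in `fderiv` form
  have hφtop : IsSpaceTimeTestOn (⊤ : Opens (ℝ × EuclideanSpace ℝ (Fin 3))) φ :=
    ⟨hφs, hφc, fun _ _ => trivial⟩
  have hφd : ∀ τ, Differentiable ℝ (φ τ) := fun τ => (hφtop.contDiff_slice τ).differentiable (by simp)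
  have hcore' : ∀ w ∈ parabolicCylinder (rad (n + 1)) z,
      φ w.1 w.2 ≤ C₁ * (rad (n + 1))⁻¹ ∧ ‖fderiv ℝ (φ w.1) w.2‖ ≤ C₁ * ((rad (n + 1)) ^ 2)⁻¹ := fun w hw =>
    ⟨(hcore w hw).1, by rw [← Scheffer.norm_gradient_eq_norm_fderiv]; exact (hcore w hw).2⟩
  have hring' : ∀ j : ℕ, 1 ≤ j → j + 1 ≤ n + 1 →
      ∀ w ∈ parabolicCylinder (rad j) z \ parabolicCylinder (rad (j + 1)) z,
        φ w.1 w.2 ≤ C₁ * (rad (n + 1)) ^ 2 * ((rad (j + 1)) ^ 3)⁻¹ ∧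
          ‖fderiv ℝ (φ w.1) w.2‖ ≤ C₁ * (rad (n + 1)) ^ 2 * ((rad (j + 1)) ^ 4)⁻¹ := fun j hj hjn w hw =>
    ⟨(hring j hj hjn w hw).1, by rw [← Scheffer.norm_gradient_eq_norm_fderiv]; exact (hring j hj hjn w hw).2⟩
  -- per-`k` data
  have hk_all : ∀ k ∈ Finset.Icc 1 n,
      IntegrableOn (fun w : ℝ × EuclideanSpace ℝ (Fin 3) =>
          p w.1 w.2 * ⟪u w.1 w.2, gradient (presTest z n φ k w.1) w.2⟫) S volume ∧
        |∫ w in S, p w.1 w.2 * ⟪u w.1 w.2, gradient (presTest z n φ k w.1) w.2⟫| ≤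
          (c' * C₁ * r ^ 2 * ((rad k) ^ 4)⁻¹) * (ε₀ ^ (2 / 3 : ℝ) * (rad k) ^ (14 / 3 : ℝ)) := by
    intro k hk
    obtain ⟨hk1, hkn⟩ := Finset.mem_Icc.1 hk
    have hPT := isSpaceTimeTestOn_top_presTest (z := z) (n := n) hφs hφc k
    obtain ⟨hgc, -, -⟩ := hPT.continuous_gradient_field
    refine pressure_presTest_bound hu hp hu3 hp32 (parabolicCylinder_rad_subset hz hk1)
      (ae_integral_inner_gradient_presTest_eq_zero hSP hz hφs hφc hbox h13 k) hgc
      (fun τ hτ y hw => ?_) (by have := rad_pos k; positivity) (fun τ hτ y => ?_) hε (hA k hk1 hkn) ht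
    · rw [gradient, fderiv_presTest_eq_zero_of_notMem hφ0 hτ hw, map_zero]
    · rw [Scheffer.norm_gradient_eq_norm_fderiv]
      exact norm_fderiv_presTest_le hk1 hkn hC hcχ0 hcχ hφd hφ0 hcore' hring' hτ y
  -- decomposition of the integrand on `S`
  have hdecomp : ∀ w ∈ S, p w.1 w.2 * ⟪u w.1 w.2, gradient (φ w.1) w.2⟫ =
      ∑ k ∈ Finset.Icc 1 n, p w.1 w.2 * ⟪u w.1 w.2, gradient (presTest z n φ k w.1) w.2⟫ := by
    intro w hw
    rw [gradient_eq_sum_presTest hn hφd hbox h13 (lt_trans hw ht) w.2, inner_sum, Finset.mul_sum]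
  rw [setIntegral_congr_fun hSm hdecomp, integral_finsetSum _ (fun k hk => (hk_all k hk).1)]
  calc |∑ k ∈ Finset.Icc 1 n, ∫ w in S, p w.1 w.2 * ⟪u w.1 w.2, gradient (presTest z n φ k w.1) w.2⟫|
      ≤ ∑ k ∈ Finset.Icc 1 n, |∫ w in S, p w.1 w.2 * ⟪u w.1 w.2, gradient (presTest z n φ k w.1) w.2⟫| :=
        Finset.abs_sum_le_sum_abs _ _
    _ ≤ ∑ k ∈ Finset.Icc 1 n, (c' * C₁ * r ^ 2 * ((rad k) ^ 4)⁻¹) * (ε₀ ^ (2 / 3 : ℝ) * (rad k) ^ (14 / 3 : ℝ)) :=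
        Finset.sum_le_sum fun k hk => (hk_all k hk).2
    _ = c' * C₁ * r ^ 2 * ε₀ ^ (2 / 3 : ℝ) * ∑ k ∈ Finset.Icc 1 n, (rad k) ^ (2 / 3 : ℝ) := by
        rw [Finset.mul_sum]
        refine Finset.sum_congr rfl fun k _ => ?_
        have hk := rad_pos k
        have hsplit : (rad k) ^ (14 / 3 : ℝ) = (rad k) ^ (2 / 3 : ℝ) * (rad k) ^ 4 := by
          rw [show (14 / 3 : ℝ) = 2 / 3 + ((4 : ℕ) : ℝ) by norm_num, Real.rpow_add hk, Real.rpow_natCast]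
        rw [hsplit]
        field_simp
    _ ≤ c' * C₁ * r ^ 2 * ε₀ ^ (2 / 3 : ℝ) * 2 := by
        gcongr
        exact sum_Icc_rad_rpow_twoThirds_le n
    _ = _ := by ring

/-- The pressure integrand is integrable below a time level `t < s` (the sum of the integrable
pieces of `abs_setIntegral_pressure_le`); recorded in the form consumed below. [folklore] -/
theorem integrableOn_pressure_of_pieces (hz : z ∈ parabolicCylinder (1 / 2) z₀)
    (hu : AEStronglyMeasurable (uncurry u) (volume.restrict (parabolicCylinder 1 z₀)))
    (hp : AEStronglyMeasurable (uncurry p) (volume.restrict (parabolicCylinder 1 z₀)))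
    (hf : AEStronglyMeasurable (uncurry f) (volume.restrict (parabolicCylinder 1 z₀)))
    (hGm : AEStronglyMeasurable (fun w : ℝ × EuclideanSpace ℝ (Fin 3) => frobeniusNormSq (G w.1 w.2))
      (volume.restrict (parabolicCylinder 1 z₀)))
    (hu3 : ∫⁻ w in parabolicCylinder 1 z₀, ‖u w.1 w.2‖ₑ ^ (3 : ℕ) ≠ ∞)
    (hp32 : ∫⁻ w in parabolicCylinder 1 z₀, ‖p w.1 w.2‖ₑ ^ (3 / 2 : ℝ) ≠ ∞)
    (hf32 : ∫⁻ w in parabolicCylinder 1 z₀, ‖f w.1 w.2‖ₑ ^ (3 / 2 : ℝ) ≠ ∞)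
    (hG2 : ∫⁻ w in parabolicCylinder 1 z₀, ENNReal.ofReal (frobeniusNormSq (G w.1 w.2)) ≠ ∞)
    (hφ : IsSpaceTimeTestOn (⊤ : Opens (ℝ × EuclideanSpace ℝ (Fin 3))) φ) {ρ : ℝ}
    (hbox : support (uncurry φ) ⊆ Ioo (z.1 - 1 / 9) (z.1 + ρ) ×ˢ ball z.2 (1 / 2))
    (h13 : support (uncurry φ) ∩ parabolicCylinder 1 z ⊆ parabolicCylinder (1 / 3) z)
    {t : ℝ} (ht : t ≤ z.1) :
    IntegrableOn (fun w : ℝ × EuclideanSpace ℝ (Fin 3) =>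
        (‖u w.1 w.2‖ ^ 2 + 2 * p w.1 w.2) * ⟪u w.1 w.2, gradient (φ w.1) w.2⟫) {w | w.1 < t} volume := by
  obtain ⟨-, hB, hP, -⟩ := integrableOn_pieces (ν := 1) hz hu hp hf hGm hu3 hp32 hf32 hG2 hφ hbox h13 ht
  refine (hB.add (hP.const_mul 2)).congr_fun (fun w _ => ?_) (measurableSet_lt measurable_fst measurable_const)
  simp only [Pi.add_apply]
  ring

end Bounds

/-! ### Step 2: the bound on the right-hand side below a time level (Claim R) -/

section ClaimR

variable {z₀ z : ℝ × EuclideanSpace ℝ (Fin 3)} {n : ℕ}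
  {f u : ℝ → EuclideanSpace ℝ (Fin 3) → EuclideanSpace ℝ (Fin 3)}
  {p : ℝ → EuclideanSpace ℝ (Fin 3) → ℝ}
  {G : ℝ → EuclideanSpace ℝ (Fin 3) → EuclideanSpace ℝ (Fin 3) →L[ℝ] EuclideanSpace ℝ (Fin 3)}
  {φ : ℝ → EuclideanSpace ℝ (Fin 3) → ℝ}

/-- **RRS (15.23), right-hand side**: for a suitable pair on `Q_1(z₀)` (viscosity `1`) with the
smallness assumptions of Theorem 15.3 (force version), `z ∈ Q_{1/2}(z₀)`, `(A_k)` for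
`1 ≤ k ≤ n` and the test function `φ = φ_{n+1}` of Lemma 15.11, for every `t < s`,
`∫∫_{τ<t} R[φ] ≤ I₁ + I₂ + I₃ + (force) ≤ (C₁ + 24 C₁ + 4 c' C₁ + 48 C₁ κ (S + 1)) ε₀^{2/3} r²`.
[cite: RobinsonRodrigoSadowski2016, (15.23) p. 221 and pp. 218–223] -/
theorem setIntegral_localEnergyRHS_le
    (hSP : IsSuitablePair (parabolicCylinderOpens 1 z₀) 1 f u p G)
    {q : ℝ} (hq : 5 / 2 < q) (hfq : MemLp (uncurry f) (ENNReal.ofReal q) (volume.restrict (parabolicCylinder 1 z₀)))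
    {ε₀ : ℝ} (hε : 0 < ε₀) (hsmall : Small ε₀ u p z₀) {κ : ℝ} (hκ : 0 ≤ κ)
    (hF : ∫⁻ w in parabolicCylinder 1 z₀, ‖f w.1 w.2‖ₑ ^ q ≤ ENNReal.ofReal ((κ * ε₀ ^ (4 / 9 : ℝ)) ^ q))
    {S : ℝ} (hS : ∀ m : ℕ, ∑ j ∈ Finset.Icc 1 m, (rad j) ^ (2 - 5 / q : ℝ) ≤ S)
    (hz : z ∈ parabolicCylinder (1 / 2) z₀) (hn : 1 ≤ n)
    (hA : ∀ k : ℕ, 1 ≤ k → k ≤ n → HypA ε₀ u p k z)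
    {C₁ cχ : ℝ} (hC : 0 ≤ C₁) (hcχ0 : 0 ≤ cχ)
    (hcχ : ∀ ρ : ℝ, 0 < ρ → ∀ (τ : ℝ) (y : EuclideanSpace ℝ (Fin 3)), ‖fderiv ℝ (cylCut z ρ τ) y‖ ≤ cχ / ρ)
    (hφs : ContDiff ℝ (⊤ : ℕ∞) (uncurry φ)) (hφc : HasCompactSupport (uncurry φ)) (hφ0 : ∀ t x, 0 ≤ φ t x)
    (hbox : support (uncurry φ) ⊆ Ioo (z.1 - 1 / 9) (z.1 + (rad (n + 1)) ^ 2 / 2) ×ˢ ball z.2 (1 / 2))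
    (hcore : ∀ w ∈ parabolicCylinder (rad (n + 1)) z,
      C₁⁻¹ * (rad (n + 1))⁻¹ ≤ φ w.1 w.2 ∧ φ w.1 w.2 ≤ C₁ * (rad (n + 1))⁻¹ ∧
        ‖gradient (φ w.1) w.2‖ ≤ C₁ * ((rad (n + 1)) ^ 2)⁻¹)
    (hring : ∀ j : ℕ, 1 ≤ j → j + 1 ≤ n + 1 →
      ∀ w ∈ parabolicCylinder (rad j) z \ parabolicCylinder (rad (j + 1)) z,
        φ w.1 w.2 ≤ C₁ * (rad (n + 1)) ^ 2 * ((rad (j + 1)) ^ 3)⁻¹ ∧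
          ‖gradient (φ w.1) w.2‖ ≤ C₁ * (rad (n + 1)) ^ 2 * ((rad (j + 1)) ^ 4)⁻¹)
    (h13 : support (uncurry φ) ∩ parabolicCylinder 1 z ⊆ parabolicCylinder (1 / 3) z)
    (hheat : ∀ t : ℝ, t ≤ z.1 → ∀ x, |timeDeriv φ t x + Δ (φ t) x| ≤ C₁ * (rad (n + 1)) ^ 2)
    {t : ℝ} (ht : t < z.1) :
    ∫ w in {w : ℝ × EuclideanSpace ℝ (Fin 3) | w.1 < t}, localEnergyRHS 1 f u p φ w ≤
      (C₁ + 24 * C₁ + 4 * (256 + 136 * cχ) * C₁ + 48 * C₁ * κ * (S + 1)) *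
        ε₀ ^ (2 / 3 : ℝ) * (rad (n + 1)) ^ 2 := by
  set T : Set (ℝ × EuclideanSpace ℝ (Fin 3)) := {w | w.1 < t} with hT_def
  have hTm : MeasurableSet T := measurableSet_lt measurable_fst measurable_const
  set Q1 := parabolicCylinder 1 z₀ with hQ1
  set r := rad (n + 1) with hr_def
  have hr : 0 < r := rad_pos _
  have hQ1fin : volume Q1 < ∞ := (volume_parabolicCylinder_le zero_le_one z₀).trans_lt ENNReal.ofReal_lt_top
  -- primitive data
  have hu : AEStronglyMeasurable (uncurry u) (volume.restrict Q1) :=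
    hSP.weakGradient.locallyIntegrableOn.aestronglyMeasurable
  have hp : AEStronglyMeasurable (uncurry p) (volume.restrict Q1) :=
    hSP.pressure_locallyIntegrableOn.aestronglyMeasurable
  have hf : AEStronglyMeasurable (uncurry f) (volume.restrict Q1) := hfq.aestronglyMeasurable
  have hG2K : ∀ K ⊆ Q1, IsCompact K → ∫⁻ w in K, ENNReal.ofReal (frobeniusNormSq (G w.1 w.2)) < ∞ :=
    fun K hK _ => (lintegral_mono_set hK).trans_lt hSP.gradient_lt_top
  have hGm : AEStronglyMeasurable (fun w : ℝ × EuclideanSpace ℝ (Fin 3) => frobeniusNormSq (G w.1 w.2))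
      (volume.restrict Q1) := (locallyIntegrableOn_frobeniusNormSq hSP.weakGradient hG2K).aestronglyMeasurable
  have hu3 : ∫⁻ w in Q1, ‖u w.1 w.2‖ₑ ^ (3 : ℕ) ≠ ∞ :=
    ne_top_of_le_ne_top ENNReal.ofReal_ne_top ((lintegral_mono fun w => le_self_add).trans hsmall)
  have hp32 : ∫⁻ w in Q1, ‖p w.1 w.2‖ₑ ^ (3 / 2 : ℝ) ≠ ∞ := hSP.pressure_lt_top.ne
  have hG2 : ∫⁻ w in Q1, ENNReal.ofReal (frobeniusNormSq (G w.1 w.2)) ≠ ∞ := hSP.gradient_lt_top.ne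
  have hf32 : ∫⁻ w in Q1, ‖f w.1 w.2‖ₑ ^ (3 / 2 : ℝ) ≠ ∞ := by
    haveI : IsFiniteMeasure (volume.restrict Q1) := ⟨by rw [Measure.restrict_apply_univ]; exact hQ1fin⟩
    have h32 : MemLp (uncurry f) (ENNReal.ofReal (3 / 2)) (volume.restrict Q1) :=
      hfq.mono_exponent (ENNReal.ofReal_le_ofReal (by linarith))
    have h' : eLpNorm' (uncurry f) (3 / 2) (volume.restrict Q1) < ∞ := by
      have := h32.eLpNorm_lt_top
      rwa [eLpNorm_eq_eLpNorm' (ENNReal.ofReal_pos.2 (by norm_num)).ne' ENNReal.ofReal_ne_top,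
        ENNReal.toReal_ofReal (by norm_num)] at this
    exact (lintegral_rpow_enorm_lt_top_of_eLpNorm'_lt_top (by norm_num) h').ne
  have hφtop : IsSpaceTimeTestOn (⊤ : Opens (ℝ × EuclideanSpace ℝ (Fin 3))) φ :=
    ⟨hφs, hφc, fun _ _ => trivial⟩
  -- integrability of the pieces
  obtain ⟨hIA, hIB, hIP, hID, -, -⟩ :=
    integrableOn_pieces (ν := 1) hz hu hp hf hGm hu3 hp32 hf32 hG2 hφtop hbox h13 ht.le
  -- the four bounds
  have bA := abs_setIntegral_quadratic_le hz hu hε.le hsmall hbox h13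
    (C := C₁ * r ^ 2) (by positivity) hheat ht.le
  have bB := abs_setIntegral_cubic_le (u := u) hn hε.le hC hA hφtop hbox h13
    (fun j hj hjn w hw => (hring j hj hjn w hw).2) (fun w hw => (hcore w hw).2.2) ht.le
  have bD := abs_setIntegral_force_le (p := p) hn hz hq hκ hε.le hC hS hf hu hF hA hφ0 hbox h13
    (fun j hj hjn w hw => (hring j hj hjn w hw).1) (fun w hw => (hcore w hw).2.1) ht.le
  have bP := abs_setIntegral_pressure_le hSP hn hz hu3 hε.le hC hcχ0 hcχ hA hφs hφc hφ0 hbox h13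
    (fun w hw => ⟨(hcore w hw).2.1, (hcore w hw).2.2⟩) hring ht
  -- split the integral
  have e1 : ∫ w in T, localEnergyRHS 1 f u p φ w =
      (∫ w in T, ‖u w.1 w.2‖ ^ 2 * (timeDeriv φ w.1 w.2 + 1 * Δ (φ w.1) w.2)) +
        (∫ w in T, (‖u w.1 w.2‖ ^ 2 + 2 * p w.1 w.2) * ⟪u w.1 w.2, gradient (φ w.1) w.2⟫) +
        ∫ w in T, 2 * ⟪f w.1 w.2, u w.1 w.2⟫ * φ w.1 w.2 := by
    have hIMid : IntegrableOn (fun w : ℝ × EuclideanSpace ℝ (Fin 3) =>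
        (‖u w.1 w.2‖ ^ 2 + 2 * p w.1 w.2) * ⟪u w.1 w.2, gradient (φ w.1) w.2⟫) T volume :=
      (hIB.add (hIP.const_mul 2)).congr_fun (fun w _ => by simp only [Pi.add_apply]; ring) hTm
    have hIAM : IntegrableOn (fun w : ℝ × EuclideanSpace ℝ (Fin 3) =>
        ‖u w.1 w.2‖ ^ 2 * (timeDeriv φ w.1 w.2 + 1 * Δ (φ w.1) w.2) +
          (‖u w.1 w.2‖ ^ 2 + 2 * p w.1 w.2) * ⟪u w.1 w.2, gradient (φ w.1) w.2⟫) T volume := hIA.add hIMid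
    rw [← integral_add hIA hIMid, ← integral_add hIAM hID]
    rfl
  have e2 : ∫ w in T, (‖u w.1 w.2‖ ^ 2 + 2 * p w.1 w.2) * ⟪u w.1 w.2, gradient (φ w.1) w.2⟫ =
      (∫ w in T, ‖u w.1 w.2‖ ^ 2 * ⟪u w.1 w.2, gradient (φ w.1) w.2⟫) +
        2 * ∫ w in T, p w.1 w.2 * ⟪u w.1 w.2, gradient (φ w.1) w.2⟫ := by
    rw [← integral_const_mul, ← integral_add hIB (hIP.const_mul 2)]
    exact integral_congr_ae (Eventually.of_forall fun w => by ring)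
  rw [e1, e2]
  have hκr : 48 * C₁ * κ * (S + 1) * ε₀ ^ (2 / 3 : ℝ) * r ^ 2 = 48 * C₁ * κ * (S + 1) * (ε₀ ^ (2 / 3 : ℝ) * r ^ 2) := by
    ring
  have key : ∀ {x b : ℝ}, |x| ≤ b → x ≤ b := fun h => (le_abs_self _).trans h
  have hBle := key bB
  have hAle := key bA
  have hDle := key bD
  have hPle : 2 * ∫ w in T, p w.1 w.2 * ⟪u w.1 w.2, gradient (φ w.1) w.2⟫ ≤
      2 * (2 * (256 + 136 * cχ) * C₁ * r ^ 2 * ε₀ ^ (2 / 3 : ℝ)) :=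
    mul_le_mul_of_nonneg_left (key bP) zero_le_two
  nlinarith [hAle, hBle, hDle, hPle]

end ClaimR

/-! ### Step 2 assembled -/

section Final

/-- **Step 2 of the induction, proved** from Lemma 15.11 (RRS pp. 221–223 with the force term
of CKN (2.5)): `{(A_k) : 1 ≤ k ≤ n} ⟹ (B_{n+1})` with `C_B = C₁² (39 + 6 (256 + 136 c_χ))`,
`C₁` the constant of Lemma 15.11 and `c_χ` the gradient bound of the cylinder cut-offs, and
`κ(q) = 1 / (48 (S_q + 1))`, `S_q = Σ_{j ≥ 1} 2^{-j(2 - 5/q)}`. The local energy inequality is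
used in its sliced form below the top time `s` (`IsSuitablePair.ae_localEnergy_slice_of_forall_lt`);
the right-hand side is bounded by `setIntegral_localEnergyRHS_le`; the `sup_t` is an essential
supremum and the dissipation term is recovered by letting `t ↑ s`. [cite: RobinsonRodrigoSadowski2016, proof of Thm. 15.3, Step 2, pp. 221–223] -/
theorem step2_force_of_lemma15_11 (h11 : lemma15_11) : step2_force := by
  classical
  obtain ⟨C₁, hC1, hφex⟩ := h11
  obtain ⟨cχ, hcχ0, hcχ⟩ := exists_norm_fderiv_cylCut_le
  have hC0 : 0 ≤ C₁ := zero_le_one.trans hC1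
  set c' : ℝ := 256 + 136 * cχ with hc'
  have hc'0 : 0 ≤ c' := by positivity
  refine ⟨C₁ ^ 2 * (39 + 6 * c'), ?_, fun q hq => ?_⟩
  · have h1 : (1 : ℝ) ≤ C₁ ^ 2 := by nlinarith
    nlinarith
  have hq0 : 0 < q := by linarith
  have he : 0 < 2 - 5 / q := by
    rw [sub_pos, div_lt_iff₀ hq0]; linarith
  obtain ⟨S, hS0, hS⟩ := exists_sum_rad_rpow_le he
  refine ⟨1 / (48 * (S + 1)), by positivity, ?_⟩
  intro z₀ f u p G hSP hfq ε₀ hε hsmall hF z hz n hn hA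
  -- the test function `φ = φ_{n+1}`
  obtain ⟨φ, hφs, hφc, hφ0, hbox, hcore, hring, h13, hheat⟩ := hφex z (n + 1) (by omega)
  set r := rad (n + 1) with hr_def
  have hr : 0 < r := rad_pos _
  set Q1 := parabolicCylinder 1 z₀ with hQ1
  have hQ1fin : volume Q1 < ∞ := (volume_parabolicCylinder_le zero_le_one z₀).trans_lt ENNReal.ofReal_lt_top
  -- primitive data
  have hu : AEStronglyMeasurable (uncurry u) (volume.restrict Q1) :=
    hSP.weakGradient.locallyIntegrableOn.aestronglyMeasurable
  have hp : AEStronglyMeasurable (uncurry p) (volume.restrict Q1) :=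
    hSP.pressure_locallyIntegrableOn.aestronglyMeasurable
  have hf : AEStronglyMeasurable (uncurry f) (volume.restrict Q1) := hfq.aestronglyMeasurable
  have hG2K : ∀ K ⊆ Q1, IsCompact K → ∫⁻ w in K, ENNReal.ofReal (frobeniusNormSq (G w.1 w.2)) < ∞ :=
    fun K hK _ => (lintegral_mono_set hK).trans_lt hSP.gradient_lt_top
  have hGm : AEStronglyMeasurable (fun w : ℝ × EuclideanSpace ℝ (Fin 3) => frobeniusNormSq (G w.1 w.2))
      (volume.restrict Q1) := (locallyIntegrableOn_frobeniusNormSq hSP.weakGradient hG2K).aestronglyMeasurable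
  have hu3 : ∫⁻ w in Q1, ‖u w.1 w.2‖ₑ ^ (3 : ℕ) ≠ ∞ :=
    ne_top_of_le_ne_top ENNReal.ofReal_ne_top ((lintegral_mono fun w => le_self_add).trans hsmall)
  have hp32 : ∫⁻ w in Q1, ‖p w.1 w.2‖ₑ ^ (3 / 2 : ℝ) ≠ ∞ := hSP.pressure_lt_top.ne
  have hG2 : ∫⁻ w in Q1, ENNReal.ofReal (frobeniusNormSq (G w.1 w.2)) ≠ ∞ := hSP.gradient_lt_top.ne
  have hf32 : ∫⁻ w in Q1, ‖f w.1 w.2‖ₑ ^ (3 / 2 : ℝ) ≠ ∞ := by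
    haveI : IsFiniteMeasure (volume.restrict Q1) := ⟨by rw [Measure.restrict_apply_univ]; exact hQ1fin⟩
    have h32 : MemLp (uncurry f) (ENNReal.ofReal (3 / 2)) (volume.restrict Q1) :=
      hfq.mono_exponent (ENNReal.ofReal_le_ofReal (by linarith))
    have h' : eLpNorm' (uncurry f) (3 / 2) (volume.restrict Q1) < ∞ := by
      have := h32.eLpNorm_lt_top
      rwa [eLpNorm_eq_eLpNorm' (ENNReal.ofReal_pos.2 (by norm_num)).ne' ENNReal.ofReal_ne_top,
        ENNReal.toReal_ofReal (by norm_num)] at this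
    exact (lintegral_rpow_enorm_lt_top_of_eLpNorm'_lt_top (by norm_num) h').ne
  have hun : AEStronglyMeasurable (fun w : ℝ × EuclideanSpace ℝ (Fin 3) => ‖u w.1 w.2‖) (volume.restrict Q1) :=
    hu.norm
  have hfn : AEStronglyMeasurable (fun w : ℝ × EuclideanSpace ℝ (Fin 3) => ‖f w.1 w.2‖) (volume.restrict Q1) :=
    hf.norm
  have hu3loc : LocallyIntegrableOn (fun w : ℝ × EuclideanSpace ℝ (Fin 3) => ‖u w.1 w.2‖ ^ 3) Q1 volume :=
    (integrableOn_cube_of_lintegral hu hu3).locallyIntegrableOn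
  have hfu_loc : LocallyIntegrableOn (fun w : ℝ × EuclideanSpace ℝ (Fin 3) => ⟪f w.1 w.2, u w.1 w.2⟫) Q1 volume := by
    have hIuf : IntegrableOn (fun w : ℝ × EuclideanSpace ℝ (Fin 3) => ‖u w.1 w.2‖ * ‖f w.1 w.2‖) Q1 volume :=
      integrableOn_mul_of_L3_L32 (S := Q1) hun hfn (by simpa only [enorm_norm] using hu3)
        (by simpa only [enorm_norm] using hf32)
    have hm : AEStronglyMeasurable (fun w : ℝ × EuclideanSpace ℝ (Fin 3) => ⟪f w.1 w.2, u w.1 w.2⟫)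
        (volume.restrict Q1) := hf.inner hu
    have hI : IntegrableOn (fun w : ℝ × EuclideanSpace ℝ (Fin 3) => ⟪f w.1 w.2, u w.1 w.2⟫) Q1 volume :=
      Integrable.mono' hIuf hm (Eventually.of_forall fun w => by
        rw [mul_comm]; exact norm_inner_le_norm _ _)
    exact hI.locallyIntegrableOn
  have hφtop : IsSpaceTimeTestOn (⊤ : Opens (ℝ × EuclideanSpace ℝ (Fin 3))) φ :=
    ⟨hφs, hφc, fun _ _ => trivial⟩
  have hζQ := tsupport_inter_subset_of_box hz hbox h13
  -- the bound `M` on the right-hand side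
  set M : ℝ := (C₁ + 24 * C₁ + 4 * c' * C₁ + 48 * C₁ * (1 / (48 * (S + 1))) * (S + 1)) *
    ε₀ ^ (2 / 3 : ℝ) * r ^ 2 with hM_def
  have hMeq : M = (26 + 4 * c') * C₁ * ε₀ ^ (2 / 3 : ℝ) * r ^ 2 := by
    rw [hM_def]; field_simp; ring
  have hM0 : 0 ≤ M := by rw [hMeq]; positivity
  have hR : ∀ t < z.1, ∫ w in {w : ℝ × EuclideanSpace ℝ (Fin 3) | w.1 < t}, localEnergyRHS 1 f u p φ w ≤ M :=
    fun t ht => setIntegral_localEnergyRHS_le hSP hq hfq hε hsmall (by positivity) hF hS hz hn hA hC0 hcχ0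
      (hcχ z) hφs hφc hφ0 hbox hcore hring h13 hheat ht
  -- Claim S: the sliced local energy inequality below `s`
  have hslice := hSP.ae_localEnergy_slice_of_forall_lt hu3loc hfu_loc hφtop hφ0 hζQ
  have hmeasS : ∀ t : ℝ, MeasurableSet {w : ℝ × EuclideanSpace ℝ (Fin 3) | w.1 < t} := fun t =>
    measurableSet_lt measurable_fst measurable_const
  have hGφ0 : ∀ w : ℝ × EuclideanSpace ℝ (Fin 3), 0 ≤ frobeniusNormSq (G w.1 w.2) * φ w.1 w.2 := fun w =>
    mul_nonneg (frobeniusNormSq_nonneg _) (hφ0 _ _)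
  have hgood : ∀ᵐ t ∂(volume : Measure ℝ), t < z.1 →
      (∫ x, ‖u t x‖ ^ 2 * φ t x) ≤ M ∧
        ∫ w in {w : ℝ × EuclideanSpace ℝ (Fin 3) | w.1 < t}, frobeniusNormSq (G w.1 w.2) * φ w.1 w.2 ≤ M / 2 := by
    filter_upwards [hslice] with t ht hts
    have h := (ht hts).trans (hR t hts)
    have hE0 : 0 ≤ ∫ x, ‖u t x‖ ^ 2 * φ t x := integral_nonneg fun x => mul_nonneg (sq_nonneg _) (hφ0 _ _)
    have hD0 : 0 ≤ ∫ w in {w : ℝ × EuclideanSpace ℝ (Fin 3) | w.1 < t}, frobeniusNormSq (G w.1 w.2) * φ w.1 w.2 :=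
      setIntegral_nonneg (hmeasS t) fun w _ => hGφ0 w
    constructor <;> nlinarith
  -- integrability of `|G|² φ` and `|u|² φ` below `s`
  obtain ⟨-, -, -, -, hIGφ, hIUφ⟩ :=
    integrableOn_pieces (ν := 1) hz hu hp hf hGm hu3 hp32 hf32 hG2 hφtop hbox h13 (le_refl z.1)
  ------------------------------------------------------------------
  -- (E1) the energy: `cknAEss r z u ≤ C₁ M`
  ------------------------------------------------------------------
  have hslint : ∀ᵐ t ∂(volume : Measure ℝ), t < z.1 → Integrable (fun x => ‖u t x‖ ^ 2 * φ t x) volume := by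
    have hI : Integrable ({w : ℝ × EuclideanSpace ℝ (Fin 3) | w.1 < z.1}.indicator
        fun w : ℝ × EuclideanSpace ℝ (Fin 3) => ‖u w.1 w.2‖ ^ 2 * φ w.1 w.2)
        ((volume : Measure ℝ).prod (volume : Measure (EuclideanSpace ℝ (Fin 3)))) := by
      rw [← Measure.volume_eq_prod]
      exact (integrable_indicator_iff (hmeasS z.1)).2 hIUφ
    filter_upwards [hI.prod_right_ae] with t ht hts
    have e : (fun x => {w : ℝ × EuclideanSpace ℝ (Fin 3) | w.1 < z.1}.indicator
        (fun w : ℝ × EuclideanSpace ℝ (Fin 3) => ‖u w.1 w.2‖ ^ 2 * φ w.1 w.2) (t, x)) =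
        fun x => ‖u t x‖ ^ 2 * φ t x := by
      funext x
      rw [indicator_of_mem (show (t, x) ∈ {w : ℝ × EuclideanSpace ℝ (Fin 3) | w.1 < z.1} from hts)]
    rw [e] at ht
    exact ht
  have hE1 : cknAEss r z u ≤ ENNReal.ofReal (C₁ * M) := by
    rw [cknAEss]
    refine essSup_le_of_ae_le _ ?_
    have h1 := ae_restrict_of_ae (s := Ioo (z.1 - r ^ 2) z.1) hgood
    have h2 := ae_restrict_of_ae (s := Ioo (z.1 - r ^ 2) z.1) hslint
    filter_upwards [h1, h2, ae_restrict_mem measurableSet_Ioo] with t ht1 ht2 htI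
    have hts : t < z.1 := htI.2
    obtain ⟨hEt, -⟩ := ht1 hts
    have hint := ht2 hts
    -- `∫_{B_r} |u(t)|² ≤ C₁ r ∫ |u(t)|² φ(t)`
    have hlow : ∀ x ∈ ball z.2 r, 1 ≤ C₁ * r * φ t x := by
      intro x hx
      have hmem : (t, x) ∈ parabolicCylinder r z := by
        rw [mem_parabolicCylinder]; exact ⟨htI, mem_ball.1 hx⟩
      have h := (hcore (t, x) hmem).1
      have hCr : 0 < C₁ * r := by positivity
      calc (1 : ℝ) = C₁ * r * (C₁⁻¹ * r⁻¹) := by field_simp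
        _ ≤ C₁ * r * φ t x := mul_le_mul_of_nonneg_left h hCr.le
    calc (ENNReal.ofReal r)⁻¹ * ∫⁻ x in ball z.2 r, ‖u t x‖ₑ ^ 2
        ≤ (ENNReal.ofReal r)⁻¹ * ∫⁻ x in ball z.2 r, ‖u t x‖ₑ ^ 2 * ENNReal.ofReal (C₁ * r * φ t x) := by
          refine mul_le_mul_right (setLIntegral_mono' measurableSet_ball fun x hx => ?_) _
          calc ‖u t x‖ₑ ^ 2 = ‖u t x‖ₑ ^ 2 * 1 := (mul_one _).symm
            _ ≤ ‖u t x‖ₑ ^ 2 * ENNReal.ofReal (C₁ * r * φ t x) := by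
                refine mul_le_mul_right ?_ _
                rw [← ENNReal.ofReal_one]
                exact ENNReal.ofReal_le_ofReal (hlow x hx)
      _ ≤ (ENNReal.ofReal r)⁻¹ * ∫⁻ x, ‖u t x‖ₑ ^ 2 * ENNReal.ofReal (C₁ * r * φ t x) :=
          mul_le_mul_right (lintegral_mono' Measure.restrict_le_self le_rfl) _
      _ = (ENNReal.ofReal r)⁻¹ * (ENNReal.ofReal (C₁ * r) * ENNReal.ofReal (∫ x, ‖u t x‖ ^ 2 * φ t x)) := by
          congr 1
          rw [ofReal_integral_eq_lintegral_ofReal hint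
            (Eventually.of_forall fun x => mul_nonneg (sq_nonneg _) (hφ0 _ _)), ← lintegral_const_mul' _ _
            ENNReal.ofReal_ne_top]
          refine lintegral_congr fun x => ?_
          rw [ENNReal.ofReal_mul (by positivity), ENNReal.ofReal_mul (sq_nonneg _),
            ENNReal.ofReal_pow (norm_nonneg _), ofReal_norm]
          ring
      _ ≤ (ENNReal.ofReal r)⁻¹ * (ENNReal.ofReal (C₁ * r) * ENNReal.ofReal M) := by
          gcongr
      _ = ENNReal.ofReal (C₁ * M) := by
          rw [ENNReal.ofReal_mul hC0, mul_comm (ENNReal.ofReal C₁) (ENNReal.ofReal r), mul_assoc,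
            ← mul_assoc, ENNReal.inv_mul_cancel (ENNReal.ofReal_pos.2 hr).ne' ENNReal.ofReal_ne_top, one_mul,
            ← ENNReal.ofReal_mul hC0]
  ------------------------------------------------------------------
  -- (E2) the dissipation: `cknE r z G ≤ C₁ M / 2`
  ------------------------------------------------------------------
  set Ss : Set (ℝ × EuclideanSpace ℝ (Fin 3)) := {w | w.1 < z.1} with hSs
  have hDs : ∫ w in Ss, frobeniusNormSq (G w.1 w.2) * φ w.1 w.2 ≤ M / 2 := by
    set δ : ℕ → ℝ := fun j => 1 / ((j : ℝ) + 1) with hδ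
    have hδ0 : ∀ j, 0 < δ j := fun j => by positivity
    set A : ℕ → Set (ℝ × EuclideanSpace ℝ (Fin 3)) := fun j => {w | w.1 < z.1 - δ j} with hA_def
    have hAm : ∀ j, MeasurableSet (A j) := fun j => measurableSet_lt measurable_fst measurable_const
    have hmono : Monotone A := by
      intro i j hij w hw
      have h : δ j ≤ δ i := by
        simp only [hδ]
        exact one_div_le_one_div_of_le (by positivity) (by exact_mod_cast Nat.add_le_add_right hij 1)
      show w.1 < z.1 - δ j
      exact lt_of_lt_of_le hw (by linarith)
    have hUnion : (⋃ j, A j) = Ss := by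
      ext w
      simp only [mem_iUnion, hA_def, hSs, mem_setOf_eq]
      constructor
      · rintro ⟨j, hj⟩; linarith [hδ0 j]
      · intro hw
        obtain ⟨j, hj⟩ := exists_nat_one_div_lt (show 0 < z.1 - w.1 by linarith)
        exact ⟨j, by simp only [hδ]; linarith⟩
    have hfi : IntegrableOn (fun w : ℝ × EuclideanSpace ℝ (Fin 3) => frobeniusNormSq (G w.1 w.2) * φ w.1 w.2)
        (⋃ j, A j) volume := by rw [hUnion]; exact hIGφ
    have htends := tendsto_setIntegral_of_monotone hAm hmono hfi
    rw [hUnion] at htends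
    refine le_of_tendsto' htends fun j => ?_
    -- a good time in `(s - δ j, s)`
    have hex : ∃ t ∈ Ioo (z.1 - δ j) z.1,
        ∫ w in {w : ℝ × EuclideanSpace ℝ (Fin 3) | w.1 < t}, frobeniusNormSq (G w.1 w.2) * φ w.1 w.2 ≤ M / 2 := by
      by_contra hne
      push Not at hne
      have hsub : Ioo (z.1 - δ j) z.1 ⊆ {t | ¬(t < z.1 →
          (∫ x, ‖u t x‖ ^ 2 * φ t x) ≤ M ∧
            ∫ w in {w : ℝ × EuclideanSpace ℝ (Fin 3) | w.1 < t}, frobeniusNormSq (G w.1 w.2) * φ w.1 w.2 ≤ M / 2)} := by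
        intro t ht hgood'
        exact (not_le.2 (hne t ht)) (hgood' ht.2).2
      have h0 : volume (Ioo (z.1 - δ j) z.1) = 0 := measure_mono_null hsub (ae_iff.1 hgood)
      rw [Real.volume_Ioo] at h0
      have : (0 : ℝ≥0∞) < ENNReal.ofReal (z.1 - (z.1 - δ j)) := ENNReal.ofReal_pos.2 (by linarith [hδ0 j])
      exact this.ne' h0
    obtain ⟨t, htI, htb⟩ := hex
    calc ∫ w in A j, frobeniusNormSq (G w.1 w.2) * φ w.1 w.2
        ≤ ∫ w in {w : ℝ × EuclideanSpace ℝ (Fin 3) | w.1 < t}, frobeniusNormSq (G w.1 w.2) * φ w.1 w.2 := by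
          refine setIntegral_mono_set (hIGφ.mono_set fun w hw => lt_trans hw htI.2)
            (Eventually.of_forall fun w => hGφ0 w) (LE.le.eventuallyLE (show A j ≤ {w : ℝ × EuclideanSpace ℝ (Fin 3) | w.1 < t} from fun w hw => ?_))
          exact lt_trans hw htI.1
      _ ≤ M / 2 := htb
  have hE2 : cknE r z G ≤ ENNReal.ofReal (C₁ * M / 2) := by
    rw [cknE]
    have hQm : MeasurableSet (parabolicCylinder r z) := (isOpen_parabolicCylinder r z).measurableSet
    have hsubS : parabolicCylinder r z ⊆ Ss := fun w hw => ((mem_parabolicCylinder.1 hw).1).2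
    calc (ENNReal.ofReal r)⁻¹ * ∫⁻ w in parabolicCylinder r z, ENNReal.ofReal (frobeniusNormSq (G w.1 w.2))
        ≤ (ENNReal.ofReal r)⁻¹ * ∫⁻ w in parabolicCylinder r z,
            ENNReal.ofReal (C₁ * r) * ENNReal.ofReal (frobeniusNormSq (G w.1 w.2) * φ w.1 w.2) := by
          refine mul_le_mul_right (setLIntegral_mono' hQm fun w hw => ?_) _
          rw [← ENNReal.ofReal_mul (by positivity)]
          refine ENNReal.ofReal_le_ofReal ?_
          have h := (hcore w hw).1
          have hCr : 0 < C₁ * r := by positivity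
          have hG0 := frobeniusNormSq_nonneg (G w.1 w.2)
          calc frobeniusNormSq (G w.1 w.2) = (C₁ * r * (C₁⁻¹ * r⁻¹)) * frobeniusNormSq (G w.1 w.2) := by
                field_simp
            _ ≤ (C₁ * r * φ w.1 w.2) * frobeniusNormSq (G w.1 w.2) :=
                mul_le_mul_of_nonneg_right (mul_le_mul_of_nonneg_left h hCr.le) hG0
            _ = C₁ * r * (frobeniusNormSq (G w.1 w.2) * φ w.1 w.2) := by ring
      _ ≤ (ENNReal.ofReal r)⁻¹ * ∫⁻ w in Ss,
            ENNReal.ofReal (C₁ * r) * ENNReal.ofReal (frobeniusNormSq (G w.1 w.2) * φ w.1 w.2) :=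
          mul_le_mul_right (lintegral_mono_set hsubS) _
      _ = (ENNReal.ofReal r)⁻¹ * (ENNReal.ofReal (C₁ * r) *
            ENNReal.ofReal (∫ w in Ss, frobeniusNormSq (G w.1 w.2) * φ w.1 w.2)) := by
          rw [lintegral_const_mul' _ _ ENNReal.ofReal_ne_top,
            ofReal_integral_eq_lintegral_ofReal hIGφ (Eventually.of_forall fun w => hGφ0 w)]
      _ ≤ (ENNReal.ofReal r)⁻¹ * (ENNReal.ofReal (C₁ * r) * ENNReal.ofReal (M / 2)) := by
          gcongr
      _ = ENNReal.ofReal (C₁ * M / 2) := by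
          rw [ENNReal.ofReal_mul hC0, mul_comm (ENNReal.ofReal C₁) (ENNReal.ofReal r), mul_assoc,
            ← mul_assoc, ENNReal.inv_mul_cancel (ENNReal.ofReal_pos.2 hr).ne' ENNReal.ofReal_ne_top, one_mul,
            ← ENNReal.ofReal_mul hC0]
          congr 1; ring
  ------------------------------------------------------------------
  -- (B_{n+1})
  ------------------------------------------------------------------
  show cknAEss r z u + cknE r z G ≤ ENNReal.ofReal (C₁ ^ 2 * (39 + 6 * c') * ε₀ ^ (2 / 3 : ℝ) * r ^ 2)
  calc cknAEss r z u + cknE r z G ≤ ENNReal.ofReal (C₁ * M) + ENNReal.ofReal (C₁ * M / 2) := add_le_add hE1 hE2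
    _ = ENNReal.ofReal (C₁ ^ 2 * (39 + 6 * c') * ε₀ ^ (2 / 3 : ℝ) * r ^ 2) := by
        rw [← ENNReal.ofReal_add (by positivity) (by positivity)]
        congr 1
        rw [hMeq]
        ring

/-- **Step 2 of the induction holds** (`RRS2016.step2_force`), by `step2_force_of_lemma15_11` and
the proved Lemma 15.11 (`lemma15_11_holds`). [cite: RobinsonRodrigoSadowski2016, proof of Thm. 15.3, Step 2, pp. 221–223] -/
theorem step2_force_holds : step2_force :=
  step2_force_of_lemma15_11 lemma15_11_holds

/-- **Theorem 15.3 with force, from the local pressure estimate alone**: Steps 1–4 are now all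
proved, so `lemma15_12 → theorem15_3_force`. [cite: RobinsonRodrigoSadowski2016, Thm. 15.3 pp. 220–226] -/
theorem theorem15_3_force_of_lemma15_12 (h12 : lemma15_12) : theorem15_3_force :=
  theorem15_3_force_of_step2 step2_force_holds h12

/-- **Theorem 15.3 (RRS), from the local pressure estimate alone.** [cite: RobinsonRodrigoSadowski2016, Thm. 15.3 p. 220] -/
theorem theorem15_3_of_lemma15_12 (h12 : lemma15_12) : theorem15_3 :=
  theorem15_3_of_force (theorem15_3_force_of_lemma15_12 h12)

end Final

end RRS2016

end Literature.Analysis.FluidPDE
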